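/-
Literature/AlgebraicGeometry/Pohlmann1968/DegenerateCMTypesAbelianCMFieldExponentTwoOddPrimes.lean — pub-hodgecm2 (COR-CM), KEPT
Literature lane lit-deligne-3 gen 65, file F65a.  THEOREMS ONLY (no `def`, no named fact, no `sorry`, no instance, no notation;
D-0026 net debt 0).  HC_CM is NOT proved.
-/
import Literature.AlgebraicGeometry.Pohlmann1968.DegenerateCMTypesAbelianCMFieldExponentFourTimesPrime
import Literature.NumberTheory.ComplexMultiplication.DegenerateCMTypesAbelianKernelsIndexTwoOddPrimes
import HarnessLib

/-!
# ABELIAN CM fields with Galois group of EXPONENT `2pq` (`(ℤ/2)^r × (ℤ/p)^s × (ℤ/q)^t`, `p ≠ q` odd primes): the rank of every CM type is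
# `[K:ℚ]/2 + 1 − b − (p−1)·e_{2p} − (q−1)·e_{2q} − (p−1)(q−1)·s_{2pq}` — `s_{2pq}` the CM subfields of degree `2pq` over which the type is
# ADDITIVELY SEPARABLE; the nondegeneracy criterion; the Hodge conjecture for all powers off the four lists; `ℚ(ζ₇₇), ℚ(ζ₉₃), ℚ(ζ₉₉), ℚ(ζ₁₂₄)`

Topic `Literature/AlgebraicGeometry/Pohlmann1968` (namespace `Literature.AlgebraicGeometry.Pohlmann1968.ExponentTwoOddPrimes`); cell `pub-hodgecm2`
(COR-CM), KEPT Literature lane `lit-deligne-3` gen 65 (file F65a: the TWO-ODD-PRIMES programme for NON-cyclic groups — g64 outlook item 1 — the field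
file over the lane's index-`2pq` kernel decision F64i).  KERNEL ONLY: theorems; no `def`, no named fact, no instance, no notation (D-0014 ∕ D-0026 net
debt `0`).  HC_CM is NOT proved here or anywhere in the lane.

## Mathematics

T. Kubota [Kubota1965], §4 LEMMA 2: for a CM field `K` abelian over `ℚ` with group `G ∋ ρ`, the DEFECT `[K:ℚ]/2 + 1 − Rank(Φ)` of a CM type `Φ`
is the number of ODD characters `χ` of `G` with `χ(S) = 0`, `S = {g : σ_g ∈ Φ}`; grouped by KERNEL (White's proof of his Lemma 3; tree
`AbelianKernels.typeRank_add_sum_totient_eq`: `rank(S) + Σ_H φ([G:H]) = |G|/2 + 1` over the admissible kernels `H ∌ ρ`, `G/H` cyclic, whose characters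
vanish on `S`).  If `g^{2pq} = 1` on `G` (`p ≠ q` odd primes: TWO odd primes in the exponent, `2`-part of exponent `2`), an admissible kernel has index
`2`, `2p`, `2q` or `2pq` (`index_eq_of_isCyclic_quotient`) and conversely every subgroup of these indices has cyclic quotient (squarefree order), and each
index is DECIDED by the tree: `2` — `S` splits evenly (Weil type over the imaginary quadratic `K^H`, [Dodson1984] §3.1.1); `2p`, `2q` — `S`
EQUIDISTRIBUTED along the `p`- (resp. `q`-) torsion of `G/H` (Hazama's Lemma 4.6.1 mechanism [Hazama2003CyclicCM]); `2pq` — the coset counts of `S`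
ADDITIVELY SEPARABLE along `ℤ/p × ℤ/q ⊂ G/H`: `#(S ∩ gH) + #(S ∩ gxyH) = #(S ∩ gxH) + #(S ∩ gyH)` for `x^p, y^q ∈ H` (the lane's F64i
`…separable_of_index_two_mul_odd_primes`: the `ℤ`-relations among `pq`-th roots of unity, [Hazama2003CyclicCM] (4.6) with multiplicities).  Hence

  `Rank(Φ) + b(Φ) + (p − 1)·e_{2p}(Φ) + (q − 1)·e_{2q}(Φ) + (p − 1)(q − 1)·s_{2pq}(Φ) = [K:ℚ]/2 + 1`

with `b` = the imaginary quadratic subfields over which `Φ` is of Weil type, `e_{2p}` (`e_{2q}`) = the CM subfields `F` of degree `2p` (`2q`) over which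
`Φ` is LEVEL of exponent `p` (`q`) — `#{φ ∈ Φ : φ|_F = τ ∘ σ} = #{φ ∈ Φ : φ|_F = τ}` for `σ^p = 1` — and `s_{2pq}` = the CM subfields `F` of degree `2pq`
over which `Φ` is ADDITIVELY SEPARABLE: `n(τ) + n(τ ∘ σσ') = n(τ ∘ σ) + n(τ ∘ σ')` for all `τ : F → ℂ`, `σ^p = 1`, `σ'^q = 1` in `Gal(F/ℚ) ≅ ℤ/2pq`,
`n(τ') = #{φ ∈ Φ : φ|_F = τ'}` (no interaction term between the `p`- and the `q`-direction; for the CYCLIC `K` of degree `2pq` itself, `n ∈ {0,1}` and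
separability is Hazama's «induced from `K^{ℤ/p}` or from `K^{ℤ/q}`», tree `CyclicTwoOddPrimes`).  The one-odd-prime files are the neighbours
`ExponentTwicePrime` (`2p`), `ExponentFourTimesPrime` (`4p`), … (lane gen 64).

* §1 GROUP LEVEL (`G` commutative, `g^{2pq} = 1`, `ρ`, `T ⊔ ρT = G`): private `isCyclic_of_card_eq_two_mul{,_mul}`, **`index_eq_of_isCyclic_quotient`**,
  **`typeRank_add_card_kernels_eq`** (`rank(T) + #B₂ + (p−1)·#B_{2p} + (q−1)·#B_{2q} + (p−1)(q−1)·#S_{2pq} = |G|/2 + 1`; Euler's `φ` on the admissible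
  kernels as an indicator combination), **`typeRank_eq_iff`** (nondegenerate iff all four families are empty).
* §2 FIELD LEVEL (`K` CM, `IsAbelianGalois ℚ K`, `g^{2pq} = 1` on `Gal(K/ℚ)`): `cmTypeRank_add_card_kernels_eq` (on `Gal`), `isNondegenerate_iff`;
  §2b THE READING ON SUBFIELDS: **`forall_card_filter_add_eq_iff_separable`** (additive separability of the coset counts at `Gal(K/F)` ⟺ `Φ` additively
  separable over `F`), **`card_index_eq_ncard_separable`** (the separable index-`2pq` kernels ARE the CM subfields of degree `2pq` over which `Φ` is
  additively separable), **`cmTypeRank_add_ncard_subfields_eq`** (THE INTRINSIC RANK FORMULA, the level terms by the neighbour's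
  `ExponentTwicePrime.card_index_eq_ncard_level`), **`isNondegenerate_iff_forall_intermediateField`** (NONDEGENERATE ⟺ Weil type over NO imaginary
  quadratic subfield ∧ level over NO CM subfield of degree `2p` or `2q` ∧ additively separable over NO CM subfield of degree `2pq`).
* §3 ABELIAN VARIETIES: for every realisation `(A, ι, θ)` of a type off the four lists, `B•(Aⁿ) ⊗ ℂ = D•(Aⁿ) ⊗ ℂ` and the Hodge conjecture for every
  power (`hodgeClassSpan_pow_eq_divisorClassesSpan_of_forall_intermediateField`, **`hodgeConjectureFor_pow_of_forall_intermediateField`**,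
  `not_exists_exceptional_pow_of_forall_intermediateField`) — UNCONDITIONAL (Hazama's criterion ∕ Pohlmann, tree
  `IsNondegenerate.hodgeClassSpan_pow_eq_divisorClassesSpan`); conversely `not_isNondegenerate_of_separable`, `not_isNondegenerate_of_level`.
* §4 CYCLOTOMIC FIELDS `ℚ(ζ_N)` with `u^{2pq} = 1` on `(ℤ/N)ˣ` (`cmTypeRank_add_ncard_subfields_eq_of_isCyclotomicExtension`,
  `isNondegenerate_iff_of_isCyclotomicExtension`, `hodgeConjectureFor_pow_of_forall_of_isCyclotomicExtension`); the «φ(N) = 60» levels of exponent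
  `30 = 2·3·5`: `77, 99` (`(ℤ/N)ˣ ≅ ℤ/6 × ℤ/10`) and `93, 124` (`ℤ/2 × ℤ/30`): `units_pow_thirty_*` (`decide +kernel` on residues),
  **`cmTypeRank_add_ncard_subfields_*`** (`Rank(Φ) + b + 2·e₆ + 4·e₁₀ + 8·s₃₀ = 31` for EVERY CM type of `ℚ(ζ_N)`, CM `30`-folds),
  **`hodgeConjectureFor_pow_of_forall_*`** (in the level statements `σ³ = AlgEquiv.refl` spells `σ³ = 1`, keeping instance search off the cyclotomic
  tower).  The cyclic levels `61, 122` of the band have exponent `60 = 4·15` and await the index-`4pq` kernel decision.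
  APPENDED (gen 65): the levels of exponent `42 = 2·3·7` — `43, 49` (`(ℤ/N)ˣ ≅ ℤ/42` CYCLIC, `φ = 42`; on these F65a and the tree's
  `CyclicTwoOddPrimes` overlap, the separable subfield of degree `42` being `K` itself) and the «φ(N) = 84» band `129, 147, 172, 196`
  (`ℤ/2 × ℤ/42`): `units_pow_fortyTwo_*`, **`cmTypeRank_add_ncard_subfields_*`** (`Rank + b + 2e₆ + 6e₁₄ + 12s₄₂ = 22` resp. `43`),
  `hodgeConjectureFor_pow_of_forall_*` (CM `21`- resp. `42`-folds).
  APPENDED (gen 65, 2): the remaining levels of exponent `30` with `N ≢ 2 (mod 4)` — the «φ(N) = 120» levels `231, 308, 396`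
  (`ℤ/2 × ℤ/6 × ℤ/10`) and `248, 372` (`(ℤ/2)² × ℤ/30`) (`Rank + b + 2e₆ + 4e₁₀ + 8s₃₀ = 61`, CM `60`-folds; with the exponent-`60` levels `143, 155,
  175, 183, 225, 244` of `ExponentFourTimesTwoOddPrimes` this is the whole «φ = 120» band off `N ≡ 2 (mod 4)`) and the «φ(N) = 180» levels of
  exponent `30`: `217, 279` (`ℤ/6 × ℤ/30`; `= 91`, CM `90`-folds): `units_pow_thirty_*`, **`cmTypeRank_add_ncard_subfields_*`**,
  `hodgeConjectureFor_pow_of_forall_*`.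

PRESEARCH (lane rule): the displayed formula ∕ criterion was not found in print as such — corpus hybrid «rank of CM type abelian CM field exponent 2pq
additively separable» (hits: Deligne–Milne–Ogus–Shih LNM 900 pp. 53–55, Green–Griffiths–Kerr p. 21, Lang *Cyclotomic Fields* p. 106: Kubota rank and
nondegenerate types, no such formula), corpus vector (same books), galaxy «degenerate CM type | nondegenerate CM-type | rank of a CM type» (all stars: 0
relevant) — it is Kubota's Lemma 2 regrouped by kernels (White) with Dodson's index-`2`, Hazama's index-`2p` and the `pq`-relation criteria, read through
the Galois correspondence (Yanai); recorded as the lane's own elementary theorem with those citations.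

HONEST REGISTER.  Everything here is unconditional and elementary given the tree's Kubota ∕ Hazama ∕ Pohlmann theorems and the lane's F64i.  Nothing is
claimed for the DEGENERATE types (`b + e_{2p} + e_{2q} + s_{2pq} > 0`): for them `Bᵐ ⊋ Dᵐ` in some degree and the Hodge conjecture is OPEN in print
beyond the known Weil-type cases; no census numerics are asserted (`2³⁰` types per level).  HC_CM is NOT proved and not used.

## References

* [Kubota1965] T. Kubota, *On the field extension by complex multiplication*, Trans. AMS 118 (1965), §4 Lemma 2.
* [White1993SporadicCycles] S. P. White, *Sporadic cycles on CM abelian varieties*, Compositio Math. 88 (1993), §4, proof of Lemma 3 (p. 131).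
* [Dodson1984] B. Dodson, *The structure of Galois groups of CM-fields*, Trans. AMS 283 (1984), §3.1.1 Theorem, §3.2.1.
* [Hazama2003CyclicCM] F. Hazama, *Hodge cycles on abelian varieties with complex multiplication by cyclic CM-fields*, J. Math. Sci. Univ. Tokyo 10
  (2003): (4.1), Prop. 4.1, Prop. 4.3, Lemma 4.6.1 with (4.6), Thm. 4.8.
* [Yanai2015IndexDegeneracy] H. Yanai, *On the index of degeneracy of a CM-type*, Thm. 4.1 (proof, p. 818).
* [Gordon1999HodgeAVSurvey] B. B. Gordon, *A survey of the Hodge conjecture for abelian varieties*, 5.13 (ii), Thm. 6.4, §9.3, 9.4.1.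
* [MilneFT2022] J. S. Milne, *Fields and Galois Theory*, Thm. 3.16–3.17 (Galois correspondence).
* [Shimura1998] G. Shimura, *Abelian Varieties with Complex Multiplication and Modular Functions*, §8.1, §18.2.
* [Washington1997] L. C. Washington, *Introduction to Cyclotomic Fields*, Ch. 2, Thm. 2.5.
* [Deligne2000] P. Deligne, *The Hodge conjecture* (Clay, 2000), §1.

## Provenance

Cell `pub-hodgecm2` (COR-CM), KEPT Literature lane `lit-deligne-3` gen 65 (claim ABELIAN-EXPONENT-2PQ-RANK-FORMULA; count-neutral, own lane), file F65a;
neighbours cited by name, nothing restated: `DegenerateCMTypesAbelianKernels` (group level), `DegenerateCMTypesAbelianKernelsIndexTwoOddPrimes` (F64i, the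
index-`2pq` decision), `DegenerateCMTypesAbelianCMFieldCyclicSubfields` (the kernel ↔ subfield dictionary), `DegenerateCMTypesAbelianCMFieldExponentTwicePrime`
(F64a: `forall_card_filter_eq_iff_level`, `card_index_eq_ncard_level`), `DegenerateCMTypesAbelianCMFieldExponentFourTimesPrime` (F64b-2:
`cm_abelian_pow_eq_one_of_isCyclotomicExtension`), `NondegenerateCMTypeDivisorClasses` (`IsNondegenerate.hodgeClassSpan_pow_eq_divisorClassesSpan`).  The
`[folklore]` helpers and the two dictionary helpers (copies of F64a's private ones) are private.  Theorems only; net Literature debt 0.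
-/

noncomputable section

open scoped BigOperators NumberField IsMulCommutative Classical
open NumberField IntermediateField

namespace Literature.AlgebraicGeometry.Pohlmann1968

namespace ExponentTwoOddPrimes

open Literature.NumberTheory.ComplexMultiplication
open Literature.NumberTheory.ComplexMultiplication.CMNumbers
open Literature.AlgebraicGeometry.Motives (CMType)
open Literature.AlgebraicGeometry.Pohlmann1968.CyclicTwoOddPrimes (isCMTypeWith_galType cmTypeRank_eq_typeRank_galType)
open Literature.AlgebraicGeometry.Pohlmann1968.AbelianKernels
open Literature.AlgebraicGeometry.Pohlmann1968.ExponentTwicePrime (forall_card_filter_eq_iff_level card_index_eq_ncard_level)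
open Literature.AlgebraicGeometry.Pohlmann1968.ExponentFourTimesPrime (cm_abelian_pow_eq_one_of_isCyclotomicExtension)

/-! ## §1 Group level: in exponent `2pq` every admissible kernel has index `2`, `2p`, `2q` or `2pq`, and each is decided -/

section Group

variable {G : Type*} [CommGroup G] {p q : ℕ}

/-- A commutative group of order `2p` (`p` an odd prime) is cyclic. [folklore] -/
private theorem isCyclic_of_card_eq_two_mul [Finite G] [hp : Fact p.Prime] (hp2 : p ≠ 2) (hG : Nat.card G = 2 * p) :
    IsCyclic G := by
  haveI : Fact (Nat.Prime 2) := ⟨Nat.prime_two⟩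
  obtain ⟨x, hx⟩ := exists_prime_orderOf_dvd_card' (G := G) 2 (by rw [hG]; exact dvd_mul_right 2 p)
  obtain ⟨y, hy⟩ := exists_prime_orderOf_dvd_card' (G := G) p (by rw [hG]; exact dvd_mul_left p 2)
  have hcop : Nat.Coprime (orderOf x) (orderOf y) := by
    rw [hx, hy]; exact (Nat.coprime_primes Nat.prime_two hp.out).2 hp2.symm
  exact isCyclic_of_orderOf_eq_card (x * y)
    (by rw [(Commute.all x y).orderOf_mul_eq_mul_orderOf_of_coprime hcop, hx, hy, hG])

/-- A commutative group of order `2pq` (`p ≠ q` odd primes) is cyclic: elements of orders `2`, `p`, `q` multiply to a generator.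
[folklore] -/
private theorem isCyclic_of_card_eq_two_mul_mul [Finite G] [hp : Fact p.Prime] [hq : Fact q.Prime] (hpq : p ≠ q)
    (hp2 : p ≠ 2) (hq2 : q ≠ 2) (hG : Nat.card G = 2 * (p * q)) : IsCyclic G := by
  haveI : Fact (Nat.Prime 2) := ⟨Nat.prime_two⟩
  obtain ⟨x, hx⟩ := exists_prime_orderOf_dvd_card' (G := G) 2 (by rw [hG]; exact dvd_mul_right 2 _)
  obtain ⟨y, hy⟩ := exists_prime_orderOf_dvd_card' (G := G) p
    (by rw [hG]; exact Dvd.dvd.mul_left (dvd_mul_right p q) 2)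
  obtain ⟨z, hz⟩ := exists_prime_orderOf_dvd_card' (G := G) q
    (by rw [hG]; exact Dvd.dvd.mul_left (dvd_mul_left q p) 2)
  have hcop : Nat.Coprime (orderOf x) (orderOf y) := by
    rw [hx, hy]; exact (Nat.coprime_primes Nat.prime_two hp.out).2 hp2.symm
  have hxy : orderOf (x * y) = 2 * p := by
    rw [(Commute.all x y).orderOf_mul_eq_mul_orderOf_of_coprime hcop, hx, hy]
  have hcop' : Nat.Coprime (orderOf (x * y)) (orderOf z) := by
    rw [hxy, hz]
    exact Nat.Coprime.mul_left ((Nat.coprime_primes Nat.prime_two hq.out).2 hq2.symm)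
      ((Nat.coprime_primes hp.out hq.out).2 hpq)
  exact isCyclic_of_orderOf_eq_card (x * y * z)
    (by rw [(Commute.all (x * y) z).orderOf_mul_eq_mul_orderOf_of_coprime hcop', hxy, hz, hG]; ring)

/-- **In a commutative group with `g^{2pq} = 1` for all `g` (`p ≠ q` odd primes), a subgroup `H` missing an involution `ρ` and with
CYCLIC quotient `G/H` has index `2`, `2p`, `2q` or `2pq`**: `|G/H|` divides the exponent `2pq` and is even (`ρ̄` has order `2`).
Kubota's admissible kernels of `(ℤ/2)^r × (ℤ/p)^s × (ℤ/q)^t` are its subgroups `H ∌ ρ` of these four indices.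
[cite: Kubota1965, §4 Lemma 2] [cite: White1993SporadicCycles, §4, proof of Lemma 3 (p. 131)] -/
theorem index_eq_of_isCyclic_quotient [hp : Fact p.Prime] [hq : Fact q.Prime] (hp2 : p ≠ 2) (hq2 : q ≠ 2)
    (hexp : ∀ g : G, g ^ (2 * (p * q)) = 1) {H : Subgroup G} {ρ : G} (hρH : ρ ∉ H) (hρ2 : ρ * ρ = 1)
    (hcyc : IsCyclic (G ⧸ H)) :
    H.index = 2 ∨ H.index = 2 * p ∨ H.index = 2 * q ∨ H.index = 2 * (p * q) := by
  haveI := hcyc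
  have hdvd : H.index ∣ 2 * (p * q) := by
    rw [Subgroup.index_eq_card, ← IsCyclic.exponent_eq_card]
    exact Monoid.exponent_dvd_of_forall_pow_eq_one fun x => QuotientGroup.induction_on x fun g => by
      rw [← QuotientGroup.mk_pow, hexp, QuotientGroup.mk_one]
  have hρ1 : (ρ : G ⧸ H) ≠ 1 := fun h => hρH ((QuotientGroup.eq_one_iff ρ).1 h)
  have hord : orderOf (ρ : G ⧸ H) = 2 := by
    haveI : Fact (Nat.Prime 2) := ⟨Nat.prime_two⟩
    refine orderOf_eq_prime ?_ hρ1
    rw [pow_two, ← QuotientGroup.mk_mul, hρ2, QuotientGroup.mk_one]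
  have h2 : 2 ∣ H.index := by rw [Subgroup.index_eq_card, ← hord]; exact orderOf_dvd_natCard _
  obtain ⟨m, hm⟩ := h2
  have hmdvd : m ∣ p * q := Nat.dvd_of_mul_dvd_mul_left (by norm_num) (hm ▸ hdvd)
  obtain ⟨d₁, d₂, hd₁, hd₂, hdeq⟩ := Nat.dvd_mul.1 hmdvd
  rcases (Nat.dvd_prime hp.out).1 hd₁ with rfl | rfl <;>
    rcases (Nat.dvd_prime hq.out).1 hd₂ with rfl | rfl
  · left; rw [hm, ← hdeq]
  · right; right; left; rw [hm, ← hdeq, one_mul]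
  · right; left; rw [hm, ← hdeq, mul_one]
  · right; right; right; rw [hm, ← hdeq]

variable [Fintype G] [DecidableEq G]

/-- **THE RANK OF A CM TYPE IN EXPONENT `2pq` (group level).**  Let `G` be a finite commutative group with `g^{2pq} = 1` for all `g`
(`p ≠ q` odd primes; `G ≅ (ℤ/2)^r × (ℤ/p)^s × (ℤ/q)^t`), `ρ ∈ G` and `T` a CM type (`T ⊔ ρT = G`).  Then

  `rank(T) + #B₂ + (p − 1)·#B_{2p} + (q − 1)·#B_{2q} + (p − 1)(q − 1)·#S_{2pq} = |G|/2 + 1`,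

where `B₂` is the set of index-`2` subgroups `H ∌ ρ` splitting `T` evenly (`#(T ∩ H) = #(T ∖ H)`), `B_{2p}` (resp. `B_{2q}`) the set of
index-`2p` (resp. `2q`) subgroups `H ∌ ρ` at which `T` is EQUIDISTRIBUTED (`#(T ∩ gxH) = #(T ∩ gH)` for all `g` and all `x` with `x^p ∈ H`,
resp. `x^q ∈ H`), and `S_{2pq}` the set of index-`2pq` subgroups `H ∌ ρ` at which the coset counts of `T` are ADDITIVELY SEPARABLE along the
odd part of `G/H` (`#(T ∩ gH) + #(T ∩ gxyH) = #(T ∩ gxH) + #(T ∩ gyH)` for all `g`, `x^p ∈ H`, `y^q ∈ H`).  Kubota's defect `Σ_H φ([G:H])`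
over the admissible kernels (tree `AbelianKernels.typeRank_add_sum_totient_eq`): every admissible kernel has index `2` (`φ = 1`, decided by
even splitting, tree `…iff_of_index_two`), `2p` or `2q` (`φ = p − 1`, `q − 1`; equidistribution, Hazama's Lemma 4.6.1 mechanism, tree
`…equidistributed_of_index`) or `2pq` (`φ = (p−1)(q−1)`; additive separability, the lane's `…separable_of_index_two_mul_odd_primes`), and a
commutative group of order `2p`, `2q`, `2pq` is cyclic, so EVERY subgroup `H ∌ ρ` of these indices is admissible.  The one-odd-prime case is the
neighbour `ExponentTwicePrime.typeRank_add_card_add_mul_card_eq`. [cite: Kubota1965, §4 Lemma 2]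
[cite: Hazama2003CyclicCM, Prop. 4.1, Prop. 4.3, Lemma 4.6.1 and Thm. 4.8] [cite: Dodson1984, §3.1.1 Theorem] -/
theorem typeRank_add_card_kernels_eq [hp : Fact p.Prime] [hq : Fact q.Prime] (hpq : p ≠ q) (hp2 : p ≠ 2) (hq2 : q ≠ 2)
    {ρ : G} {T : Finset G} (h : IsCMTypeWith ρ (T : Set G)) (hexp : ∀ g : G, g ^ (2 * (p * q)) = 1) :
    typeRank G (T : Set G) +
      ((Finset.univ : Finset (Subgroup G)).filter fun H => ρ ∉ H ∧ H.index = 2 ∧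
        (T.filter fun s => s ∈ H).card = (T.filter fun s => s ∉ H).card).card +
      (p - 1) * ((Finset.univ : Finset (Subgroup G)).filter fun H => ρ ∉ H ∧ H.index = 2 * p ∧
        ∀ x : G, x ^ p ∈ H → ∀ g : G,
          (T.filter fun s => (g * x)⁻¹ * s ∈ H).card = (T.filter fun s => g⁻¹ * s ∈ H).card).card +
      (q - 1) * ((Finset.univ : Finset (Subgroup G)).filter fun H => ρ ∉ H ∧ H.index = 2 * q ∧
        ∀ x : G, x ^ q ∈ H → ∀ g : G,
          (T.filter fun s => (g * x)⁻¹ * s ∈ H).card = (T.filter fun s => g⁻¹ * s ∈ H).card).card +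
      (p - 1) * (q - 1) * ((Finset.univ : Finset (Subgroup G)).filter fun H => ρ ∉ H ∧ H.index = 2 * (p * q) ∧
        ∀ g x y : G, x ^ p ∈ H → y ^ q ∈ H →
          (T.filter fun s => g⁻¹ * s ∈ H).card + (T.filter fun s => (g * x * y)⁻¹ * s ∈ H).card =
            (T.filter fun s => (g * x)⁻¹ * s ∈ H).card + (T.filter fun s => (g * y)⁻¹ * s ∈ H).card).card =
      Fintype.card G / 2 + 1 := by
  have hρ2 : ρ * ρ = 1 := by simpa [smul_eq_mul] using h.invol (1 : G)
  have key := CyclicCMType.AbelianKernels.typeRank_add_sum_totient_eq h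
  set A := (Finset.univ : Finset (Subgroup G)).filter (fun H => ρ ∉ H ∧ IsCyclic (G ⧸ H) ∧
    ∀ χ : AddChar (Additive G) ℂ, (∀ g : G, χ (Additive.ofMul g) = 1 ↔ g ∈ H) →
      ∑ s ∈ T, χ (Additive.ofMul s) = 0) with hA
  set B₂ := (Finset.univ : Finset (Subgroup G)).filter (fun H => ρ ∉ H ∧ H.index = 2 ∧
    (T.filter fun s => s ∈ H).card = (T.filter fun s => s ∉ H).card) with hB₂
  set Bp := (Finset.univ : Finset (Subgroup G)).filter (fun H => ρ ∉ H ∧ H.index = 2 * p ∧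
    ∀ x : G, x ^ p ∈ H → ∀ g : G,
      (T.filter fun s => (g * x)⁻¹ * s ∈ H).card = (T.filter fun s => g⁻¹ * s ∈ H).card) with hBp
  set Bq := (Finset.univ : Finset (Subgroup G)).filter (fun H => ρ ∉ H ∧ H.index = 2 * q ∧
    ∀ x : G, x ^ q ∈ H → ∀ g : G,
      (T.filter fun s => (g * x)⁻¹ * s ∈ H).card = (T.filter fun s => g⁻¹ * s ∈ H).card) with hBq
  set Bpq := (Finset.univ : Finset (Subgroup G)).filter (fun H => ρ ∉ H ∧ H.index = 2 * (p * q) ∧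
    ∀ g x y : G, x ^ p ∈ H → y ^ q ∈ H →
      (T.filter fun s => g⁻¹ * s ∈ H).card + (T.filter fun s => (g * x * y)⁻¹ * s ∈ H).card =
        (T.filter fun s => (g * x)⁻¹ * s ∈ H).card + (T.filter fun s => (g * y)⁻¹ * s ∈ H).card) with hBpq
  have hp3 := hp.out.two_le
  have hq3 := hq.out.two_le
  -- the four index values are pairwise distinct
  have h2p : (2 : ℕ) ≠ 2 * p := by omega
  have h2q : (2 : ℕ) ≠ 2 * q := by omega
  have h2pq : (2 : ℕ) ≠ 2 * (p * q) := by nlinarith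
  have hp_q : 2 * p ≠ 2 * q := by omega
  have hp_pq : 2 * p ≠ 2 * (p * q) := by nlinarith
  have hq_pq : 2 * q ≠ 2 * (p * q) := by nlinarith
  -- the admissible kernels of index `2`
  have hA₂ : A.filter (fun H => H.index = 2) = B₂ := by
    rw [hA, hB₂, Finset.filter_filter]
    refine Finset.filter_congr fun H _ => ?_
    constructor
    · rintro ⟨⟨hρH, -, hchar⟩, hidx⟩
      exact ⟨hρH, hidx,
        (CyclicCMType.AbelianKernels.forall_sum_char_eq_zero_iff_of_index_two hρ2 hρH hidx T).1 hchar⟩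
    · rintro ⟨hρH, hidx, hsplit⟩
      haveI : Fact (Nat.Prime 2) := ⟨Nat.prime_two⟩
      exact ⟨⟨hρH, isCyclic_of_prime_card (p := 2) (by rw [← Subgroup.index_eq_card, hidx]),
        (CyclicCMType.AbelianKernels.forall_sum_char_eq_zero_iff_of_index_two hρ2 hρH hidx T).2 hsplit⟩, hidx⟩
  -- the admissible kernels of index `2p`
  have hAp : A.filter (fun H => H.index = 2 * p) = Bp := by
    rw [hA, hBp, Finset.filter_filter]
    refine Finset.filter_congr fun H _ => ?_
    constructor
    · rintro ⟨⟨hρH, hcyc, hchar⟩, hidx⟩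
      have hidx'' : H.index = 2 * p ^ (0 + 1) := by rw [zero_add, pow_one]; exact hidx
      exact ⟨hρH, hidx, (CyclicCMType.AbelianKernels.forall_sum_char_eq_zero_iff_equidistributed_of_index
        hp2 h hρH hcyc hidx'').1 hchar⟩
    · rintro ⟨hρH, hidx, hE⟩
      have hcyc : IsCyclic (G ⧸ H) :=
        isCyclic_of_card_eq_two_mul hp2 (by rw [← Subgroup.index_eq_card, hidx])
      have hidx'' : H.index = 2 * p ^ (0 + 1) := by rw [zero_add, pow_one]; exact hidx
      exact ⟨⟨hρH, hcyc, (CyclicCMType.AbelianKernels.forall_sum_char_eq_zero_iff_equidistributed_of_index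
        hp2 h hρH hcyc hidx'').2 hE⟩, hidx⟩
  -- the admissible kernels of index `2q`
  have hAq : A.filter (fun H => H.index = 2 * q) = Bq := by
    rw [hA, hBq, Finset.filter_filter]
    refine Finset.filter_congr fun H _ => ?_
    constructor
    · rintro ⟨⟨hρH, hcyc, hchar⟩, hidx⟩
      have hidx'' : H.index = 2 * q ^ (0 + 1) := by rw [zero_add, pow_one]; exact hidx
      exact ⟨hρH, hidx, (CyclicCMType.AbelianKernels.forall_sum_char_eq_zero_iff_equidistributed_of_index
        hq2 h hρH hcyc hidx'').1 hchar⟩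
    · rintro ⟨hρH, hidx, hE⟩
      have hcyc : IsCyclic (G ⧸ H) :=
        isCyclic_of_card_eq_two_mul hq2 (by rw [← Subgroup.index_eq_card, hidx])
      have hidx'' : H.index = 2 * q ^ (0 + 1) := by rw [zero_add, pow_one]; exact hidx
      exact ⟨⟨hρH, hcyc, (CyclicCMType.AbelianKernels.forall_sum_char_eq_zero_iff_equidistributed_of_index
        hq2 h hρH hcyc hidx'').2 hE⟩, hidx⟩
  -- the admissible kernels of index `2pq`
  have hApq : A.filter (fun H => H.index = 2 * (p * q)) = Bpq := by
    rw [hA, hBpq, Finset.filter_filter]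
    refine Finset.filter_congr fun H _ => ?_
    constructor
    · rintro ⟨⟨hρH, hcyc, hchar⟩, hidx⟩
      exact ⟨hρH, hidx, (CyclicCMType.AbelianKernels.forall_sum_char_eq_zero_iff_separable_of_index_two_mul_odd_primes
        hpq hp2 hq2 h hρH hcyc hidx).1 hchar⟩
    · rintro ⟨hρH, hidx, hS⟩
      have hcyc : IsCyclic (G ⧸ H) :=
        isCyclic_of_card_eq_two_mul_mul hpq hp2 hq2 (by rw [← Subgroup.index_eq_card, hidx])
      exact ⟨⟨hρH, hcyc, (CyclicCMType.AbelianKernels.forall_sum_char_eq_zero_iff_separable_of_index_two_mul_odd_primes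
        hpq hp2 hq2 h hρH hcyc hidx).2 hS⟩, hidx⟩
  -- Euler's `φ` on the admissible kernels as an indicator combination
  have htot : ∀ H ∈ A, H.index.totient =
      (if H.index = 2 then 1 else 0) + (p - 1) * (if H.index = 2 * p then 1 else 0) +
        (q - 1) * (if H.index = 2 * q then 1 else 0) + (p - 1) * (q - 1) * (if H.index = 2 * (p * q) then 1 else 0) := by
    intro H hH
    rw [hA, Finset.mem_filter] at hH
    obtain ⟨-, hρH, hcyc, -⟩ := hH
    have hcop2p : Nat.Coprime 2 p := (Nat.coprime_primes Nat.prime_two hp.out).2 hp2.symm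
    have hcop2q : Nat.Coprime 2 q := (Nat.coprime_primes Nat.prime_two hq.out).2 hq2.symm
    have hcoppq : Nat.Coprime p q := (Nat.coprime_primes hp.out hq.out).2 hpq
    rcases index_eq_of_isCyclic_quotient hp2 hq2 hexp hρH hρ2 hcyc with hi | hi | hi | hi <;> rw [hi]
    · rw [if_pos rfl, if_neg h2p, if_neg h2q, if_neg h2pq, Nat.totient_two]; ring
    · rw [if_neg h2p.symm, if_pos rfl, if_neg hp_q, if_neg hp_pq, Nat.totient_mul hcop2p, Nat.totient_two,
        Nat.totient_prime hp.out]; ring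
    · rw [if_neg h2q.symm, if_neg hp_q.symm, if_pos rfl, if_neg hq_pq, Nat.totient_mul hcop2q, Nat.totient_two,
        Nat.totient_prime hq.out]; ring
    · rw [if_neg h2pq.symm, if_neg hp_pq.symm, if_neg hq_pq.symm, if_pos rfl,
        Nat.totient_mul (Nat.Coprime.mul_right hcop2p hcop2q), Nat.totient_two, Nat.totient_mul hcoppq,
        Nat.totient_prime hp.out, Nat.totient_prime hq.out]; ring
  have hsum : ∑ H ∈ A, H.index.totient = B₂.card + (p - 1) * Bp.card + (q - 1) * Bq.card + (p - 1) * (q - 1) * Bpq.card := by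
    rw [Finset.sum_congr rfl htot, Finset.sum_add_distrib, Finset.sum_add_distrib, Finset.sum_add_distrib,
      ← Finset.mul_sum, ← Finset.mul_sum, ← Finset.mul_sum, ← Finset.card_filter, ← Finset.card_filter,
      ← Finset.card_filter, ← Finset.card_filter, hA₂, hAp, hAq, hApq]
  rw [add_assoc, add_assoc, add_assoc, ← key, hsum]
  ring

/-- **NONDEGENERATE iff no index-`2` subgroup `H ∌ ρ` splits the type evenly, the type is equidistributed at no index-`2p` and no index-`2q`
subgroup `H ∌ ρ`, and its coset counts are additively separable at no index-`2pq` subgroup `H ∌ ρ`** (exponent `2pq`).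
[cite: Kubota1965, §4 Lemma 2] [cite: Hazama2003CyclicCM, Prop. 4.3 and Thm. 4.8] [cite: Dodson1984, §3.1.1 Theorem] -/
theorem typeRank_eq_iff [hp : Fact p.Prime] [hq : Fact q.Prime] (hpq : p ≠ q) (hp2 : p ≠ 2) (hq2 : q ≠ 2)
    {ρ : G} {T : Finset G} (h : IsCMTypeWith ρ (T : Set G)) (hexp : ∀ g : G, g ^ (2 * (p * q)) = 1) :
    typeRank G (T : Set G) = Fintype.card G / 2 + 1 ↔
      (∀ H : Subgroup G, ρ ∉ H → H.index = 2 →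
          (T.filter fun s => s ∈ H).card ≠ (T.filter fun s => s ∉ H).card) ∧
      (∀ H : Subgroup G, ρ ∉ H → H.index = 2 * p →
          ¬ ∀ x : G, x ^ p ∈ H → ∀ g : G,
            (T.filter fun s => (g * x)⁻¹ * s ∈ H).card = (T.filter fun s => g⁻¹ * s ∈ H).card) ∧
      (∀ H : Subgroup G, ρ ∉ H → H.index = 2 * q →
          ¬ ∀ x : G, x ^ q ∈ H → ∀ g : G,
            (T.filter fun s => (g * x)⁻¹ * s ∈ H).card = (T.filter fun s => g⁻¹ * s ∈ H).card) ∧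
      (∀ H : Subgroup G, ρ ∉ H → H.index = 2 * (p * q) →
          ¬ ∀ g x y : G, x ^ p ∈ H → y ^ q ∈ H →
            (T.filter fun s => g⁻¹ * s ∈ H).card + (T.filter fun s => (g * x * y)⁻¹ * s ∈ H).card =
              (T.filter fun s => (g * x)⁻¹ * s ∈ H).card + (T.filter fun s => (g * y)⁻¹ * s ∈ H).card) := by
  have key := typeRank_add_card_kernels_eq hpq hp2 hq2 h hexp
  set B₂ := (Finset.univ : Finset (Subgroup G)).filter (fun H => ρ ∉ H ∧ H.index = 2 ∧
    (T.filter fun s => s ∈ H).card = (T.filter fun s => s ∉ H).card) with hB₂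
  set Bp := (Finset.univ : Finset (Subgroup G)).filter (fun H => ρ ∉ H ∧ H.index = 2 * p ∧
    ∀ x : G, x ^ p ∈ H → ∀ g : G,
      (T.filter fun s => (g * x)⁻¹ * s ∈ H).card = (T.filter fun s => g⁻¹ * s ∈ H).card) with hBp
  set Bq := (Finset.univ : Finset (Subgroup G)).filter (fun H => ρ ∉ H ∧ H.index = 2 * q ∧
    ∀ x : G, x ^ q ∈ H → ∀ g : G,
      (T.filter fun s => (g * x)⁻¹ * s ∈ H).card = (T.filter fun s => g⁻¹ * s ∈ H).card) with hBq
  set Bpq := (Finset.univ : Finset (Subgroup G)).filter (fun H => ρ ∉ H ∧ H.index = 2 * (p * q) ∧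
    ∀ g x y : G, x ^ p ∈ H → y ^ q ∈ H →
      (T.filter fun s => g⁻¹ * s ∈ H).card + (T.filter fun s => (g * x * y)⁻¹ * s ∈ H).card =
        (T.filter fun s => (g * x)⁻¹ * s ∈ H).card + (T.filter fun s => (g * y)⁻¹ * s ∈ H).card) with hBpq
  set cp := (p - 1) * Bp.card with hcp
  set cq := (q - 1) * Bq.card with hcq
  set cpq := (p - 1) * (q - 1) * Bpq.card with hcpq
  have hp1 : p - 1 ≠ 0 := by have := hp.out.two_le; omega
  have hq1 : q - 1 ≠ 0 := by have := hq.out.two_le; omega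
  have step : typeRank G (T : Set G) = Fintype.card G / 2 + 1 ↔
      B₂.card = 0 ∧ Bp.card = 0 ∧ Bq.card = 0 ∧ Bpq.card = 0 := by
    constructor
    · intro hr
      have h0 : B₂.card = 0 ∧ cp = 0 ∧ cq = 0 ∧ cpq = 0 := by omega
      exact ⟨h0.1, (Nat.mul_eq_zero.1 h0.2.1).resolve_left hp1, (Nat.mul_eq_zero.1 h0.2.2.1).resolve_left hq1,
        (Nat.mul_eq_zero.1 h0.2.2.2).resolve_left (Nat.mul_ne_zero hp1 hq1)⟩
    · rintro ⟨h₁, h₂, h₃, h₄⟩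
      have hc1 : cp = 0 := by rw [hcp, h₂, mul_zero]
      have hc2 : cq = 0 := by rw [hcq, h₃, mul_zero]
      have hc3 : cpq = 0 := by rw [hcpq, h₄, mul_zero]
      omega
  rw [step, Finset.card_eq_zero, Finset.card_eq_zero, Finset.card_eq_zero, Finset.card_eq_zero, hB₂, hBp, hBq, hBpq,
    Finset.filter_eq_empty_iff, Finset.filter_eq_empty_iff, Finset.filter_eq_empty_iff, Finset.filter_eq_empty_iff]
  simp only [Finset.mem_univ, forall_true_left, not_and, ne_eq]

end Group

/-! ## §2 Abelian CM fields with Galois group of exponent `2pq`: the defect is `b + (p − 1)·e_{2p} + (q − 1)·e_{2q} + (p − 1)(q − 1)·s_{2pq}` -/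

section Field

variable {K : Type} [Field K] [NumberField K] [IsCMField K] [IsAbelianGalois ℚ K] {p q : ℕ}

/-- **The defect on `Gal(K/ℚ)` for an abelian CM field of exponent `2pq`** (`S = {g : σ_g ∈ Φ}`, `σ_g = φ₀ ∘ g⁻¹`, `ρ` = complex
conjugation): `Rank(Φ) + #B₂ + (p − 1)·#B_{2p} + (q − 1)·#B_{2q} + (p − 1)(q − 1)·#S_{2pq} = [K:ℚ]/2 + 1` with the four families of
kernels of `typeRank_add_card_kernels_eq` read on `Gal(K/ℚ)`. [cite: Kubota1965, §4 Lemma 2] [cite: Hazama2003CyclicCM, Prop. 4.3 and Thm. 4.8]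
[cite: Dodson1984, §3.1.1 Theorem] -/
theorem cmTypeRank_add_card_kernels_eq [Fact p.Prime] [Fact q.Prime] (hpq : p ≠ q) (hp2 : p ≠ 2) (hq2 : q ≠ 2)
    (φ₀ : K →+* ℂ) (hexp : ∀ g : K ≃ₐ[ℚ] K, g ^ (2 * (p * q)) = 1) (Φ : CMType K) :
    cmTypeRank Φ +
      ((Finset.univ : Finset (Subgroup (K ≃ₐ[ℚ] K))).filter fun H =>
        (conjGal : K ≃ₐ[ℚ] K) ∉ H ∧ H.index = 2 ∧
        ((Finset.univ.filter fun g : K ≃ₐ[ℚ] K => embOf φ₀ g ∈ Φ.1).filter fun s => s ∈ H).card =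
          ((Finset.univ.filter fun g : K ≃ₐ[ℚ] K => embOf φ₀ g ∈ Φ.1).filter fun s => s ∉ H).card).card +
      (p - 1) * ((Finset.univ : Finset (Subgroup (K ≃ₐ[ℚ] K))).filter fun H =>
        (conjGal : K ≃ₐ[ℚ] K) ∉ H ∧ H.index = 2 * p ∧
        ∀ x : K ≃ₐ[ℚ] K, x ^ p ∈ H → ∀ g : K ≃ₐ[ℚ] K,
          ((Finset.univ.filter fun g : K ≃ₐ[ℚ] K => embOf φ₀ g ∈ Φ.1).filter fun s => (g * x)⁻¹ * s ∈ H).card =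
          ((Finset.univ.filter fun g : K ≃ₐ[ℚ] K => embOf φ₀ g ∈ Φ.1).filter fun s => g⁻¹ * s ∈ H).card).card +
      (q - 1) * ((Finset.univ : Finset (Subgroup (K ≃ₐ[ℚ] K))).filter fun H =>
        (conjGal : K ≃ₐ[ℚ] K) ∉ H ∧ H.index = 2 * q ∧
        ∀ x : K ≃ₐ[ℚ] K, x ^ q ∈ H → ∀ g : K ≃ₐ[ℚ] K,
          ((Finset.univ.filter fun g : K ≃ₐ[ℚ] K => embOf φ₀ g ∈ Φ.1).filter fun s => (g * x)⁻¹ * s ∈ H).card =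
          ((Finset.univ.filter fun g : K ≃ₐ[ℚ] K => embOf φ₀ g ∈ Φ.1).filter fun s => g⁻¹ * s ∈ H).card).card +
      (p - 1) * (q - 1) * ((Finset.univ : Finset (Subgroup (K ≃ₐ[ℚ] K))).filter fun H =>
        (conjGal : K ≃ₐ[ℚ] K) ∉ H ∧ H.index = 2 * (p * q) ∧
        ∀ g x y : K ≃ₐ[ℚ] K, x ^ p ∈ H → y ^ q ∈ H →
          ((Finset.univ.filter fun g : K ≃ₐ[ℚ] K => embOf φ₀ g ∈ Φ.1).filter fun s => g⁻¹ * s ∈ H).card +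
              ((Finset.univ.filter fun g : K ≃ₐ[ℚ] K => embOf φ₀ g ∈ Φ.1).filter fun s => (g * x * y)⁻¹ * s ∈ H).card =
            ((Finset.univ.filter fun g : K ≃ₐ[ℚ] K => embOf φ₀ g ∈ Φ.1).filter fun s => (g * x)⁻¹ * s ∈ H).card +
              ((Finset.univ.filter fun g : K ≃ₐ[ℚ] K => embOf φ₀ g ∈ Φ.1).filter fun s => (g * y)⁻¹ * s ∈ H).card).card =
      Module.finrank ℚ K / 2 + 1 := by
  rw [cmTypeRank_eq_typeRank_galType Φ φ₀, ← card_gal_eq_finrank φ₀]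
  exact typeRank_add_card_kernels_eq hpq hp2 hq2 (isCMTypeWith_galType (AbelianCMFieldExistence.apply_conjGal_eq φ₀) Φ) hexp

/-- **NONDEGENERACY CRITERION IN EXPONENT `2pq` (on `Gal(K/ℚ)`).**  A CM type `Φ` of an abelian CM field `K` with `g^{2pq} = 1` on `Gal(K/ℚ)`
(`p ≠ q` odd primes) is NONDEGENERATE iff (i) `Φ` is balanced over NO imaginary quadratic subfield (Weil type over none of them), (ii) the type
`S ⊆ Gal(K/ℚ)` is equidistributed at NO index-`2p` and (iii) NO index-`2q` subgroup `H ∌ ρ`, and (iv) the coset counts of `S` are additively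
separable along the odd part of `G/H` at NO index-`2pq` subgroup `H ∌ ρ` — one surviving character per admissible kernel, the admissible kernels
having index `2`, `2p`, `2q` or `2pq`. [cite: Kubota1965, §4 Lemma 2] [cite: Hazama2003CyclicCM, Prop. 4.3 and Thm. 4.8] [cite: Dodson1984, §3.1.1 Theorem] -/
theorem isNondegenerate_iff [hp : Fact p.Prime] [hq : Fact q.Prime] (hpq : p ≠ q) (hp2 : p ≠ 2) (hq2 : q ≠ 2) (φ₀ : K →+* ℂ)
    (hexp : ∀ g : K ≃ₐ[ℚ] K, g ^ (2 * (p * q)) = 1) (Φ : CMType K) :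
    IsNondegenerate Φ ↔
      (∀ F : IntermediateField ℚ K, Module.finrank ℚ F = 2 → ¬ IsTotallyReal F →
        ¬ ∀ τ : F →+* ℂ, {φ : K →+* ℂ | φ.comp (algebraMap F K) = τ ∧ φ ∈ Φ.1}.ncard =
          {φ : K →+* ℂ | φ.comp (algebraMap F K) = τ ∧ φ ∉ Φ.1}.ncard) ∧
      (∀ H : Subgroup (K ≃ₐ[ℚ] K), (conjGal : K ≃ₐ[ℚ] K) ∉ H → H.index = 2 * p →
        ¬ ∀ x : K ≃ₐ[ℚ] K, x ^ p ∈ H → ∀ g : K ≃ₐ[ℚ] K,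
          ((Finset.univ.filter fun g : K ≃ₐ[ℚ] K => embOf φ₀ g ∈ Φ.1).filter fun s => (g * x)⁻¹ * s ∈ H).card =
          ((Finset.univ.filter fun g : K ≃ₐ[ℚ] K => embOf φ₀ g ∈ Φ.1).filter fun s => g⁻¹ * s ∈ H).card) ∧
      (∀ H : Subgroup (K ≃ₐ[ℚ] K), (conjGal : K ≃ₐ[ℚ] K) ∉ H → H.index = 2 * q →
        ¬ ∀ x : K ≃ₐ[ℚ] K, x ^ q ∈ H → ∀ g : K ≃ₐ[ℚ] K,
          ((Finset.univ.filter fun g : K ≃ₐ[ℚ] K => embOf φ₀ g ∈ Φ.1).filter fun s => (g * x)⁻¹ * s ∈ H).card =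
          ((Finset.univ.filter fun g : K ≃ₐ[ℚ] K => embOf φ₀ g ∈ Φ.1).filter fun s => g⁻¹ * s ∈ H).card) ∧
      (∀ H : Subgroup (K ≃ₐ[ℚ] K), (conjGal : K ≃ₐ[ℚ] K) ∉ H → H.index = 2 * (p * q) →
        ¬ ∀ g x y : K ≃ₐ[ℚ] K, x ^ p ∈ H → y ^ q ∈ H →
          ((Finset.univ.filter fun g : K ≃ₐ[ℚ] K => embOf φ₀ g ∈ Φ.1).filter fun s => g⁻¹ * s ∈ H).card +
              ((Finset.univ.filter fun g : K ≃ₐ[ℚ] K => embOf φ₀ g ∈ Φ.1).filter fun s => (g * x * y)⁻¹ * s ∈ H).card =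
            ((Finset.univ.filter fun g : K ≃ₐ[ℚ] K => embOf φ₀ g ∈ Φ.1).filter fun s => (g * x)⁻¹ * s ∈ H).card +
              ((Finset.univ.filter fun g : K ≃ₐ[ℚ] K => embOf φ₀ g ∈ Φ.1).filter fun s => (g * y)⁻¹ * s ∈ H).card) := by
  rw [Pohlmann1968.isNondegenerate_iff Φ, cmTypeRank_eq_typeRank_galType Φ φ₀, ← card_gal_eq_finrank φ₀,
    typeRank_eq_iff hpq hp2 hq2 (isCMTypeWith_galType (AbelianCMFieldExistence.apply_conjGal_eq φ₀) Φ) hexp]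
  refine and_congr_left fun _ => ?_
  constructor
  · intro h F h2 hF hW
    have hρH : (conjGal : K ≃ₐ[ℚ] K) ∉ F.fixingSubgroup := (conjGal_not_mem_fixingSubgroup_iff F).2 hF
    exact h F.fixingSubgroup hρH (index_fixingSubgroup_eq_two F h2)
      ((card_filter_mem_eq_iff_balanced φ₀ Φ F h2 hF).2 hW)
  · intro h H hρH hidx hsplit
    have h2 : Module.finrank ℚ (fixedField H) = 2 := by rw [← index_eq_finrank_fixedField, hidx]
    have hF : ¬ IsTotallyReal (fixedField H) := (conjGal_not_mem_iff_not_isTotallyReal_fixedField H).1 hρH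
    refine h (fixedField H) h2 hF ((card_filter_mem_eq_iff_balanced φ₀ Φ (fixedField H) h2 hF).1 ?_)
    simpa only [fixingSubgroup_fixedField] using hsplit

end Field

/-! ## §2b The index-`2pq` terms read on the lattice of subfields: CM subfields of degree `2pq` over which `Φ` is ADDITIVELY SEPARABLE -/

section Reading

variable {K : Type} [Field K] [NumberField K] [IsCMField K] [IsAbelianGalois ℚ K] {p q : ℕ}

omit [IsCMField K] [IsAbelianGalois ℚ K] in
/-- `σ_{xg}|_F = σ_g|_F ∘ (x|_F)⁻¹` as embeddings of `F`: `embOf (φ₀|_F) (x̄ ḡ) = (embOf (φ₀|_F) ḡ) ∘ x̄⁻¹`. [cite: Shimura1998, §8.1] -/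
private theorem embOf_mul_eq_comp (F : IntermediateField ℚ K) (ψ₀ : F →+* ℂ) (σ t : F ≃ₐ[ℚ] F) :
    embOf ψ₀ (σ * t) = (embOf ψ₀ t).comp (σ.symm : F ≃ₐ[ℚ] F).toRingEquiv.toRingHom := by
  refine RingHom.ext fun y => ?_
  simp only [embOf_apply, RingHom.comp_apply]
  rfl

omit [IsCMField K] in
/-- **The coset counts at `H = Gal(K/F)` are multiplicities of `Φ|_F`**: `#(S ∩ gH) = #{φ ∈ Φ : φ|_F = σ_g|_F}` with
`σ_g|_F = embOf (φ₀|_F) (g|_F)`. [cite: Yanai2015IndexDegeneracy, Thm. 4.1 (proof, p. 818)] -/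
private theorem card_filter_inv_mul_mem_eq (φ₀ : K →+* ℂ) (Φ : CMType K) (F : IntermediateField ℚ K) [Normal ℚ F]
    (g : K ≃ₐ[ℚ] K) :
    ((Finset.univ.filter fun g : K ≃ₐ[ℚ] K => embOf φ₀ g ∈ Φ.1).filter fun s => g⁻¹ * s ∈ F.fixingSubgroup).card =
      {φ : K →+* ℂ | φ.comp (algebraMap F K) = embOf (φ₀.comp (algebraMap F K)) (AlgEquiv.restrictNormalHom F g) ∧
        φ ∈ Φ.1}.ncard := by
  have h1 : ((Finset.univ.filter fun g : K ≃ₐ[ℚ] K => embOf φ₀ g ∈ Φ.1).filter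
      fun s => g⁻¹ * s ∈ F.fixingSubgroup) =
      ((Finset.univ.filter fun g : K ≃ₐ[ℚ] K => embOf φ₀ g ∈ Φ.1).filter
        fun s => AlgEquiv.restrictNormalHom F s = AlgEquiv.restrictNormalHom F g) :=
    Finset.filter_congr fun s _ => (restrictNormalHom_eq_iff F s g).symm
  rw [h1, card_fibre_restrictNormalHom_eq φ₀ Φ F, ← Set.ncard_coe_finset]
  congr 1
  ext φ
  simp only [Finset.coe_filter, Finset.mem_univ, true_and, Set.mem_setOf_eq]
  tauto

omit [IsCMField K] in
/-- **ADDITIVE SEPARABILITY AT `Gal(K/F)` READ ON `F`.**  For a subfield `F ⊆ K` the coset counts of the type `S ⊆ Gal(K/ℚ)` at `H = Gal(K/F)` are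
additively separable along the odd part — `#(S ∩ gH) + #(S ∩ gxyH) = #(S ∩ gxH) + #(S ∩ gyH)` for all `g` and all `x`, `y` with `x^p ∈ H`,
`y^q ∈ H` — iff `Φ` is ADDITIVELY SEPARABLE OVER `F` (of exponents `p`, `q`): for all `σ, σ' ∈ Gal(F/ℚ)` with `σ^p = 1`, `σ'^q = 1` and every
embedding `τ : F → ℂ`, `n(τ) + n(τ ∘ σσ') = n(τ ∘ σ) + n(τ ∘ σ')`, `n(τ) = #{φ ∈ Φ : φ|_F = τ}` (the multiplicities of `Φ|_F` have no interaction
term along the `p`- and `q`-torsion of `Gal(F/ℚ)`: `n(τσσ') − n(τσ) = n(τσ') − n(τ)`).  The one-prime analogue (levelness) is the neighbour's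
`ExponentTwicePrime.forall_card_filter_eq_iff_level`. [cite: Yanai2015IndexDegeneracy, Thm. 4.1 (proof, p. 818)]
[cite: Hazama2003CyclicCM, Prop. 4.1, Lemma 4.6.1 and Thm. 4.8] -/
theorem forall_card_filter_add_eq_iff_separable (φ₀ : K →+* ℂ) (Φ : CMType K) (F : IntermediateField ℚ K) :
    (∀ g x y : K ≃ₐ[ℚ] K, x ^ p ∈ F.fixingSubgroup → y ^ q ∈ F.fixingSubgroup →
        ((Finset.univ.filter fun g : K ≃ₐ[ℚ] K => embOf φ₀ g ∈ Φ.1).filter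
            fun s => g⁻¹ * s ∈ F.fixingSubgroup).card +
          ((Finset.univ.filter fun g : K ≃ₐ[ℚ] K => embOf φ₀ g ∈ Φ.1).filter
            fun s => (g * x * y)⁻¹ * s ∈ F.fixingSubgroup).card =
        ((Finset.univ.filter fun g : K ≃ₐ[ℚ] K => embOf φ₀ g ∈ Φ.1).filter
            fun s => (g * x)⁻¹ * s ∈ F.fixingSubgroup).card +
          ((Finset.univ.filter fun g : K ≃ₐ[ℚ] K => embOf φ₀ g ∈ Φ.1).filter
            fun s => (g * y)⁻¹ * s ∈ F.fixingSubgroup).card) ↔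
      ∀ σ σ' : F ≃ₐ[ℚ] F, σ ^ p = 1 → σ' ^ q = 1 → ∀ τ : F →+* ℂ,
        {φ : K →+* ℂ | φ.comp (algebraMap F K) = τ ∧ φ ∈ Φ.1}.ncard +
            {φ : K →+* ℂ | φ.comp (algebraMap F K) = τ.comp (σ * σ').toRingEquiv.toRingHom ∧ φ ∈ Φ.1}.ncard =
          {φ : K →+* ℂ | φ.comp (algebraMap F K) = τ.comp σ.toRingEquiv.toRingHom ∧ φ ∈ Φ.1}.ncard +
            {φ : K →+* ℂ | φ.comp (algebraMap F K) = τ.comp σ'.toRingEquiv.toRingHom ∧ φ ∈ Φ.1}.ncard := by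
  haveI := normal_of_isAbelianGalois F
  set ψ₀ : F →+* ℂ := φ₀.comp (algebraMap F K) with hψ₀
  have hres1 : ∀ (x : K ≃ₐ[ℚ] K) (n : ℕ), x ^ n ∈ F.fixingSubgroup ↔ (AlgEquiv.restrictNormalHom F x) ^ n = 1 :=
    fun x n => by rw [← map_pow, restrictNormalHom_eq_one_iff]
  -- the four coset counts as multiplicities
  have hcount0 : ∀ g : K ≃ₐ[ℚ] K,
      ((Finset.univ.filter fun g : K ≃ₐ[ℚ] K => embOf φ₀ g ∈ Φ.1).filter
          fun s => g⁻¹ * s ∈ F.fixingSubgroup).card =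
        {φ : K →+* ℂ | φ.comp (algebraMap F K) = embOf ψ₀ (AlgEquiv.restrictNormalHom F g) ∧ φ ∈ Φ.1}.ncard :=
    fun g => card_filter_inv_mul_mem_eq φ₀ Φ F g
  have hcount : ∀ x g : K ≃ₐ[ℚ] K,
      ((Finset.univ.filter fun g : K ≃ₐ[ℚ] K => embOf φ₀ g ∈ Φ.1).filter
          fun s => (g * x)⁻¹ * s ∈ F.fixingSubgroup).card =
        {φ : K →+* ℂ | φ.comp (algebraMap F K) =
          (embOf ψ₀ (AlgEquiv.restrictNormalHom F g)).comp
            ((AlgEquiv.restrictNormalHom F x).symm : F ≃ₐ[ℚ] F).toRingEquiv.toRingHom ∧ φ ∈ Φ.1}.ncard := by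
    intro x g
    rw [mul_comm g x, card_filter_inv_mul_mem_eq φ₀ Φ F (x * g), map_mul, embOf_mul_eq_comp]
  have hcount2 : ∀ x y g : K ≃ₐ[ℚ] K,
      ((Finset.univ.filter fun g : K ≃ₐ[ℚ] K => embOf φ₀ g ∈ Φ.1).filter
          fun s => (g * x * y)⁻¹ * s ∈ F.fixingSubgroup).card =
        {φ : K →+* ℂ | φ.comp (algebraMap F K) =
          (embOf ψ₀ (AlgEquiv.restrictNormalHom F g)).comp
            (((AlgEquiv.restrictNormalHom F x).symm : F ≃ₐ[ℚ] F) *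
              ((AlgEquiv.restrictNormalHom F y).symm : F ≃ₐ[ℚ] F)).toRingEquiv.toRingHom ∧ φ ∈ Φ.1}.ncard := by
    intro x y g
    rw [show g * x * y = y * x * g by rw [mul_assoc, mul_comm g, mul_comm x y],
      card_filter_inv_mul_mem_eq φ₀ Φ F (y * x * g), map_mul, embOf_mul_eq_comp, map_mul, ← AlgEquiv.aut_inv,
      mul_inv_rev, AlgEquiv.aut_inv, AlgEquiv.aut_inv]
  constructor
  · intro h σ σ' hσ hσ' τ
    obtain ⟨t, rfl⟩ := (embOf_bijective ψ₀).2 τ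
    obtain ⟨g, rfl⟩ := AlgEquiv.restrictNormalHom_surjective K t
    obtain ⟨x, hx⟩ := AlgEquiv.restrictNormalHom_surjective K (σ⁻¹ : F ≃ₐ[ℚ] F)
    obtain ⟨y, hy⟩ := AlgEquiv.restrictNormalHom_surjective K (σ'⁻¹ : F ≃ₐ[ℚ] F)
    have hxp : x ^ p ∈ F.fixingSubgroup := by rw [hres1, hx, inv_pow, hσ, inv_one]
    have hyq : y ^ q ∈ F.fixingSubgroup := by rw [hres1, hy, inv_pow, hσ', inv_one]
    have key := h g x y hxp hyq
    rw [hcount0 g, hcount2 x y g, hcount x g, hcount y g, hx, hy] at key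
    have hss : ((σ⁻¹ : F ≃ₐ[ℚ] F).symm : F ≃ₐ[ℚ] F) = σ := by
      rw [AlgEquiv.aut_inv, AlgEquiv.symm_symm]
    have hss' : ((σ'⁻¹ : F ≃ₐ[ℚ] F).symm : F ≃ₐ[ℚ] F) = σ' := by
      rw [AlgEquiv.aut_inv, AlgEquiv.symm_symm]
    rw [hss, hss'] at key
    exact key
  · intro h g x y hx hy
    rw [hcount0 g, hcount2 x y g, hcount x g, hcount y g]
    refine h _ _ ?_ ?_ _
    · rw [← AlgEquiv.aut_inv, inv_pow, inv_eq_one, ← hres1]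
      exact hx
    · rw [← AlgEquiv.aut_inv, inv_pow, inv_eq_one, ← hres1]
      exact hy

/-- **The separable index-`2pq` kernels ARE the CM subfields of degree `2pq` over which `Φ` is additively separable**: `H ↦ K^H` is a
bijection from the index-`2pq` subgroups `H ∌ ρ` of `Gal(K/ℚ)` at which the coset counts of `S` are additively separable onto the subfields
`F ⊆ K` with `[F:ℚ] = 2pq`, `F` not totally real (a CM subfield), over which `Φ` is additively separable of exponents `p`, `q`.
[cite: Yanai2015IndexDegeneracy, Thm. 4.1 (proof, p. 818)] [cite: MilneFT2022, Thm. 3.16] -/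
theorem card_index_eq_ncard_separable (φ₀ : K →+* ℂ) (Φ : CMType K) :
    ((Finset.univ : Finset (Subgroup (K ≃ₐ[ℚ] K))).filter fun H =>
        (conjGal : K ≃ₐ[ℚ] K) ∉ H ∧ H.index = 2 * (p * q) ∧
        ∀ g x y : K ≃ₐ[ℚ] K, x ^ p ∈ H → y ^ q ∈ H →
          ((Finset.univ.filter fun g : K ≃ₐ[ℚ] K => embOf φ₀ g ∈ Φ.1).filter fun s => g⁻¹ * s ∈ H).card +
              ((Finset.univ.filter fun g : K ≃ₐ[ℚ] K => embOf φ₀ g ∈ Φ.1).filter fun s => (g * x * y)⁻¹ * s ∈ H).card =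
            ((Finset.univ.filter fun g : K ≃ₐ[ℚ] K => embOf φ₀ g ∈ Φ.1).filter fun s => (g * x)⁻¹ * s ∈ H).card +
              ((Finset.univ.filter fun g : K ≃ₐ[ℚ] K => embOf φ₀ g ∈ Φ.1).filter fun s => (g * y)⁻¹ * s ∈ H).card).card =
      {F : IntermediateField ℚ K | Module.finrank ℚ F = 2 * (p * q) ∧ ¬ IsTotallyReal F ∧
        ∀ σ σ' : F ≃ₐ[ℚ] F, σ ^ p = 1 → σ' ^ q = 1 → ∀ τ : F →+* ℂ,
          {φ : K →+* ℂ | φ.comp (algebraMap F K) = τ ∧ φ ∈ Φ.1}.ncard +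
              {φ : K →+* ℂ | φ.comp (algebraMap F K) = τ.comp (σ * σ').toRingEquiv.toRingHom ∧ φ ∈ Φ.1}.ncard =
            {φ : K →+* ℂ | φ.comp (algebraMap F K) = τ.comp σ.toRingEquiv.toRingHom ∧ φ ∈ Φ.1}.ncard +
              {φ : K →+* ℂ | φ.comp (algebraMap F K) = τ.comp σ'.toRingEquiv.toRingHom ∧ φ ∈ Φ.1}.ncard}.ncard := by
  set B := ((Finset.univ : Finset (Subgroup (K ≃ₐ[ℚ] K))).filter fun H =>
        (conjGal : K ≃ₐ[ℚ] K) ∉ H ∧ H.index = 2 * (p * q) ∧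
        ∀ g x y : K ≃ₐ[ℚ] K, x ^ p ∈ H → y ^ q ∈ H →
          ((Finset.univ.filter fun g : K ≃ₐ[ℚ] K => embOf φ₀ g ∈ Φ.1).filter fun s => g⁻¹ * s ∈ H).card +
              ((Finset.univ.filter fun g : K ≃ₐ[ℚ] K => embOf φ₀ g ∈ Φ.1).filter fun s => (g * x * y)⁻¹ * s ∈ H).card =
            ((Finset.univ.filter fun g : K ≃ₐ[ℚ] K => embOf φ₀ g ∈ Φ.1).filter fun s => (g * x)⁻¹ * s ∈ H).card +
              ((Finset.univ.filter fun g : K ≃ₐ[ℚ] K => embOf φ₀ g ∈ Φ.1).filter fun s => (g * y)⁻¹ * s ∈ H).card) with hB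
  have hinj : Function.Injective (fun H : Subgroup (K ≃ₐ[ℚ] K) => fixedField H) := fun H H' hHH' => by
    have := congrArg IntermediateField.fixingSubgroup hHH'
    simpa only [fixingSubgroup_fixedField] using this
  have himage : (fun H : Subgroup (K ≃ₐ[ℚ] K) => fixedField H) '' (↑B : Set (Subgroup (K ≃ₐ[ℚ] K))) =
      {F : IntermediateField ℚ K | Module.finrank ℚ F = 2 * (p * q) ∧ ¬ IsTotallyReal F ∧
        ∀ σ σ' : F ≃ₐ[ℚ] F, σ ^ p = 1 → σ' ^ q = 1 → ∀ τ : F →+* ℂ,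
          {φ : K →+* ℂ | φ.comp (algebraMap F K) = τ ∧ φ ∈ Φ.1}.ncard +
              {φ : K →+* ℂ | φ.comp (algebraMap F K) = τ.comp (σ * σ').toRingEquiv.toRingHom ∧ φ ∈ Φ.1}.ncard =
            {φ : K →+* ℂ | φ.comp (algebraMap F K) = τ.comp σ.toRingEquiv.toRingHom ∧ φ ∈ Φ.1}.ncard +
              {φ : K →+* ℂ | φ.comp (algebraMap F K) = τ.comp σ'.toRingEquiv.toRingHom ∧ φ ∈ Φ.1}.ncard} := by
    ext F
    simp only [Set.mem_image, Finset.mem_coe, hB, Finset.mem_filter, Finset.mem_univ, true_and,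
      Set.mem_setOf_eq]
    constructor
    · rintro ⟨H, ⟨hρH, hidx, hS⟩, rfl⟩
      refine ⟨by rw [← index_eq_finrank_fixedField, hidx],
        (conjGal_not_mem_iff_not_isTotallyReal_fixedField H).1 hρH,
        (forall_card_filter_add_eq_iff_separable φ₀ Φ (fixedField H)).1 ?_⟩
      simpa only [fixingSubgroup_fixedField] using hS
    · rintro ⟨h2pq, hF, hS⟩
      refine ⟨F.fixingSubgroup, ⟨(conjGal_not_mem_fixingSubgroup_iff F).2 hF,
        by rw [CMNumbers.index_fixingSubgroup_eq_finrank, h2pq], (forall_card_filter_add_eq_iff_separable φ₀ Φ F).2 hS⟩,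
        IsGalois.fixedField_fixingSubgroup F⟩
  rw [← himage, Set.ncard_image_of_injective _ hinj, Set.ncard_coe_finset]

/-- **THE RANK OF A CM TYPE OF AN ABELIAN CM FIELD OF EXPONENT `2pq`, ON THE LATTICE OF SUBFIELDS.**  Let `K` be a CM field, abelian over `ℚ`,
with `g^{2pq} = 1` on `Gal(K/ℚ)` (`p ≠ q` odd primes; `Gal(K/ℚ) ≅ (ℤ/2)^r × (ℤ/p)^s × (ℤ/q)^t` — e.g. `ℚ(ζ₇₇), ℚ(ζ₉₃), ℚ(ζ₉₉), ℚ(ζ₁₂₄)`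
(`ℤ/2 × ℤ/30`, resp. `ℤ/6 × ℤ/10`), `ℚ(ζ₁₂₉), ℚ(ζ₁₄₇)` (`ℤ/2 × ℤ/42`), the cyclic `ℚ(ζ₃₁), ℚ(ζ₄₃), ℚ(ζ₇₁)`, their CM subfields and composita
with imaginary quadratic fields), and `Φ` ANY CM type of `K`.  Then

  `Rank(Φ) + b(Φ) + (p − 1)·e_{2p}(Φ) + (q − 1)·e_{2q}(Φ) + (p − 1)(q − 1)·s_{2pq}(Φ) = [K:ℚ]/2 + 1`,

where `b(Φ) = #{F ⊆ K imaginary quadratic : Φ of Weil type (balanced) over F}`, `e_{2p}(Φ)` (resp. `e_{2q}(Φ)`) `= #{F ⊆ K : [F:ℚ] = 2p` (resp.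
`2q`)`, F a CM field, Φ LEVEL of exponent p` (resp. `q`) `over F}` (for every `σ ∈ Gal(F/ℚ)` with `σ^p = 1` and every `τ : F → ℂ`,
`#{φ ∈ Φ : φ|_F = τ ∘ σ} = #{φ ∈ Φ : φ|_F = τ}`), and `s_{2pq}(Φ) = #{F ⊆ K : [F:ℚ] = 2pq, F a CM field, Φ ADDITIVELY SEPARABLE over F}`
(`n(τ) + n(τ ∘ σσ') = n(τ ∘ σ) + n(τ ∘ σ')` for `σ^p = 1`, `σ'^q = 1`).  All these subfields are cyclic over `ℚ`.  Kubota's defect of `Φ` is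
`b + (p − 1)·e_{2p} + (q − 1)·e_{2q} + (p − 1)(q − 1)·s_{2pq}`. [cite: Kubota1965, §4 Lemma 2] [cite: Hazama2003CyclicCM, Prop. 4.1, 4.3, Lemma 4.6.1 and Thm. 4.8]
[cite: Dodson1984, §3.1.1 Theorem] [cite: Yanai2015IndexDegeneracy, Thm. 4.1 (proof, p. 818)] [cite: Gordon1999HodgeAVSurvey, 5.13 (ii) and 9.4.1] -/
theorem cmTypeRank_add_ncard_subfields_eq [Fact p.Prime] [Fact q.Prime] (hpq : p ≠ q) (hp2 : p ≠ 2) (hq2 : q ≠ 2)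
    (hexp : ∀ g : K ≃ₐ[ℚ] K, g ^ (2 * (p * q)) = 1) (Φ : CMType K) :
    cmTypeRank Φ + {F : IntermediateField ℚ K | Module.finrank ℚ F = 2 ∧ ¬ IsTotallyReal F ∧
        ∀ τ : F →+* ℂ, {φ : K →+* ℂ | φ.comp (algebraMap F K) = τ ∧ φ ∈ Φ.1}.ncard =
          {φ : K →+* ℂ | φ.comp (algebraMap F K) = τ ∧ φ ∉ Φ.1}.ncard}.ncard +
      (p - 1) * {F : IntermediateField ℚ K | Module.finrank ℚ F = 2 * p ∧ ¬ IsTotallyReal F ∧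
        ∀ σ : F ≃ₐ[ℚ] F, σ ^ p = 1 → ∀ τ : F →+* ℂ,
          {φ : K →+* ℂ | φ.comp (algebraMap F K) = τ.comp σ.toRingEquiv.toRingHom ∧ φ ∈ Φ.1}.ncard =
            {φ : K →+* ℂ | φ.comp (algebraMap F K) = τ ∧ φ ∈ Φ.1}.ncard}.ncard +
      (q - 1) * {F : IntermediateField ℚ K | Module.finrank ℚ F = 2 * q ∧ ¬ IsTotallyReal F ∧
        ∀ σ : F ≃ₐ[ℚ] F, σ ^ q = 1 → ∀ τ : F →+* ℂ,
          {φ : K →+* ℂ | φ.comp (algebraMap F K) = τ.comp σ.toRingEquiv.toRingHom ∧ φ ∈ Φ.1}.ncard =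
            {φ : K →+* ℂ | φ.comp (algebraMap F K) = τ ∧ φ ∈ Φ.1}.ncard}.ncard +
      (p - 1) * (q - 1) * {F : IntermediateField ℚ K | Module.finrank ℚ F = 2 * (p * q) ∧ ¬ IsTotallyReal F ∧
        ∀ σ σ' : F ≃ₐ[ℚ] F, σ ^ p = 1 → σ' ^ q = 1 → ∀ τ : F →+* ℂ,
          {φ : K →+* ℂ | φ.comp (algebraMap F K) = τ ∧ φ ∈ Φ.1}.ncard +
              {φ : K →+* ℂ | φ.comp (algebraMap F K) = τ.comp (σ * σ').toRingEquiv.toRingHom ∧ φ ∈ Φ.1}.ncard =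
            {φ : K →+* ℂ | φ.comp (algebraMap F K) = τ.comp σ.toRingEquiv.toRingHom ∧ φ ∈ Φ.1}.ncard +
              {φ : K →+* ℂ | φ.comp (algebraMap F K) = τ.comp σ'.toRingEquiv.toRingHom ∧ φ ∈ Φ.1}.ncard}.ncard = Module.finrank ℚ K / 2 + 1 := by
  obtain ⟨φ₀⟩ := (inferInstance : Nonempty (K →+* ℂ))
  rw [← card_indexTwo_eq_ncard_weilQuadratic φ₀ Φ, ← card_index_eq_ncard_level φ₀ Φ, ← card_index_eq_ncard_level φ₀ Φ,
    ← card_index_eq_ncard_separable φ₀ Φ]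
  exact cmTypeRank_add_card_kernels_eq hpq hp2 hq2 φ₀ hexp Φ

/-- **NONDEGENERACY CRITERION ON THE LATTICE OF SUBFIELDS (exponent `2pq`).**  `Φ` is nondegenerate iff it is (i) of Weil type (balanced) over
NO imaginary quadratic subfield, (ii) level of exponent `p` over NO CM subfield of degree `2p`, (iii) level of exponent `q` over NO CM subfield
of degree `2q`, and (iv) additively separable over NO CM subfield of degree `2pq` — an intrinsic statement (no base embedding, no Galois
bookkeeping). [cite: Kubota1965, §4 Lemma 2] [cite: Hazama2003CyclicCM, Prop. 4.3 and Thm. 4.8] [cite: Dodson1984, §3.1.1 Theorem]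
[cite: Yanai2015IndexDegeneracy, Thm. 4.1] -/
theorem isNondegenerate_iff_forall_intermediateField [hp : Fact p.Prime] [hq : Fact q.Prime] (hpq : p ≠ q) (hp2 : p ≠ 2)
    (hq2 : q ≠ 2) (hexp : ∀ g : K ≃ₐ[ℚ] K, g ^ (2 * (p * q)) = 1) (Φ : CMType K) :
    IsNondegenerate Φ ↔
      (∀ F : IntermediateField ℚ K, Module.finrank ℚ F = 2 → ¬ IsTotallyReal F →
        ¬ ∀ τ : F →+* ℂ, {φ : K →+* ℂ | φ.comp (algebraMap F K) = τ ∧ φ ∈ Φ.1}.ncard =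
          {φ : K →+* ℂ | φ.comp (algebraMap F K) = τ ∧ φ ∉ Φ.1}.ncard) ∧
      (∀ F : IntermediateField ℚ K, Module.finrank ℚ F = 2 * p → ¬ IsTotallyReal F →
        ¬ ∀ σ : F ≃ₐ[ℚ] F, σ ^ p = 1 → ∀ τ : F →+* ℂ,
          {φ : K →+* ℂ | φ.comp (algebraMap F K) = τ.comp σ.toRingEquiv.toRingHom ∧ φ ∈ Φ.1}.ncard =
            {φ : K →+* ℂ | φ.comp (algebraMap F K) = τ ∧ φ ∈ Φ.1}.ncard) ∧
      (∀ F : IntermediateField ℚ K, Module.finrank ℚ F = 2 * q → ¬ IsTotallyReal F →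
        ¬ ∀ σ : F ≃ₐ[ℚ] F, σ ^ q = 1 → ∀ τ : F →+* ℂ,
          {φ : K →+* ℂ | φ.comp (algebraMap F K) = τ.comp σ.toRingEquiv.toRingHom ∧ φ ∈ Φ.1}.ncard =
            {φ : K →+* ℂ | φ.comp (algebraMap F K) = τ ∧ φ ∈ Φ.1}.ncard) ∧
      (∀ F : IntermediateField ℚ K, Module.finrank ℚ F = 2 * (p * q) → ¬ IsTotallyReal F →
        ¬ ∀ σ σ' : F ≃ₐ[ℚ] F, σ ^ p = 1 → σ' ^ q = 1 → ∀ τ : F →+* ℂ,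
          {φ : K →+* ℂ | φ.comp (algebraMap F K) = τ ∧ φ ∈ Φ.1}.ncard +
              {φ : K →+* ℂ | φ.comp (algebraMap F K) = τ.comp (σ * σ').toRingEquiv.toRingHom ∧ φ ∈ Φ.1}.ncard =
            {φ : K →+* ℂ | φ.comp (algebraMap F K) = τ.comp σ.toRingEquiv.toRingHom ∧ φ ∈ Φ.1}.ncard +
              {φ : K →+* ℂ | φ.comp (algebraMap F K) = τ.comp σ'.toRingEquiv.toRingHom ∧ φ ∈ Φ.1}.ncard) := by
  obtain ⟨φ₀⟩ := (inferInstance : Nonempty (K →+* ℂ))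
  rw [isNondegenerate_iff hpq hp2 hq2 φ₀ hexp Φ]
  refine and_congr_right fun _ => ?_
  have hlev : ∀ r : ℕ, ((∀ H : Subgroup (K ≃ₐ[ℚ] K), (conjGal : K ≃ₐ[ℚ] K) ∉ H → H.index = 2 * r →
        ¬ ∀ x : K ≃ₐ[ℚ] K, x ^ r ∈ H → ∀ g : K ≃ₐ[ℚ] K,
          ((Finset.univ.filter fun g : K ≃ₐ[ℚ] K => embOf φ₀ g ∈ Φ.1).filter fun s => (g * x)⁻¹ * s ∈ H).card =
          ((Finset.univ.filter fun g : K ≃ₐ[ℚ] K => embOf φ₀ g ∈ Φ.1).filter fun s => g⁻¹ * s ∈ H).card)) ↔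
      (∀ F : IntermediateField ℚ K, Module.finrank ℚ F = 2 * r → ¬ IsTotallyReal F →
        ¬ ∀ σ : F ≃ₐ[ℚ] F, σ ^ r = 1 → ∀ τ : F →+* ℂ,
          {φ : K →+* ℂ | φ.comp (algebraMap F K) = τ.comp σ.toRingEquiv.toRingHom ∧ φ ∈ Φ.1}.ncard =
            {φ : K →+* ℂ | φ.comp (algebraMap F K) = τ ∧ φ ∈ Φ.1}.ncard) := by
    intro r
    constructor
    · intro h F h2r hF hL
      exact h F.fixingSubgroup ((conjGal_not_mem_fixingSubgroup_iff F).2 hF)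
        (by rw [CMNumbers.index_fixingSubgroup_eq_finrank, h2r]) ((forall_card_filter_eq_iff_level φ₀ Φ F).2 hL)
    · intro h H hρH hidx hE
      refine h (fixedField H) (by rw [← index_eq_finrank_fixedField, hidx])
        ((conjGal_not_mem_iff_not_isTotallyReal_fixedField H).1 hρH)
        ((forall_card_filter_eq_iff_level φ₀ Φ (fixedField H)).1 ?_)
      simpa only [fixingSubgroup_fixedField] using hE
  have hsep : ((∀ H : Subgroup (K ≃ₐ[ℚ] K), (conjGal : K ≃ₐ[ℚ] K) ∉ H → H.index = 2 * (p * q) →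
        ¬ ∀ g x y : K ≃ₐ[ℚ] K, x ^ p ∈ H → y ^ q ∈ H →
          ((Finset.univ.filter fun g : K ≃ₐ[ℚ] K => embOf φ₀ g ∈ Φ.1).filter fun s => g⁻¹ * s ∈ H).card +
              ((Finset.univ.filter fun g : K ≃ₐ[ℚ] K => embOf φ₀ g ∈ Φ.1).filter fun s => (g * x * y)⁻¹ * s ∈ H).card =
            ((Finset.univ.filter fun g : K ≃ₐ[ℚ] K => embOf φ₀ g ∈ Φ.1).filter fun s => (g * x)⁻¹ * s ∈ H).card +
              ((Finset.univ.filter fun g : K ≃ₐ[ℚ] K => embOf φ₀ g ∈ Φ.1).filter fun s => (g * y)⁻¹ * s ∈ H).card)) ↔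
      (∀ F : IntermediateField ℚ K, Module.finrank ℚ F = 2 * (p * q) → ¬ IsTotallyReal F →
        ¬ ∀ σ σ' : F ≃ₐ[ℚ] F, σ ^ p = 1 → σ' ^ q = 1 → ∀ τ : F →+* ℂ,
          {φ : K →+* ℂ | φ.comp (algebraMap F K) = τ ∧ φ ∈ Φ.1}.ncard +
              {φ : K →+* ℂ | φ.comp (algebraMap F K) = τ.comp (σ * σ').toRingEquiv.toRingHom ∧ φ ∈ Φ.1}.ncard =
            {φ : K →+* ℂ | φ.comp (algebraMap F K) = τ.comp σ.toRingEquiv.toRingHom ∧ φ ∈ Φ.1}.ncard +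
              {φ : K →+* ℂ | φ.comp (algebraMap F K) = τ.comp σ'.toRingEquiv.toRingHom ∧ φ ∈ Φ.1}.ncard) := by
    constructor
    · intro h F h2pq hF hS
      exact h F.fixingSubgroup ((conjGal_not_mem_fixingSubgroup_iff F).2 hF)
        (by rw [CMNumbers.index_fixingSubgroup_eq_finrank, h2pq]) ((forall_card_filter_add_eq_iff_separable φ₀ Φ F).2 hS)
    · intro h H hρH hidx hS
      refine h (fixedField H) (by rw [← index_eq_finrank_fixedField, hidx])
        ((conjGal_not_mem_iff_not_isTotallyReal_fixedField H).1 hρH)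
        ((forall_card_filter_add_eq_iff_separable φ₀ Φ (fixedField H)).1 ?_)
      simpa only [fixingSubgroup_fixedField] using hS
  rw [hlev p, hlev q, hsep]

end Reading

/-! ## §3 Consequences for abelian varieties: `B•(Aⁿ) ⊗ ℂ = D•(Aⁿ) ⊗ ℂ` and the Hodge conjecture for all powers -/

section Varieties

open Literature.AlgebraicGeometry.Motives (AbelianVariety)
open Literature.AlgebraicGeometry.HodgeTheory
open Literature.AlgebraicGeometry.ComplexMultiplication (IsCMTypeRealisation)
open Literature.AlgebraicGeometry.VanGeemen1994 (hodgeClassSpan)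
open Literature.Barriers.HodgeConjecture (divisorClassesSpan)
open _root_.CategoryTheory _root_.CategoryTheory.Limits

variable {K : Type} [Field K] [NumberField K] [IsCMField K] [IsAbelianGalois ℚ K] {p q : ℕ}
  {Φ : CMType K} {A : AbelianVariety ℂ} {ι : 𝓞 K →+* End A} {θ : K →+* Module.End ℂ (complexBetti A.X 1)}

/-- `Bᵐ ⊗ ℂ = Dᵐ ⊗ ℂ` for all `m` on an abelian variety gives the Hodge conjecture for it (Lefschetz `(1,1)`, cup products, tree theorems).
[cite: Gordon1999HodgeAVSurvey, §9.3] -/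
private theorem hodgeConjectureFor_of_forall_hodgeClassSpan_eq₆₅ (B : AbelianVariety ℂ)
    (h : ∀ m : ℕ, hodgeClassSpan B.dim B.X m = divisorClassesSpan B.X B.dim m) : HodgeConjectureFor B.dim B.X :=
  ⟨nonempty_hodgeModel_holds (Motives.AbelianVariety.isSmoothProjective_holds (A := B)),
    fun m _ hc hmm ↦ AbelianVariety.divisorClassesSpan_le_algebraicClasses B
      (fun b hb hb' ↦ lefschetzOneOne_rational_holds (Motives.AbelianVariety.isSmoothProjective_holds (A := B)) b hb hb') m
      ((h m) ▸ Submodule.subset_span ⟨hc, hmm⟩)⟩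

/-- **`B•(Aⁿ) ⊗ ℂ = D•(Aⁿ) ⊗ ℂ` FOR EVERY REALISATION OF A TYPE OFF THE FOUR LISTS.**  `K` abelian CM with `g^{2pq} = 1` on `Gal(K/ℚ)`; if `Φ` is
of Weil type over no imaginary quadratic subfield, level of exponent `p` (resp. `q`) over no CM subfield of degree `2p` (resp. `2q`) and additively
separable over no CM subfield of degree `2pq`, then `Φ` is nondegenerate, so for every abelian variety `(A, ι, θ)` of type `(K; Φ)` and all `n, m`
the Hodge classes of `Aⁿ` in degree `2m` are spanned by products of divisor classes (Hazama's criterion ∕ Pohlmann, tree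
`IsNondegenerate.hodgeClassSpan_pow_eq_divisorClassesSpan`). [cite: Kubota1965, §4 Lemma 2] [cite: Gordon1999HodgeAVSurvey, Thm. 6.4 and §9.3]
[cite: Hazama2003CyclicCM, Prop. 4.3 and Thm. 4.8] -/
theorem hodgeClassSpan_pow_eq_divisorClassesSpan_of_forall_intermediateField [Fact p.Prime] [Fact q.Prime] (hpq : p ≠ q)
    (hp2 : p ≠ 2) (hq2 : q ≠ 2) (hexp : ∀ g : K ≃ₐ[ℚ] K, g ^ (2 * (p * q)) = 1)
    (hW : ∀ F : IntermediateField ℚ K, Module.finrank ℚ F = 2 → ¬ IsTotallyReal F →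
        ¬ ∀ τ : F →+* ℂ, {φ : K →+* ℂ | φ.comp (algebraMap F K) = τ ∧ φ ∈ Φ.1}.ncard =
          {φ : K →+* ℂ | φ.comp (algebraMap F K) = τ ∧ φ ∉ Φ.1}.ncard)
    (hLp : ∀ F : IntermediateField ℚ K, Module.finrank ℚ F = 2 * p → ¬ IsTotallyReal F →
        ¬ ∀ σ : F ≃ₐ[ℚ] F, σ ^ p = 1 → ∀ τ : F →+* ℂ,
          {φ : K →+* ℂ | φ.comp (algebraMap F K) = τ.comp σ.toRingEquiv.toRingHom ∧ φ ∈ Φ.1}.ncard =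
            {φ : K →+* ℂ | φ.comp (algebraMap F K) = τ ∧ φ ∈ Φ.1}.ncard)
    (hLq : ∀ F : IntermediateField ℚ K, Module.finrank ℚ F = 2 * q → ¬ IsTotallyReal F →
        ¬ ∀ σ : F ≃ₐ[ℚ] F, σ ^ q = 1 → ∀ τ : F →+* ℂ,
          {φ : K →+* ℂ | φ.comp (algebraMap F K) = τ.comp σ.toRingEquiv.toRingHom ∧ φ ∈ Φ.1}.ncard =
            {φ : K →+* ℂ | φ.comp (algebraMap F K) = τ ∧ φ ∈ Φ.1}.ncard)
    (hS : ∀ F : IntermediateField ℚ K, Module.finrank ℚ F = 2 * (p * q) → ¬ IsTotallyReal F →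
        ¬ ∀ σ σ' : F ≃ₐ[ℚ] F, σ ^ p = 1 → σ' ^ q = 1 → ∀ τ : F →+* ℂ,
          {φ : K →+* ℂ | φ.comp (algebraMap F K) = τ ∧ φ ∈ Φ.1}.ncard +
              {φ : K →+* ℂ | φ.comp (algebraMap F K) = τ.comp (σ * σ').toRingEquiv.toRingHom ∧ φ ∈ Φ.1}.ncard =
            {φ : K →+* ℂ | φ.comp (algebraMap F K) = τ.comp σ.toRingEquiv.toRingHom ∧ φ ∈ Φ.1}.ncard +
              {φ : K →+* ℂ | φ.comp (algebraMap F K) = τ.comp σ'.toRingEquiv.toRingHom ∧ φ ∈ Φ.1}.ncard)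
    (hA : IsCMTypeRealisation Φ A ι θ) (n m : ℕ) :
    hodgeClassSpan (⨁ fun _ : Fin n => A).dim (⨁ fun _ : Fin n => A).X m =
      divisorClassesSpan (⨁ fun _ : Fin n => A).X (⨁ fun _ : Fin n => A).dim m :=
  ((isNondegenerate_iff_forall_intermediateField hpq hp2 hq2 hexp Φ).2 ⟨hW, hLp, hLq, hS⟩).hodgeClassSpan_pow_eq_divisorClassesSpan
    hA n m

/-- **THE HODGE CONJECTURE FOR ALL POWERS OF EVERY REALISATION OF A TYPE OFF THE FOUR LISTS** (abelian CM field with `g^{2pq} = 1` on `Gal`;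
`Φ` of Weil type over no imaginary quadratic subfield, level over no CM subfield of degree `2p` or `2q`, additively separable over no CM subfield of
degree `2pq`) — UNCONDITIONAL, any realisation. [cite: Gordon1999HodgeAVSurvey, Thm. 6.4 and §9.3] [cite: Kubota1965, §4 Lemma 2] [cite: Deligne2000, §1] -/
theorem hodgeConjectureFor_pow_of_forall_intermediateField [Fact p.Prime] [Fact q.Prime] (hpq : p ≠ q) (hp2 : p ≠ 2) (hq2 : q ≠ 2)
    (hexp : ∀ g : K ≃ₐ[ℚ] K, g ^ (2 * (p * q)) = 1)
    (hW : ∀ F : IntermediateField ℚ K, Module.finrank ℚ F = 2 → ¬ IsTotallyReal F →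
        ¬ ∀ τ : F →+* ℂ, {φ : K →+* ℂ | φ.comp (algebraMap F K) = τ ∧ φ ∈ Φ.1}.ncard =
          {φ : K →+* ℂ | φ.comp (algebraMap F K) = τ ∧ φ ∉ Φ.1}.ncard)
    (hLp : ∀ F : IntermediateField ℚ K, Module.finrank ℚ F = 2 * p → ¬ IsTotallyReal F →
        ¬ ∀ σ : F ≃ₐ[ℚ] F, σ ^ p = 1 → ∀ τ : F →+* ℂ,
          {φ : K →+* ℂ | φ.comp (algebraMap F K) = τ.comp σ.toRingEquiv.toRingHom ∧ φ ∈ Φ.1}.ncard =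
            {φ : K →+* ℂ | φ.comp (algebraMap F K) = τ ∧ φ ∈ Φ.1}.ncard)
    (hLq : ∀ F : IntermediateField ℚ K, Module.finrank ℚ F = 2 * q → ¬ IsTotallyReal F →
        ¬ ∀ σ : F ≃ₐ[ℚ] F, σ ^ q = 1 → ∀ τ : F →+* ℂ,
          {φ : K →+* ℂ | φ.comp (algebraMap F K) = τ.comp σ.toRingEquiv.toRingHom ∧ φ ∈ Φ.1}.ncard =
            {φ : K →+* ℂ | φ.comp (algebraMap F K) = τ ∧ φ ∈ Φ.1}.ncard)
    (hS : ∀ F : IntermediateField ℚ K, Module.finrank ℚ F = 2 * (p * q) → ¬ IsTotallyReal F →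
        ¬ ∀ σ σ' : F ≃ₐ[ℚ] F, σ ^ p = 1 → σ' ^ q = 1 → ∀ τ : F →+* ℂ,
          {φ : K →+* ℂ | φ.comp (algebraMap F K) = τ ∧ φ ∈ Φ.1}.ncard +
              {φ : K →+* ℂ | φ.comp (algebraMap F K) = τ.comp (σ * σ').toRingEquiv.toRingHom ∧ φ ∈ Φ.1}.ncard =
            {φ : K →+* ℂ | φ.comp (algebraMap F K) = τ.comp σ.toRingEquiv.toRingHom ∧ φ ∈ Φ.1}.ncard +
              {φ : K →+* ℂ | φ.comp (algebraMap F K) = τ.comp σ'.toRingEquiv.toRingHom ∧ φ ∈ Φ.1}.ncard)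
    (hA : IsCMTypeRealisation Φ A ι θ) (n : ℕ) :
    HodgeConjectureFor (⨁ fun _ : Fin n => A).dim (⨁ fun _ : Fin n => A).X :=
  hodgeConjectureFor_of_forall_hodgeClassSpan_eq₆₅ _
    fun m ↦ hodgeClassSpan_pow_eq_divisorClassesSpan_of_forall_intermediateField hpq hp2 hq2 hexp hW hLp hLq hS hA n m

/-- **No power of such an `A` carries an exceptional Hodge class** (a rational `(m,m)`-class outside `Dᵐ ⊗ ℂ`). [cite: Gordon1999HodgeAVSurvey, Thm. 6.4] -/
theorem not_exists_exceptional_pow_of_forall_intermediateField [Fact p.Prime] [Fact q.Prime] (hpq : p ≠ q) (hp2 : p ≠ 2) (hq2 : q ≠ 2)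
    (hexp : ∀ g : K ≃ₐ[ℚ] K, g ^ (2 * (p * q)) = 1)
    (hW : ∀ F : IntermediateField ℚ K, Module.finrank ℚ F = 2 → ¬ IsTotallyReal F →
        ¬ ∀ τ : F →+* ℂ, {φ : K →+* ℂ | φ.comp (algebraMap F K) = τ ∧ φ ∈ Φ.1}.ncard =
          {φ : K →+* ℂ | φ.comp (algebraMap F K) = τ ∧ φ ∉ Φ.1}.ncard)
    (hLp : ∀ F : IntermediateField ℚ K, Module.finrank ℚ F = 2 * p → ¬ IsTotallyReal F →
        ¬ ∀ σ : F ≃ₐ[ℚ] F, σ ^ p = 1 → ∀ τ : F →+* ℂ,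
          {φ : K →+* ℂ | φ.comp (algebraMap F K) = τ.comp σ.toRingEquiv.toRingHom ∧ φ ∈ Φ.1}.ncard =
            {φ : K →+* ℂ | φ.comp (algebraMap F K) = τ ∧ φ ∈ Φ.1}.ncard)
    (hLq : ∀ F : IntermediateField ℚ K, Module.finrank ℚ F = 2 * q → ¬ IsTotallyReal F →
        ¬ ∀ σ : F ≃ₐ[ℚ] F, σ ^ q = 1 → ∀ τ : F →+* ℂ,
          {φ : K →+* ℂ | φ.comp (algebraMap F K) = τ.comp σ.toRingEquiv.toRingHom ∧ φ ∈ Φ.1}.ncard =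
            {φ : K →+* ℂ | φ.comp (algebraMap F K) = τ ∧ φ ∈ Φ.1}.ncard)
    (hS : ∀ F : IntermediateField ℚ K, Module.finrank ℚ F = 2 * (p * q) → ¬ IsTotallyReal F →
        ¬ ∀ σ σ' : F ≃ₐ[ℚ] F, σ ^ p = 1 → σ' ^ q = 1 → ∀ τ : F →+* ℂ,
          {φ : K →+* ℂ | φ.comp (algebraMap F K) = τ ∧ φ ∈ Φ.1}.ncard +
              {φ : K →+* ℂ | φ.comp (algebraMap F K) = τ.comp (σ * σ').toRingEquiv.toRingHom ∧ φ ∈ Φ.1}.ncard =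
            {φ : K →+* ℂ | φ.comp (algebraMap F K) = τ.comp σ.toRingEquiv.toRingHom ∧ φ ∈ Φ.1}.ncard +
              {φ : K →+* ℂ | φ.comp (algebraMap F K) = τ.comp σ'.toRingEquiv.toRingHom ∧ φ ∈ Φ.1}.ncard)
    (hA : IsCMTypeRealisation Φ A ι θ) (n m : ℕ) :
    ¬ ∃ c : complexBetti (⨁ fun _ : Fin n => A).X (2 * m), IsRationalClass c ∧
        IsOfHodgeType (⨁ fun _ : Fin n => A).dim (⨁ fun _ : Fin n => A).X (2 * m) m m c ∧
        c ∉ divisorClassesSpan (⨁ fun _ : Fin n => A).X (⨁ fun _ : Fin n => A).dim m := by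
  rintro ⟨c, hcQ, hcH, hcD⟩
  exact hcD ((hodgeClassSpan_pow_eq_divisorClassesSpan_of_forall_intermediateField hpq hp2 hq2 hexp hW hLp hLq hS hA n m) ▸
    Submodule.subset_span ⟨hcQ, hcH⟩)

/-- **Conversely, a CM subfield of degree `2pq` over which `Φ` is additively separable makes the type DEGENERATE** (its `(p−1)(q−1)` characters
vanish on `S`; the Weil-quadratic and level converses are the neighbours' `not_isNondegenerate_of_balanced ∕ …_of_equidistributed`).
[cite: Hazama2003CyclicCM, Thm. 4.8] [cite: Kubota1965, §4 Lemma 2] -/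
theorem not_isNondegenerate_of_separable [Fact p.Prime] [Fact q.Prime] (hpq : p ≠ q) (hp2 : p ≠ 2) (hq2 : q ≠ 2)
    (hexp : ∀ g : K ≃ₐ[ℚ] K, g ^ (2 * (p * q)) = 1) (Φ : CMType K) (F : IntermediateField ℚ K)
    (h2pq : Module.finrank ℚ F = 2 * (p * q)) (hF : ¬ IsTotallyReal F)
    (hS : ∀ σ σ' : F ≃ₐ[ℚ] F, σ ^ p = 1 → σ' ^ q = 1 → ∀ τ : F →+* ℂ,
          {φ : K →+* ℂ | φ.comp (algebraMap F K) = τ ∧ φ ∈ Φ.1}.ncard +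
              {φ : K →+* ℂ | φ.comp (algebraMap F K) = τ.comp (σ * σ').toRingEquiv.toRingHom ∧ φ ∈ Φ.1}.ncard =
            {φ : K →+* ℂ | φ.comp (algebraMap F K) = τ.comp σ.toRingEquiv.toRingHom ∧ φ ∈ Φ.1}.ncard +
              {φ : K →+* ℂ | φ.comp (algebraMap F K) = τ.comp σ'.toRingEquiv.toRingHom ∧ φ ∈ Φ.1}.ncard) :
    ¬ IsNondegenerate Φ := by
  rw [isNondegenerate_iff_forall_intermediateField hpq hp2 hq2 hexp Φ]
  exact fun h => h.2.2.2 F h2pq hF hS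

/-- **… and so does a CM subfield of degree `2p` over which `Φ` is level of exponent `p`** (in exponent `2pq`). [cite: Hazama2003CyclicCM, Prop. 4.3]
[cite: Kubota1965, §4 Lemma 2] -/
theorem not_isNondegenerate_of_level [Fact p.Prime] [Fact q.Prime] (hpq : p ≠ q) (hp2 : p ≠ 2) (hq2 : q ≠ 2)
    (hexp : ∀ g : K ≃ₐ[ℚ] K, g ^ (2 * (p * q)) = 1) (Φ : CMType K) (F : IntermediateField ℚ K)
    (h2p : Module.finrank ℚ F = 2 * p) (hF : ¬ IsTotallyReal F)
    (hL : ∀ σ : F ≃ₐ[ℚ] F, σ ^ p = 1 → ∀ τ : F →+* ℂ,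
      {φ : K →+* ℂ | φ.comp (algebraMap F K) = τ.comp σ.toRingEquiv.toRingHom ∧ φ ∈ Φ.1}.ncard =
        {φ : K →+* ℂ | φ.comp (algebraMap F K) = τ ∧ φ ∈ Φ.1}.ncard) :
    ¬ IsNondegenerate Φ := by
  rw [isNondegenerate_iff_forall_intermediateField hpq hp2 hq2 hexp Φ]
  exact fun h => h.2.1 F h2p hF hL

end Varieties

/-! ## §4 The cyclotomic fields `ℚ(ζ_N)` with `(ℤ/N)ˣ` of exponent `2pq`: `N = 77, 93, 99, 124` (`φ = 60`, exponent `30`) -/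

section Cyclotomic

open Literature.AlgebraicGeometry.Motives (AbelianVariety)
open Literature.AlgebraicGeometry.HodgeTheory
open Literature.AlgebraicGeometry.ComplexMultiplication (IsCMTypeRealisation)
open Literature.AlgebraicGeometry.VanGeemen1994 (hodgeClassSpan)
open Literature.Barriers.HodgeConjecture (divisorClassesSpan)
open _root_.CategoryTheory _root_.CategoryTheory.Limits
open Polynomial

variable {N p q : ℕ} {L : Type} [Field L] [NumberField L]
  {Φ : CMType L} {A : AbelianVariety ℂ} {ι : 𝓞 L →+* End A} {θ : L →+* Module.End ℂ (complexBetti A.X 1)}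

/-- **The rank formula for `ℚ(ζ_N)`, `(ℤ/N)ˣ` of exponent `2pq`**:
`Rank(Φ) + b(Φ) + (p − 1)·e_{2p}(Φ) + (q − 1)·e_{2q}(Φ) + (p − 1)(q − 1)·s_{2pq}(Φ) = φ(N)/2 + 1`. [cite: Kubota1965, §4 Lemma 2]
[cite: Hazama2003CyclicCM, Prop. 4.3 and Thm. 4.8] [cite: Dodson1984, §3.1.1 Theorem] [cite: Washington1997, Ch. 2 Thm. 2.5] -/
theorem cmTypeRank_add_ncard_subfields_eq_of_isCyclotomicExtension [NeZero N] [IsCyclotomicExtension {N} ℚ L]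
    (h2N : 2 < N) [Fact p.Prime] [Fact q.Prime] (hpq : p ≠ q) (hp2 : p ≠ 2) (hq2 : q ≠ 2)
    (hN : ∀ u : (ZMod N)ˣ, u ^ (2 * (p * q)) = 1) (Φ : CMType L) :
    cmTypeRank Φ + {F : IntermediateField ℚ L | Module.finrank ℚ F = 2 ∧ ¬ IsTotallyReal F ∧
        ∀ τ : F →+* ℂ, {φ : L →+* ℂ | φ.comp (algebraMap F L) = τ ∧ φ ∈ Φ.1}.ncard =
          {φ : L →+* ℂ | φ.comp (algebraMap F L) = τ ∧ φ ∉ Φ.1}.ncard}.ncard +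
      (p - 1) * {F : IntermediateField ℚ L | Module.finrank ℚ F = 2 * p ∧ ¬ IsTotallyReal F ∧
        ∀ σ : F ≃ₐ[ℚ] F, σ ^ p = 1 → ∀ τ : F →+* ℂ,
          {φ : L →+* ℂ | φ.comp (algebraMap F L) = τ.comp σ.toRingEquiv.toRingHom ∧ φ ∈ Φ.1}.ncard =
            {φ : L →+* ℂ | φ.comp (algebraMap F L) = τ ∧ φ ∈ Φ.1}.ncard}.ncard +
      (q - 1) * {F : IntermediateField ℚ L | Module.finrank ℚ F = 2 * q ∧ ¬ IsTotallyReal F ∧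
        ∀ σ : F ≃ₐ[ℚ] F, σ ^ q = 1 → ∀ τ : F →+* ℂ,
          {φ : L →+* ℂ | φ.comp (algebraMap F L) = τ.comp σ.toRingEquiv.toRingHom ∧ φ ∈ Φ.1}.ncard =
            {φ : L →+* ℂ | φ.comp (algebraMap F L) = τ ∧ φ ∈ Φ.1}.ncard}.ncard +
      (p - 1) * (q - 1) * {F : IntermediateField ℚ L | Module.finrank ℚ F = 2 * (p * q) ∧ ¬ IsTotallyReal F ∧
        ∀ σ σ' : F ≃ₐ[ℚ] F, σ ^ p = 1 → σ' ^ q = 1 → ∀ τ : F →+* ℂ,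
          {φ : L →+* ℂ | φ.comp (algebraMap F L) = τ ∧ φ ∈ Φ.1}.ncard +
              {φ : L →+* ℂ | φ.comp (algebraMap F L) = τ.comp (σ * σ').toRingEquiv.toRingHom ∧ φ ∈ Φ.1}.ncard =
            {φ : L →+* ℂ | φ.comp (algebraMap F L) = τ.comp σ.toRingEquiv.toRingHom ∧ φ ∈ Φ.1}.ncard +
              {φ : L →+* ℂ | φ.comp (algebraMap F L) = τ.comp σ'.toRingEquiv.toRingHom ∧ φ ∈ Φ.1}.ncard}.ncard = Nat.totient N / 2 + 1 := by
  obtain ⟨hcm, hab, hexp, hL⟩ := cm_abelian_pow_eq_one_of_isCyclotomicExtension h2N hN L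
  haveI := hcm; haveI := hab
  rw [← hL]
  exact cmTypeRank_add_ncard_subfields_eq hpq hp2 hq2 hexp Φ

/-- **Nondegeneracy criterion for `ℚ(ζ_N)`, `(ℤ/N)ˣ` of exponent `2pq`**: no Weil imaginary quadratic subfield, no CM subfield of degree `2p`
(resp. `2q`) over which `Φ` is level, no CM subfield of degree `2pq` over which `Φ` is additively separable. [cite: Kubota1965, §4 Lemma 2]
[cite: Hazama2003CyclicCM, Prop. 4.3 and Thm. 4.8] [cite: Dodson1984, §3.1.1 Theorem] -/
theorem isNondegenerate_iff_of_isCyclotomicExtension [NeZero N] [IsCyclotomicExtension {N} ℚ L]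
    (h2N : 2 < N) [Fact p.Prime] [Fact q.Prime] (hpq : p ≠ q) (hp2 : p ≠ 2) (hq2 : q ≠ 2)
    (hN : ∀ u : (ZMod N)ˣ, u ^ (2 * (p * q)) = 1) (Φ : CMType L) :
    IsNondegenerate Φ ↔
      (∀ F : IntermediateField ℚ L, Module.finrank ℚ F = 2 → ¬ IsTotallyReal F →
        ¬ ∀ τ : F →+* ℂ, {φ : L →+* ℂ | φ.comp (algebraMap F L) = τ ∧ φ ∈ Φ.1}.ncard =
          {φ : L →+* ℂ | φ.comp (algebraMap F L) = τ ∧ φ ∉ Φ.1}.ncard) ∧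
      (∀ F : IntermediateField ℚ L, Module.finrank ℚ F = 2 * p → ¬ IsTotallyReal F →
        ¬ ∀ σ : F ≃ₐ[ℚ] F, σ ^ p = 1 → ∀ τ : F →+* ℂ,
          {φ : L →+* ℂ | φ.comp (algebraMap F L) = τ.comp σ.toRingEquiv.toRingHom ∧ φ ∈ Φ.1}.ncard =
            {φ : L →+* ℂ | φ.comp (algebraMap F L) = τ ∧ φ ∈ Φ.1}.ncard) ∧
      (∀ F : IntermediateField ℚ L, Module.finrank ℚ F = 2 * q → ¬ IsTotallyReal F →
        ¬ ∀ σ : F ≃ₐ[ℚ] F, σ ^ q = 1 → ∀ τ : F →+* ℂ,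
          {φ : L →+* ℂ | φ.comp (algebraMap F L) = τ.comp σ.toRingEquiv.toRingHom ∧ φ ∈ Φ.1}.ncard =
            {φ : L →+* ℂ | φ.comp (algebraMap F L) = τ ∧ φ ∈ Φ.1}.ncard) ∧
      (∀ F : IntermediateField ℚ L, Module.finrank ℚ F = 2 * (p * q) → ¬ IsTotallyReal F →
        ¬ ∀ σ σ' : F ≃ₐ[ℚ] F, σ ^ p = 1 → σ' ^ q = 1 → ∀ τ : F →+* ℂ,
          {φ : L →+* ℂ | φ.comp (algebraMap F L) = τ ∧ φ ∈ Φ.1}.ncard +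
              {φ : L →+* ℂ | φ.comp (algebraMap F L) = τ.comp (σ * σ').toRingEquiv.toRingHom ∧ φ ∈ Φ.1}.ncard =
            {φ : L →+* ℂ | φ.comp (algebraMap F L) = τ.comp σ.toRingEquiv.toRingHom ∧ φ ∈ Φ.1}.ncard +
              {φ : L →+* ℂ | φ.comp (algebraMap F L) = τ.comp σ'.toRingEquiv.toRingHom ∧ φ ∈ Φ.1}.ncard) := by
  obtain ⟨hcm, hab, hexp, -⟩ := cm_abelian_pow_eq_one_of_isCyclotomicExtension h2N hN L
  haveI := hcm; haveI := hab
  exact isNondegenerate_iff_forall_intermediateField hpq hp2 hq2 hexp Φ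

/-- **The Hodge conjecture for all powers of every realisation of a type of `ℚ(ζ_N)`** (`(ℤ/N)ˣ` of exponent `2pq`) **off the four lists** —
UNCONDITIONAL. [cite: Gordon1999HodgeAVSurvey, Thm. 6.4 and §9.3] [cite: Kubota1965, §4 Lemma 2] -/
theorem hodgeConjectureFor_pow_of_forall_of_isCyclotomicExtension [NeZero N] [IsCyclotomicExtension {N} ℚ L]
    (h2N : 2 < N) [Fact p.Prime] [Fact q.Prime] (hpq : p ≠ q) (hp2 : p ≠ 2) (hq2 : q ≠ 2)
    (hN : ∀ u : (ZMod N)ˣ, u ^ (2 * (p * q)) = 1)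
    (hW : ∀ F : IntermediateField ℚ L, Module.finrank ℚ F = 2 → ¬ IsTotallyReal F →
        ¬ ∀ τ : F →+* ℂ, {φ : L →+* ℂ | φ.comp (algebraMap F L) = τ ∧ φ ∈ Φ.1}.ncard =
          {φ : L →+* ℂ | φ.comp (algebraMap F L) = τ ∧ φ ∉ Φ.1}.ncard)
    (hLp : ∀ F : IntermediateField ℚ L, Module.finrank ℚ F = 2 * p → ¬ IsTotallyReal F →
        ¬ ∀ σ : F ≃ₐ[ℚ] F, σ ^ p = 1 → ∀ τ : F →+* ℂ,
          {φ : L →+* ℂ | φ.comp (algebraMap F L) = τ.comp σ.toRingEquiv.toRingHom ∧ φ ∈ Φ.1}.ncard =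
            {φ : L →+* ℂ | φ.comp (algebraMap F L) = τ ∧ φ ∈ Φ.1}.ncard)
    (hLq : ∀ F : IntermediateField ℚ L, Module.finrank ℚ F = 2 * q → ¬ IsTotallyReal F →
        ¬ ∀ σ : F ≃ₐ[ℚ] F, σ ^ q = 1 → ∀ τ : F →+* ℂ,
          {φ : L →+* ℂ | φ.comp (algebraMap F L) = τ.comp σ.toRingEquiv.toRingHom ∧ φ ∈ Φ.1}.ncard =
            {φ : L →+* ℂ | φ.comp (algebraMap F L) = τ ∧ φ ∈ Φ.1}.ncard)
    (hS : ∀ F : IntermediateField ℚ L, Module.finrank ℚ F = 2 * (p * q) → ¬ IsTotallyReal F →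
        ¬ ∀ σ σ' : F ≃ₐ[ℚ] F, σ ^ p = 1 → σ' ^ q = 1 → ∀ τ : F →+* ℂ,
          {φ : L →+* ℂ | φ.comp (algebraMap F L) = τ ∧ φ ∈ Φ.1}.ncard +
              {φ : L →+* ℂ | φ.comp (algebraMap F L) = τ.comp (σ * σ').toRingEquiv.toRingHom ∧ φ ∈ Φ.1}.ncard =
            {φ : L →+* ℂ | φ.comp (algebraMap F L) = τ.comp σ.toRingEquiv.toRingHom ∧ φ ∈ Φ.1}.ncard +
              {φ : L →+* ℂ | φ.comp (algebraMap F L) = τ.comp σ'.toRingEquiv.toRingHom ∧ φ ∈ Φ.1}.ncard)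
    (hA : IsCMTypeRealisation Φ A ι θ) (n : ℕ) :
    HodgeConjectureFor (⨁ fun _ : Fin n => A).dim (⨁ fun _ : Fin n => A).X := by
  obtain ⟨hcm, hab, hexp, -⟩ := cm_abelian_pow_eq_one_of_isCyclotomicExtension h2N hN L
  haveI := hcm; haveI := hab
  exact hodgeConjectureFor_pow_of_forall_intermediateField hpq hp2 hq2 hexp hW hLp hLq hS hA n

/-! ### The levels `77`, `93`, `99`, `124`: `(ℤ/N)ˣ` of exponent `30 = 2·3·5`, degree `φ(N) = 60` -/

/-- `u³⁰ = 1` for every unit of `ℤ/77`: `(ℤ/77)ˣ ≅ ℤ/6 × ℤ/10` (`77 = 7·11`; kernel decision on residues coprime to `77`).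
[cite: Washington1997, Ch. 2 Thm. 2.5] -/
theorem units_pow_thirty_seventySeven (u : (ZMod 77)ˣ) : u ^ (2 * (3 * 5)) = 1 := by
  have h : ∀ a : ZMod 77, Nat.Coprime a.val 77 → a ^ 30 = 1 := by decide +kernel
  exact Units.ext (by rw [Units.val_pow_eq_pow_val, h _ (ZMod.val_coe_unit_coprime u), Units.val_one])

/-- **`ℚ(ζ_{77})` (degree `60`, `Gal ≅ ℤ/6 × ℤ/10`, exponent `30`): the rank formula `Rank(Φ) + b(Φ) + 2·e₆(Φ) + 4·e₁₀(Φ) + 8·s₃₀(Φ) = 31`** for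
every CM type — `b` = number of imaginary quadratic subfields over which `Φ` is of Weil type, `e₆` (`e₁₀`) = number of cyclic sextic (decic) CM
subfields over which `Φ` is level of exponent `3` (`5`), `s₃₀` = number of CM subfields of degree `30` over which `Φ` is additively separable.
[cite: Kubota1965, §4 Lemma 2] [cite: Hazama2003CyclicCM, Prop. 4.3 and Thm. 4.8] [cite: Dodson1984, §3.1.1 Theorem] -/
theorem cmTypeRank_add_ncard_subfields_seventySeven [IsCyclotomicExtension {77} ℚ L] (Φ : CMType L) :
    cmTypeRank Φ + {F : IntermediateField ℚ L | Module.finrank ℚ F = 2 ∧ ¬ IsTotallyReal F ∧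
        ∀ τ : F →+* ℂ, {φ : L →+* ℂ | φ.comp (algebraMap F L) = τ ∧ φ ∈ Φ.1}.ncard =
          {φ : L →+* ℂ | φ.comp (algebraMap F L) = τ ∧ φ ∉ Φ.1}.ncard}.ncard +
      2 * {F : IntermediateField ℚ L | Module.finrank ℚ F = 6 ∧ ¬ IsTotallyReal F ∧
        ∀ σ : F ≃ₐ[ℚ] F, σ ^ (3 : ℕ) = AlgEquiv.refl → ∀ τ : F →+* ℂ,
          {φ : L →+* ℂ | φ.comp (algebraMap F L) = τ.comp σ.toRingEquiv.toRingHom ∧ φ ∈ Φ.1}.ncard =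
            {φ : L →+* ℂ | φ.comp (algebraMap F L) = τ ∧ φ ∈ Φ.1}.ncard}.ncard +
      4 * {F : IntermediateField ℚ L | Module.finrank ℚ F = 10 ∧ ¬ IsTotallyReal F ∧
        ∀ σ : F ≃ₐ[ℚ] F, σ ^ (5 : ℕ) = AlgEquiv.refl → ∀ τ : F →+* ℂ,
          {φ : L →+* ℂ | φ.comp (algebraMap F L) = τ.comp σ.toRingEquiv.toRingHom ∧ φ ∈ Φ.1}.ncard =
            {φ : L →+* ℂ | φ.comp (algebraMap F L) = τ ∧ φ ∈ Φ.1}.ncard}.ncard +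
      8 * {F : IntermediateField ℚ L | Module.finrank ℚ F = 30 ∧ ¬ IsTotallyReal F ∧
        ∀ σ σ' : F ≃ₐ[ℚ] F, σ ^ (3 : ℕ) = AlgEquiv.refl → σ' ^ (5 : ℕ) = AlgEquiv.refl → ∀ τ : F →+* ℂ,
          {φ : L →+* ℂ | φ.comp (algebraMap F L) = τ ∧ φ ∈ Φ.1}.ncard +
              {φ : L →+* ℂ | φ.comp (algebraMap F L) = τ.comp (σ * σ').toRingEquiv.toRingHom ∧ φ ∈ Φ.1}.ncard =
            {φ : L →+* ℂ | φ.comp (algebraMap F L) = τ.comp σ.toRingEquiv.toRingHom ∧ φ ∈ Φ.1}.ncard +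
              {φ : L →+* ℂ | φ.comp (algebraMap F L) = τ.comp σ'.toRingEquiv.toRingHom ∧ φ ∈ Φ.1}.ncard}.ncard = 31 := by
  haveI : Fact (Nat.Prime 3) := ⟨Nat.prime_three⟩
  haveI : Fact (Nat.Prime 5) := ⟨Nat.prime_five⟩
  have h := cmTypeRank_add_ncard_subfields_eq_of_isCyclotomicExtension (L := L) (N := 77) (by norm_num)
    (by decide : (3 : ℕ) ≠ 5) (by decide : (3 : ℕ) ≠ 2) (by decide : (5 : ℕ) ≠ 2) units_pow_thirty_seventySeven Φ
  have hN : Nat.totient 77 = 60 := by decide +kernel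
  rw [hN] at h
  exact h

/-- **`ℚ(ζ_{77})`: THE HODGE CONJECTURE FOR ALL POWERS of every abelian variety with complex multiplication by `ℚ(ζ_{77})` (CM `30`-folds)
whose type is of Weil type over none of the imaginary quadratic subfields, level over none of the sextic and decic CM subfields and additively
separable over none of the CM subfields of degree `30`** — UNCONDITIONAL. [cite: Gordon1999HodgeAVSurvey, Thm. 6.4 and §9.3] [cite: Kubota1965, §4 Lemma 2] -/
theorem hodgeConjectureFor_pow_of_forall_seventySeven [IsCyclotomicExtension {77} ℚ L]
    (hW : ∀ F : IntermediateField ℚ L, Module.finrank ℚ F = 2 → ¬ IsTotallyReal F →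
        ¬ ∀ τ : F →+* ℂ, {φ : L →+* ℂ | φ.comp (algebraMap F L) = τ ∧ φ ∈ Φ.1}.ncard =
          {φ : L →+* ℂ | φ.comp (algebraMap F L) = τ ∧ φ ∉ Φ.1}.ncard)
    (hLp : ∀ F : IntermediateField ℚ L, Module.finrank ℚ F = 2 * 3 → ¬ IsTotallyReal F →
        ¬ ∀ σ : F ≃ₐ[ℚ] F, σ ^ (3 : ℕ) = AlgEquiv.refl → ∀ τ : F →+* ℂ,
          {φ : L →+* ℂ | φ.comp (algebraMap F L) = τ.comp σ.toRingEquiv.toRingHom ∧ φ ∈ Φ.1}.ncard =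
            {φ : L →+* ℂ | φ.comp (algebraMap F L) = τ ∧ φ ∈ Φ.1}.ncard)
    (hLq : ∀ F : IntermediateField ℚ L, Module.finrank ℚ F = 2 * 5 → ¬ IsTotallyReal F →
        ¬ ∀ σ : F ≃ₐ[ℚ] F, σ ^ (5 : ℕ) = AlgEquiv.refl → ∀ τ : F →+* ℂ,
          {φ : L →+* ℂ | φ.comp (algebraMap F L) = τ.comp σ.toRingEquiv.toRingHom ∧ φ ∈ Φ.1}.ncard =
            {φ : L →+* ℂ | φ.comp (algebraMap F L) = τ ∧ φ ∈ Φ.1}.ncard)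
    (hS : ∀ F : IntermediateField ℚ L, Module.finrank ℚ F = 2 * (3 * 5) → ¬ IsTotallyReal F →
        ¬ ∀ σ σ' : F ≃ₐ[ℚ] F, σ ^ (3 : ℕ) = AlgEquiv.refl → σ' ^ (5 : ℕ) = AlgEquiv.refl → ∀ τ : F →+* ℂ,
          {φ : L →+* ℂ | φ.comp (algebraMap F L) = τ ∧ φ ∈ Φ.1}.ncard +
              {φ : L →+* ℂ | φ.comp (algebraMap F L) = τ.comp (σ * σ').toRingEquiv.toRingHom ∧ φ ∈ Φ.1}.ncard =
            {φ : L →+* ℂ | φ.comp (algebraMap F L) = τ.comp σ.toRingEquiv.toRingHom ∧ φ ∈ Φ.1}.ncard +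
              {φ : L →+* ℂ | φ.comp (algebraMap F L) = τ.comp σ'.toRingEquiv.toRingHom ∧ φ ∈ Φ.1}.ncard)
    (hA : IsCMTypeRealisation Φ A ι θ) (n : ℕ) :
    HodgeConjectureFor (⨁ fun _ : Fin n => A).dim (⨁ fun _ : Fin n => A).X :=
  haveI : Fact (Nat.Prime 3) := ⟨Nat.prime_three⟩
  haveI : Fact (Nat.Prime 5) := ⟨Nat.prime_five⟩
  hodgeConjectureFor_pow_of_forall_of_isCyclotomicExtension (N := 77) (by norm_num) (by decide) (by decide) (by decide)
    units_pow_thirty_seventySeven hW hLp hLq hS hA n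

/-- `u³⁰ = 1` for every unit of `ℤ/93`: `(ℤ/93)ˣ ≅ ℤ/2 × ℤ/30` (`93 = 3·31`; kernel decision on residues coprime to `93`).
[cite: Washington1997, Ch. 2 Thm. 2.5] -/
theorem units_pow_thirty_ninetyThree (u : (ZMod 93)ˣ) : u ^ (2 * (3 * 5)) = 1 := by
  have h : ∀ a : ZMod 93, Nat.Coprime a.val 93 → a ^ 30 = 1 := by decide +kernel
  exact Units.ext (by rw [Units.val_pow_eq_pow_val, h _ (ZMod.val_coe_unit_coprime u), Units.val_one])

/-- **`ℚ(ζ_{93})` (degree `60`, `Gal ≅ ℤ/2 × ℤ/30`, exponent `30`): the rank formula `Rank(Φ) + b(Φ) + 2·e₆(Φ) + 4·e₁₀(Φ) + 8·s₃₀(Φ) = 31`** for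
every CM type — `b` = number of imaginary quadratic subfields over which `Φ` is of Weil type, `e₆` (`e₁₀`) = number of cyclic sextic (decic) CM
subfields over which `Φ` is level of exponent `3` (`5`), `s₃₀` = number of CM subfields of degree `30` over which `Φ` is additively separable.
[cite: Kubota1965, §4 Lemma 2] [cite: Hazama2003CyclicCM, Prop. 4.3 and Thm. 4.8] [cite: Dodson1984, §3.1.1 Theorem] -/
theorem cmTypeRank_add_ncard_subfields_ninetyThree [IsCyclotomicExtension {93} ℚ L] (Φ : CMType L) :
    cmTypeRank Φ + {F : IntermediateField ℚ L | Module.finrank ℚ F = 2 ∧ ¬ IsTotallyReal F ∧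
        ∀ τ : F →+* ℂ, {φ : L →+* ℂ | φ.comp (algebraMap F L) = τ ∧ φ ∈ Φ.1}.ncard =
          {φ : L →+* ℂ | φ.comp (algebraMap F L) = τ ∧ φ ∉ Φ.1}.ncard}.ncard +
      2 * {F : IntermediateField ℚ L | Module.finrank ℚ F = 6 ∧ ¬ IsTotallyReal F ∧
        ∀ σ : F ≃ₐ[ℚ] F, σ ^ (3 : ℕ) = AlgEquiv.refl → ∀ τ : F →+* ℂ,
          {φ : L →+* ℂ | φ.comp (algebraMap F L) = τ.comp σ.toRingEquiv.toRingHom ∧ φ ∈ Φ.1}.ncard =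
            {φ : L →+* ℂ | φ.comp (algebraMap F L) = τ ∧ φ ∈ Φ.1}.ncard}.ncard +
      4 * {F : IntermediateField ℚ L | Module.finrank ℚ F = 10 ∧ ¬ IsTotallyReal F ∧
        ∀ σ : F ≃ₐ[ℚ] F, σ ^ (5 : ℕ) = AlgEquiv.refl → ∀ τ : F →+* ℂ,
          {φ : L →+* ℂ | φ.comp (algebraMap F L) = τ.comp σ.toRingEquiv.toRingHom ∧ φ ∈ Φ.1}.ncard =
            {φ : L →+* ℂ | φ.comp (algebraMap F L) = τ ∧ φ ∈ Φ.1}.ncard}.ncard +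
      8 * {F : IntermediateField ℚ L | Module.finrank ℚ F = 30 ∧ ¬ IsTotallyReal F ∧
        ∀ σ σ' : F ≃ₐ[ℚ] F, σ ^ (3 : ℕ) = AlgEquiv.refl → σ' ^ (5 : ℕ) = AlgEquiv.refl → ∀ τ : F →+* ℂ,
          {φ : L →+* ℂ | φ.comp (algebraMap F L) = τ ∧ φ ∈ Φ.1}.ncard +
              {φ : L →+* ℂ | φ.comp (algebraMap F L) = τ.comp (σ * σ').toRingEquiv.toRingHom ∧ φ ∈ Φ.1}.ncard =
            {φ : L →+* ℂ | φ.comp (algebraMap F L) = τ.comp σ.toRingEquiv.toRingHom ∧ φ ∈ Φ.1}.ncard +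
              {φ : L →+* ℂ | φ.comp (algebraMap F L) = τ.comp σ'.toRingEquiv.toRingHom ∧ φ ∈ Φ.1}.ncard}.ncard = 31 := by
  haveI : Fact (Nat.Prime 3) := ⟨Nat.prime_three⟩
  haveI : Fact (Nat.Prime 5) := ⟨Nat.prime_five⟩
  have h := cmTypeRank_add_ncard_subfields_eq_of_isCyclotomicExtension (L := L) (N := 93) (by norm_num)
    (by decide : (3 : ℕ) ≠ 5) (by decide : (3 : ℕ) ≠ 2) (by decide : (5 : ℕ) ≠ 2) units_pow_thirty_ninetyThree Φ
  have hN : Nat.totient 93 = 60 := by decide +kernel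
  rw [hN] at h
  exact h

/-- **`ℚ(ζ_{93})`: THE HODGE CONJECTURE FOR ALL POWERS of every abelian variety with complex multiplication by `ℚ(ζ_{93})` (CM `30`-folds)
whose type is of Weil type over none of the imaginary quadratic subfields, level over none of the sextic and decic CM subfields and additively
separable over none of the CM subfields of degree `30`** — UNCONDITIONAL. [cite: Gordon1999HodgeAVSurvey, Thm. 6.4 and §9.3] [cite: Kubota1965, §4 Lemma 2] -/
theorem hodgeConjectureFor_pow_of_forall_ninetyThree [IsCyclotomicExtension {93} ℚ L]
    (hW : ∀ F : IntermediateField ℚ L, Module.finrank ℚ F = 2 → ¬ IsTotallyReal F →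
        ¬ ∀ τ : F →+* ℂ, {φ : L →+* ℂ | φ.comp (algebraMap F L) = τ ∧ φ ∈ Φ.1}.ncard =
          {φ : L →+* ℂ | φ.comp (algebraMap F L) = τ ∧ φ ∉ Φ.1}.ncard)
    (hLp : ∀ F : IntermediateField ℚ L, Module.finrank ℚ F = 2 * 3 → ¬ IsTotallyReal F →
        ¬ ∀ σ : F ≃ₐ[ℚ] F, σ ^ (3 : ℕ) = AlgEquiv.refl → ∀ τ : F →+* ℂ,
          {φ : L →+* ℂ | φ.comp (algebraMap F L) = τ.comp σ.toRingEquiv.toRingHom ∧ φ ∈ Φ.1}.ncard =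
            {φ : L →+* ℂ | φ.comp (algebraMap F L) = τ ∧ φ ∈ Φ.1}.ncard)
    (hLq : ∀ F : IntermediateField ℚ L, Module.finrank ℚ F = 2 * 5 → ¬ IsTotallyReal F →
        ¬ ∀ σ : F ≃ₐ[ℚ] F, σ ^ (5 : ℕ) = AlgEquiv.refl → ∀ τ : F →+* ℂ,
          {φ : L →+* ℂ | φ.comp (algebraMap F L) = τ.comp σ.toRingEquiv.toRingHom ∧ φ ∈ Φ.1}.ncard =
            {φ : L →+* ℂ | φ.comp (algebraMap F L) = τ ∧ φ ∈ Φ.1}.ncard)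
    (hS : ∀ F : IntermediateField ℚ L, Module.finrank ℚ F = 2 * (3 * 5) → ¬ IsTotallyReal F →
        ¬ ∀ σ σ' : F ≃ₐ[ℚ] F, σ ^ (3 : ℕ) = AlgEquiv.refl → σ' ^ (5 : ℕ) = AlgEquiv.refl → ∀ τ : F →+* ℂ,
          {φ : L →+* ℂ | φ.comp (algebraMap F L) = τ ∧ φ ∈ Φ.1}.ncard +
              {φ : L →+* ℂ | φ.comp (algebraMap F L) = τ.comp (σ * σ').toRingEquiv.toRingHom ∧ φ ∈ Φ.1}.ncard =
            {φ : L →+* ℂ | φ.comp (algebraMap F L) = τ.comp σ.toRingEquiv.toRingHom ∧ φ ∈ Φ.1}.ncard +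
              {φ : L →+* ℂ | φ.comp (algebraMap F L) = τ.comp σ'.toRingEquiv.toRingHom ∧ φ ∈ Φ.1}.ncard)
    (hA : IsCMTypeRealisation Φ A ι θ) (n : ℕ) :
    HodgeConjectureFor (⨁ fun _ : Fin n => A).dim (⨁ fun _ : Fin n => A).X :=
  haveI : Fact (Nat.Prime 3) := ⟨Nat.prime_three⟩
  haveI : Fact (Nat.Prime 5) := ⟨Nat.prime_five⟩
  hodgeConjectureFor_pow_of_forall_of_isCyclotomicExtension (N := 93) (by norm_num) (by decide) (by decide) (by decide)
    units_pow_thirty_ninetyThree hW hLp hLq hS hA n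

/-- `u³⁰ = 1` for every unit of `ℤ/99`: `(ℤ/99)ˣ ≅ ℤ/6 × ℤ/10` (`99 = 9·11`; kernel decision on residues coprime to `99`).
[cite: Washington1997, Ch. 2 Thm. 2.5] -/
theorem units_pow_thirty_ninetyNine (u : (ZMod 99)ˣ) : u ^ (2 * (3 * 5)) = 1 := by
  have h : ∀ a : ZMod 99, Nat.Coprime a.val 99 → a ^ 30 = 1 := by decide +kernel
  exact Units.ext (by rw [Units.val_pow_eq_pow_val, h _ (ZMod.val_coe_unit_coprime u), Units.val_one])

/-- **`ℚ(ζ_{99})` (degree `60`, `Gal ≅ ℤ/6 × ℤ/10`, exponent `30`): the rank formula `Rank(Φ) + b(Φ) + 2·e₆(Φ) + 4·e₁₀(Φ) + 8·s₃₀(Φ) = 31`** for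
every CM type — `b` = number of imaginary quadratic subfields over which `Φ` is of Weil type, `e₆` (`e₁₀`) = number of cyclic sextic (decic) CM
subfields over which `Φ` is level of exponent `3` (`5`), `s₃₀` = number of CM subfields of degree `30` over which `Φ` is additively separable.
[cite: Kubota1965, §4 Lemma 2] [cite: Hazama2003CyclicCM, Prop. 4.3 and Thm. 4.8] [cite: Dodson1984, §3.1.1 Theorem] -/
theorem cmTypeRank_add_ncard_subfields_ninetyNine [IsCyclotomicExtension {99} ℚ L] (Φ : CMType L) :
    cmTypeRank Φ + {F : IntermediateField ℚ L | Module.finrank ℚ F = 2 ∧ ¬ IsTotallyReal F ∧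
        ∀ τ : F →+* ℂ, {φ : L →+* ℂ | φ.comp (algebraMap F L) = τ ∧ φ ∈ Φ.1}.ncard =
          {φ : L →+* ℂ | φ.comp (algebraMap F L) = τ ∧ φ ∉ Φ.1}.ncard}.ncard +
      2 * {F : IntermediateField ℚ L | Module.finrank ℚ F = 6 ∧ ¬ IsTotallyReal F ∧
        ∀ σ : F ≃ₐ[ℚ] F, σ ^ (3 : ℕ) = AlgEquiv.refl → ∀ τ : F →+* ℂ,
          {φ : L →+* ℂ | φ.comp (algebraMap F L) = τ.comp σ.toRingEquiv.toRingHom ∧ φ ∈ Φ.1}.ncard =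
            {φ : L →+* ℂ | φ.comp (algebraMap F L) = τ ∧ φ ∈ Φ.1}.ncard}.ncard +
      4 * {F : IntermediateField ℚ L | Module.finrank ℚ F = 10 ∧ ¬ IsTotallyReal F ∧
        ∀ σ : F ≃ₐ[ℚ] F, σ ^ (5 : ℕ) = AlgEquiv.refl → ∀ τ : F →+* ℂ,
          {φ : L →+* ℂ | φ.comp (algebraMap F L) = τ.comp σ.toRingEquiv.toRingHom ∧ φ ∈ Φ.1}.ncard =
            {φ : L →+* ℂ | φ.comp (algebraMap F L) = τ ∧ φ ∈ Φ.1}.ncard}.ncard +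
      8 * {F : IntermediateField ℚ L | Module.finrank ℚ F = 30 ∧ ¬ IsTotallyReal F ∧
        ∀ σ σ' : F ≃ₐ[ℚ] F, σ ^ (3 : ℕ) = AlgEquiv.refl → σ' ^ (5 : ℕ) = AlgEquiv.refl → ∀ τ : F →+* ℂ,
          {φ : L →+* ℂ | φ.comp (algebraMap F L) = τ ∧ φ ∈ Φ.1}.ncard +
              {φ : L →+* ℂ | φ.comp (algebraMap F L) = τ.comp (σ * σ').toRingEquiv.toRingHom ∧ φ ∈ Φ.1}.ncard =
            {φ : L →+* ℂ | φ.comp (algebraMap F L) = τ.comp σ.toRingEquiv.toRingHom ∧ φ ∈ Φ.1}.ncard +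
              {φ : L →+* ℂ | φ.comp (algebraMap F L) = τ.comp σ'.toRingEquiv.toRingHom ∧ φ ∈ Φ.1}.ncard}.ncard = 31 := by
  haveI : Fact (Nat.Prime 3) := ⟨Nat.prime_three⟩
  haveI : Fact (Nat.Prime 5) := ⟨Nat.prime_five⟩
  have h := cmTypeRank_add_ncard_subfields_eq_of_isCyclotomicExtension (L := L) (N := 99) (by norm_num)
    (by decide : (3 : ℕ) ≠ 5) (by decide : (3 : ℕ) ≠ 2) (by decide : (5 : ℕ) ≠ 2) units_pow_thirty_ninetyNine Φ
  have hN : Nat.totient 99 = 60 := by decide +kernel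
  rw [hN] at h
  exact h

/-- **`ℚ(ζ_{99})`: THE HODGE CONJECTURE FOR ALL POWERS of every abelian variety with complex multiplication by `ℚ(ζ_{99})` (CM `30`-folds)
whose type is of Weil type over none of the imaginary quadratic subfields, level over none of the sextic and decic CM subfields and additively
separable over none of the CM subfields of degree `30`** — UNCONDITIONAL. [cite: Gordon1999HodgeAVSurvey, Thm. 6.4 and §9.3] [cite: Kubota1965, §4 Lemma 2] -/
theorem hodgeConjectureFor_pow_of_forall_ninetyNine [IsCyclotomicExtension {99} ℚ L]
    (hW : ∀ F : IntermediateField ℚ L, Module.finrank ℚ F = 2 → ¬ IsTotallyReal F →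
        ¬ ∀ τ : F →+* ℂ, {φ : L →+* ℂ | φ.comp (algebraMap F L) = τ ∧ φ ∈ Φ.1}.ncard =
          {φ : L →+* ℂ | φ.comp (algebraMap F L) = τ ∧ φ ∉ Φ.1}.ncard)
    (hLp : ∀ F : IntermediateField ℚ L, Module.finrank ℚ F = 2 * 3 → ¬ IsTotallyReal F →
        ¬ ∀ σ : F ≃ₐ[ℚ] F, σ ^ (3 : ℕ) = AlgEquiv.refl → ∀ τ : F →+* ℂ,
          {φ : L →+* ℂ | φ.comp (algebraMap F L) = τ.comp σ.toRingEquiv.toRingHom ∧ φ ∈ Φ.1}.ncard =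
            {φ : L →+* ℂ | φ.comp (algebraMap F L) = τ ∧ φ ∈ Φ.1}.ncard)
    (hLq : ∀ F : IntermediateField ℚ L, Module.finrank ℚ F = 2 * 5 → ¬ IsTotallyReal F →
        ¬ ∀ σ : F ≃ₐ[ℚ] F, σ ^ (5 : ℕ) = AlgEquiv.refl → ∀ τ : F →+* ℂ,
          {φ : L →+* ℂ | φ.comp (algebraMap F L) = τ.comp σ.toRingEquiv.toRingHom ∧ φ ∈ Φ.1}.ncard =
            {φ : L →+* ℂ | φ.comp (algebraMap F L) = τ ∧ φ ∈ Φ.1}.ncard)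
    (hS : ∀ F : IntermediateField ℚ L, Module.finrank ℚ F = 2 * (3 * 5) → ¬ IsTotallyReal F →
        ¬ ∀ σ σ' : F ≃ₐ[ℚ] F, σ ^ (3 : ℕ) = AlgEquiv.refl → σ' ^ (5 : ℕ) = AlgEquiv.refl → ∀ τ : F →+* ℂ,
          {φ : L →+* ℂ | φ.comp (algebraMap F L) = τ ∧ φ ∈ Φ.1}.ncard +
              {φ : L →+* ℂ | φ.comp (algebraMap F L) = τ.comp (σ * σ').toRingEquiv.toRingHom ∧ φ ∈ Φ.1}.ncard =
            {φ : L →+* ℂ | φ.comp (algebraMap F L) = τ.comp σ.toRingEquiv.toRingHom ∧ φ ∈ Φ.1}.ncard +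
              {φ : L →+* ℂ | φ.comp (algebraMap F L) = τ.comp σ'.toRingEquiv.toRingHom ∧ φ ∈ Φ.1}.ncard)
    (hA : IsCMTypeRealisation Φ A ι θ) (n : ℕ) :
    HodgeConjectureFor (⨁ fun _ : Fin n => A).dim (⨁ fun _ : Fin n => A).X :=
  haveI : Fact (Nat.Prime 3) := ⟨Nat.prime_three⟩
  haveI : Fact (Nat.Prime 5) := ⟨Nat.prime_five⟩
  hodgeConjectureFor_pow_of_forall_of_isCyclotomicExtension (N := 99) (by norm_num) (by decide) (by decide) (by decide)
    units_pow_thirty_ninetyNine hW hLp hLq hS hA n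

/-- `u³⁰ = 1` for every unit of `ℤ/124`: `(ℤ/124)ˣ ≅ ℤ/2 × ℤ/30` (`124 = 4·31`; kernel decision on residues coprime to `124`).
[cite: Washington1997, Ch. 2 Thm. 2.5] -/
theorem units_pow_thirty_oneHundredTwentyFour (u : (ZMod 124)ˣ) : u ^ (2 * (3 * 5)) = 1 := by
  have h : ∀ a : ZMod 124, Nat.Coprime a.val 124 → a ^ 30 = 1 := by decide +kernel
  exact Units.ext (by rw [Units.val_pow_eq_pow_val, h _ (ZMod.val_coe_unit_coprime u), Units.val_one])

/-- **`ℚ(ζ_{124})` (degree `60`, `Gal ≅ ℤ/2 × ℤ/30`, exponent `30`): the rank formula `Rank(Φ) + b(Φ) + 2·e₆(Φ) + 4·e₁₀(Φ) + 8·s₃₀(Φ) = 31`** for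
every CM type — `b` = number of imaginary quadratic subfields over which `Φ` is of Weil type, `e₆` (`e₁₀`) = number of cyclic sextic (decic) CM
subfields over which `Φ` is level of exponent `3` (`5`), `s₃₀` = number of CM subfields of degree `30` over which `Φ` is additively separable.
[cite: Kubota1965, §4 Lemma 2] [cite: Hazama2003CyclicCM, Prop. 4.3 and Thm. 4.8] [cite: Dodson1984, §3.1.1 Theorem] -/
theorem cmTypeRank_add_ncard_subfields_oneHundredTwentyFour [IsCyclotomicExtension {124} ℚ L] (Φ : CMType L) :
    cmTypeRank Φ + {F : IntermediateField ℚ L | Module.finrank ℚ F = 2 ∧ ¬ IsTotallyReal F ∧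
        ∀ τ : F →+* ℂ, {φ : L →+* ℂ | φ.comp (algebraMap F L) = τ ∧ φ ∈ Φ.1}.ncard =
          {φ : L →+* ℂ | φ.comp (algebraMap F L) = τ ∧ φ ∉ Φ.1}.ncard}.ncard +
      2 * {F : IntermediateField ℚ L | Module.finrank ℚ F = 6 ∧ ¬ IsTotallyReal F ∧
        ∀ σ : F ≃ₐ[ℚ] F, σ ^ (3 : ℕ) = AlgEquiv.refl → ∀ τ : F →+* ℂ,
          {φ : L →+* ℂ | φ.comp (algebraMap F L) = τ.comp σ.toRingEquiv.toRingHom ∧ φ ∈ Φ.1}.ncard =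
            {φ : L →+* ℂ | φ.comp (algebraMap F L) = τ ∧ φ ∈ Φ.1}.ncard}.ncard +
      4 * {F : IntermediateField ℚ L | Module.finrank ℚ F = 10 ∧ ¬ IsTotallyReal F ∧
        ∀ σ : F ≃ₐ[ℚ] F, σ ^ (5 : ℕ) = AlgEquiv.refl → ∀ τ : F →+* ℂ,
          {φ : L →+* ℂ | φ.comp (algebraMap F L) = τ.comp σ.toRingEquiv.toRingHom ∧ φ ∈ Φ.1}.ncard =
            {φ : L →+* ℂ | φ.comp (algebraMap F L) = τ ∧ φ ∈ Φ.1}.ncard}.ncard +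
      8 * {F : IntermediateField ℚ L | Module.finrank ℚ F = 30 ∧ ¬ IsTotallyReal F ∧
        ∀ σ σ' : F ≃ₐ[ℚ] F, σ ^ (3 : ℕ) = AlgEquiv.refl → σ' ^ (5 : ℕ) = AlgEquiv.refl → ∀ τ : F →+* ℂ,
          {φ : L →+* ℂ | φ.comp (algebraMap F L) = τ ∧ φ ∈ Φ.1}.ncard +
              {φ : L →+* ℂ | φ.comp (algebraMap F L) = τ.comp (σ * σ').toRingEquiv.toRingHom ∧ φ ∈ Φ.1}.ncard =
            {φ : L →+* ℂ | φ.comp (algebraMap F L) = τ.comp σ.toRingEquiv.toRingHom ∧ φ ∈ Φ.1}.ncard +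
              {φ : L →+* ℂ | φ.comp (algebraMap F L) = τ.comp σ'.toRingEquiv.toRingHom ∧ φ ∈ Φ.1}.ncard}.ncard = 31 := by
  haveI : Fact (Nat.Prime 3) := ⟨Nat.prime_three⟩
  haveI : Fact (Nat.Prime 5) := ⟨Nat.prime_five⟩
  have h := cmTypeRank_add_ncard_subfields_eq_of_isCyclotomicExtension (L := L) (N := 124) (by norm_num)
    (by decide : (3 : ℕ) ≠ 5) (by decide : (3 : ℕ) ≠ 2) (by decide : (5 : ℕ) ≠ 2) units_pow_thirty_oneHundredTwentyFour Φ
  have hN : Nat.totient 124 = 60 := by decide +kernel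
  rw [hN] at h
  exact h

/-- **`ℚ(ζ_{124})`: THE HODGE CONJECTURE FOR ALL POWERS of every abelian variety with complex multiplication by `ℚ(ζ_{124})` (CM `30`-folds)
whose type is of Weil type over none of the imaginary quadratic subfields, level over none of the sextic and decic CM subfields and additively
separable over none of the CM subfields of degree `30`** — UNCONDITIONAL. [cite: Gordon1999HodgeAVSurvey, Thm. 6.4 and §9.3] [cite: Kubota1965, §4 Lemma 2] -/
theorem hodgeConjectureFor_pow_of_forall_oneHundredTwentyFour [IsCyclotomicExtension {124} ℚ L]
    (hW : ∀ F : IntermediateField ℚ L, Module.finrank ℚ F = 2 → ¬ IsTotallyReal F →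
        ¬ ∀ τ : F →+* ℂ, {φ : L →+* ℂ | φ.comp (algebraMap F L) = τ ∧ φ ∈ Φ.1}.ncard =
          {φ : L →+* ℂ | φ.comp (algebraMap F L) = τ ∧ φ ∉ Φ.1}.ncard)
    (hLp : ∀ F : IntermediateField ℚ L, Module.finrank ℚ F = 2 * 3 → ¬ IsTotallyReal F →
        ¬ ∀ σ : F ≃ₐ[ℚ] F, σ ^ (3 : ℕ) = AlgEquiv.refl → ∀ τ : F →+* ℂ,
          {φ : L →+* ℂ | φ.comp (algebraMap F L) = τ.comp σ.toRingEquiv.toRingHom ∧ φ ∈ Φ.1}.ncard =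
            {φ : L →+* ℂ | φ.comp (algebraMap F L) = τ ∧ φ ∈ Φ.1}.ncard)
    (hLq : ∀ F : IntermediateField ℚ L, Module.finrank ℚ F = 2 * 5 → ¬ IsTotallyReal F →
        ¬ ∀ σ : F ≃ₐ[ℚ] F, σ ^ (5 : ℕ) = AlgEquiv.refl → ∀ τ : F →+* ℂ,
          {φ : L →+* ℂ | φ.comp (algebraMap F L) = τ.comp σ.toRingEquiv.toRingHom ∧ φ ∈ Φ.1}.ncard =
            {φ : L →+* ℂ | φ.comp (algebraMap F L) = τ ∧ φ ∈ Φ.1}.ncard)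
    (hS : ∀ F : IntermediateField ℚ L, Module.finrank ℚ F = 2 * (3 * 5) → ¬ IsTotallyReal F →
        ¬ ∀ σ σ' : F ≃ₐ[ℚ] F, σ ^ (3 : ℕ) = AlgEquiv.refl → σ' ^ (5 : ℕ) = AlgEquiv.refl → ∀ τ : F →+* ℂ,
          {φ : L →+* ℂ | φ.comp (algebraMap F L) = τ ∧ φ ∈ Φ.1}.ncard +
              {φ : L →+* ℂ | φ.comp (algebraMap F L) = τ.comp (σ * σ').toRingEquiv.toRingHom ∧ φ ∈ Φ.1}.ncard =
            {φ : L →+* ℂ | φ.comp (algebraMap F L) = τ.comp σ.toRingEquiv.toRingHom ∧ φ ∈ Φ.1}.ncard +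
              {φ : L →+* ℂ | φ.comp (algebraMap F L) = τ.comp σ'.toRingEquiv.toRingHom ∧ φ ∈ Φ.1}.ncard)
    (hA : IsCMTypeRealisation Φ A ι θ) (n : ℕ) :
    HodgeConjectureFor (⨁ fun _ : Fin n => A).dim (⨁ fun _ : Fin n => A).X :=
  haveI : Fact (Nat.Prime 3) := ⟨Nat.prime_three⟩
  haveI : Fact (Nat.Prime 5) := ⟨Nat.prime_five⟩
  hodgeConjectureFor_pow_of_forall_of_isCyclotomicExtension (N := 124) (by norm_num) (by decide) (by decide) (by decide)
    units_pow_thirty_oneHundredTwentyFour hW hLp hLq hS hA n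

/-! ### APPENDED (gen 65): the levels of exponent `42 = 2·3·7` — `43, 49` (`(ℤ/N)ˣ ≅ ℤ/42` cyclic, `φ = 42`) and `129, 147, 172, 196`
(`ℤ/2 × ℤ/42`, the «φ(N) = 84» band) -/

/-- `u⁴² = 1` for every unit of `ℤ/43`: `(ℤ/43)ˣ ≅ ℤ/42 (cyclic)` (`43 = 43 prime`; kernel decision on residues coprime to `43`).
[cite: Washington1997, Ch. 2 Thm. 2.5] -/
theorem units_pow_fortyTwo_fortyThree (u : (ZMod 43)ˣ) : u ^ (2 * (3 * 7)) = 1 := by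
  have h : ∀ a : ZMod 43, Nat.Coprime a.val 43 → a ^ 42 = 1 := by decide +kernel
  exact Units.ext (by rw [Units.val_pow_eq_pow_val, h _ (ZMod.val_coe_unit_coprime u), Units.val_one])

/-- **`ℚ(ζ_{43})` (degree `42`, `Gal ≅ ℤ/42 (cyclic)`, exponent `42`): the rank formula `Rank(Φ) + b(Φ) + 2·e₆(Φ) + 6·e₁₄(Φ) + 12·s₄₂(Φ) = 22`** for
every CM type — `b` = number of imaginary quadratic subfields over which `Φ` is of Weil type, `e₆` (`e₁₄`) = number of cyclic CM subfields of degree `6`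
(`14`) over which `Φ` is level of exponent `3` (`7`), `s₄₂` = number of CM subfields of degree `42` over which `Φ` is additively separable.
[cite: Kubota1965, §4 Lemma 2] [cite: Hazama2003CyclicCM, Prop. 4.3 and Thm. 4.8] [cite: Dodson1984, §3.1.1 Theorem] -/
theorem cmTypeRank_add_ncard_subfields_fortyThree [IsCyclotomicExtension {43} ℚ L] (Φ : CMType L) :
    cmTypeRank Φ + {F : IntermediateField ℚ L | Module.finrank ℚ F = 2 ∧ ¬ IsTotallyReal F ∧
        ∀ τ : F →+* ℂ, {φ : L →+* ℂ | φ.comp (algebraMap F L) = τ ∧ φ ∈ Φ.1}.ncard =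
          {φ : L →+* ℂ | φ.comp (algebraMap F L) = τ ∧ φ ∉ Φ.1}.ncard}.ncard +
      2 * {F : IntermediateField ℚ L | Module.finrank ℚ F = 6 ∧ ¬ IsTotallyReal F ∧
        ∀ σ : F ≃ₐ[ℚ] F, σ ^ (3 : ℕ) = AlgEquiv.refl → ∀ τ : F →+* ℂ,
          {φ : L →+* ℂ | φ.comp (algebraMap F L) = τ.comp σ.toRingEquiv.toRingHom ∧ φ ∈ Φ.1}.ncard =
            {φ : L →+* ℂ | φ.comp (algebraMap F L) = τ ∧ φ ∈ Φ.1}.ncard}.ncard +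
      6 * {F : IntermediateField ℚ L | Module.finrank ℚ F = 14 ∧ ¬ IsTotallyReal F ∧
        ∀ σ : F ≃ₐ[ℚ] F, σ ^ (7 : ℕ) = AlgEquiv.refl → ∀ τ : F →+* ℂ,
          {φ : L →+* ℂ | φ.comp (algebraMap F L) = τ.comp σ.toRingEquiv.toRingHom ∧ φ ∈ Φ.1}.ncard =
            {φ : L →+* ℂ | φ.comp (algebraMap F L) = τ ∧ φ ∈ Φ.1}.ncard}.ncard +
      12 * {F : IntermediateField ℚ L | Module.finrank ℚ F = 42 ∧ ¬ IsTotallyReal F ∧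
        ∀ σ σ' : F ≃ₐ[ℚ] F, σ ^ (3 : ℕ) = AlgEquiv.refl → σ' ^ (7 : ℕ) = AlgEquiv.refl → ∀ τ : F →+* ℂ,
          {φ : L →+* ℂ | φ.comp (algebraMap F L) = τ ∧ φ ∈ Φ.1}.ncard +
              {φ : L →+* ℂ | φ.comp (algebraMap F L) = τ.comp (σ * σ').toRingEquiv.toRingHom ∧ φ ∈ Φ.1}.ncard =
            {φ : L →+* ℂ | φ.comp (algebraMap F L) = τ.comp σ.toRingEquiv.toRingHom ∧ φ ∈ Φ.1}.ncard +
              {φ : L →+* ℂ | φ.comp (algebraMap F L) = τ.comp σ'.toRingEquiv.toRingHom ∧ φ ∈ Φ.1}.ncard}.ncard = 22 := by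
  haveI : Fact (Nat.Prime 3) := ⟨Nat.prime_three⟩
  haveI : Fact (Nat.Prime 7) := ⟨by norm_num⟩
  have h := cmTypeRank_add_ncard_subfields_eq_of_isCyclotomicExtension (L := L) (N := 43) (by norm_num)
    (by decide : (3 : ℕ) ≠ 7) (by decide : (3 : ℕ) ≠ 2) (by decide : (7 : ℕ) ≠ 2) units_pow_fortyTwo_fortyThree Φ
  have hN : Nat.totient 43 = 42 := by decide +kernel
  rw [hN] at h
  exact h

/-- **`ℚ(ζ_{43})`: THE HODGE CONJECTURE FOR ALL POWERS of every abelian variety with complex multiplication by `ℚ(ζ_{43})` (CM `21`-folds)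
whose type is of Weil type over none of the imaginary quadratic subfields, level over none of the CM subfields of degree `6` or `14` and additively
separable over none of the CM subfields of degree `42`** — UNCONDITIONAL. [cite: Gordon1999HodgeAVSurvey, Thm. 6.4 and §9.3] [cite: Kubota1965, §4 Lemma 2] -/
theorem hodgeConjectureFor_pow_of_forall_fortyThree [IsCyclotomicExtension {43} ℚ L]
    (hW : ∀ F : IntermediateField ℚ L, Module.finrank ℚ F = 2 → ¬ IsTotallyReal F →
        ¬ ∀ τ : F →+* ℂ, {φ : L →+* ℂ | φ.comp (algebraMap F L) = τ ∧ φ ∈ Φ.1}.ncard =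
          {φ : L →+* ℂ | φ.comp (algebraMap F L) = τ ∧ φ ∉ Φ.1}.ncard)
    (hLp : ∀ F : IntermediateField ℚ L, Module.finrank ℚ F = 2 * 3 → ¬ IsTotallyReal F →
        ¬ ∀ σ : F ≃ₐ[ℚ] F, σ ^ (3 : ℕ) = AlgEquiv.refl → ∀ τ : F →+* ℂ,
          {φ : L →+* ℂ | φ.comp (algebraMap F L) = τ.comp σ.toRingEquiv.toRingHom ∧ φ ∈ Φ.1}.ncard =
            {φ : L →+* ℂ | φ.comp (algebraMap F L) = τ ∧ φ ∈ Φ.1}.ncard)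
    (hLq : ∀ F : IntermediateField ℚ L, Module.finrank ℚ F = 2 * 7 → ¬ IsTotallyReal F →
        ¬ ∀ σ : F ≃ₐ[ℚ] F, σ ^ (7 : ℕ) = AlgEquiv.refl → ∀ τ : F →+* ℂ,
          {φ : L →+* ℂ | φ.comp (algebraMap F L) = τ.comp σ.toRingEquiv.toRingHom ∧ φ ∈ Φ.1}.ncard =
            {φ : L →+* ℂ | φ.comp (algebraMap F L) = τ ∧ φ ∈ Φ.1}.ncard)
    (hS : ∀ F : IntermediateField ℚ L, Module.finrank ℚ F = 2 * (3 * 7) → ¬ IsTotallyReal F →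
        ¬ ∀ σ σ' : F ≃ₐ[ℚ] F, σ ^ (3 : ℕ) = AlgEquiv.refl → σ' ^ (7 : ℕ) = AlgEquiv.refl → ∀ τ : F →+* ℂ,
          {φ : L →+* ℂ | φ.comp (algebraMap F L) = τ ∧ φ ∈ Φ.1}.ncard +
              {φ : L →+* ℂ | φ.comp (algebraMap F L) = τ.comp (σ * σ').toRingEquiv.toRingHom ∧ φ ∈ Φ.1}.ncard =
            {φ : L →+* ℂ | φ.comp (algebraMap F L) = τ.comp σ.toRingEquiv.toRingHom ∧ φ ∈ Φ.1}.ncard +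
              {φ : L →+* ℂ | φ.comp (algebraMap F L) = τ.comp σ'.toRingEquiv.toRingHom ∧ φ ∈ Φ.1}.ncard)
    (hA : IsCMTypeRealisation Φ A ι θ) (n : ℕ) :
    HodgeConjectureFor (⨁ fun _ : Fin n => A).dim (⨁ fun _ : Fin n => A).X :=
  haveI : Fact (Nat.Prime 3) := ⟨Nat.prime_three⟩
  haveI : Fact (Nat.Prime 7) := ⟨by norm_num⟩
  hodgeConjectureFor_pow_of_forall_of_isCyclotomicExtension (N := 43) (by norm_num) (by decide) (by decide) (by decide)
    units_pow_fortyTwo_fortyThree hW hLp hLq hS hA n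

/-- `u⁴² = 1` for every unit of `ℤ/49`: `(ℤ/49)ˣ ≅ ℤ/42 (cyclic)` (`49 = 7²`; kernel decision on residues coprime to `49`).
[cite: Washington1997, Ch. 2 Thm. 2.5] -/
theorem units_pow_fortyTwo_fortyNine (u : (ZMod 49)ˣ) : u ^ (2 * (3 * 7)) = 1 := by
  have h : ∀ a : ZMod 49, Nat.Coprime a.val 49 → a ^ 42 = 1 := by decide +kernel
  exact Units.ext (by rw [Units.val_pow_eq_pow_val, h _ (ZMod.val_coe_unit_coprime u), Units.val_one])

/-- **`ℚ(ζ_{49})` (degree `42`, `Gal ≅ ℤ/42 (cyclic)`, exponent `42`): the rank formula `Rank(Φ) + b(Φ) + 2·e₆(Φ) + 6·e₁₄(Φ) + 12·s₄₂(Φ) = 22`** for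
every CM type — `b` = number of imaginary quadratic subfields over which `Φ` is of Weil type, `e₆` (`e₁₄`) = number of cyclic CM subfields of degree `6`
(`14`) over which `Φ` is level of exponent `3` (`7`), `s₄₂` = number of CM subfields of degree `42` over which `Φ` is additively separable.
[cite: Kubota1965, §4 Lemma 2] [cite: Hazama2003CyclicCM, Prop. 4.3 and Thm. 4.8] [cite: Dodson1984, §3.1.1 Theorem] -/
theorem cmTypeRank_add_ncard_subfields_fortyNine [IsCyclotomicExtension {49} ℚ L] (Φ : CMType L) :
    cmTypeRank Φ + {F : IntermediateField ℚ L | Module.finrank ℚ F = 2 ∧ ¬ IsTotallyReal F ∧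
        ∀ τ : F →+* ℂ, {φ : L →+* ℂ | φ.comp (algebraMap F L) = τ ∧ φ ∈ Φ.1}.ncard =
          {φ : L →+* ℂ | φ.comp (algebraMap F L) = τ ∧ φ ∉ Φ.1}.ncard}.ncard +
      2 * {F : IntermediateField ℚ L | Module.finrank ℚ F = 6 ∧ ¬ IsTotallyReal F ∧
        ∀ σ : F ≃ₐ[ℚ] F, σ ^ (3 : ℕ) = AlgEquiv.refl → ∀ τ : F →+* ℂ,
          {φ : L →+* ℂ | φ.comp (algebraMap F L) = τ.comp σ.toRingEquiv.toRingHom ∧ φ ∈ Φ.1}.ncard =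
            {φ : L →+* ℂ | φ.comp (algebraMap F L) = τ ∧ φ ∈ Φ.1}.ncard}.ncard +
      6 * {F : IntermediateField ℚ L | Module.finrank ℚ F = 14 ∧ ¬ IsTotallyReal F ∧
        ∀ σ : F ≃ₐ[ℚ] F, σ ^ (7 : ℕ) = AlgEquiv.refl → ∀ τ : F →+* ℂ,
          {φ : L →+* ℂ | φ.comp (algebraMap F L) = τ.comp σ.toRingEquiv.toRingHom ∧ φ ∈ Φ.1}.ncard =
            {φ : L →+* ℂ | φ.comp (algebraMap F L) = τ ∧ φ ∈ Φ.1}.ncard}.ncard +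
      12 * {F : IntermediateField ℚ L | Module.finrank ℚ F = 42 ∧ ¬ IsTotallyReal F ∧
        ∀ σ σ' : F ≃ₐ[ℚ] F, σ ^ (3 : ℕ) = AlgEquiv.refl → σ' ^ (7 : ℕ) = AlgEquiv.refl → ∀ τ : F →+* ℂ,
          {φ : L →+* ℂ | φ.comp (algebraMap F L) = τ ∧ φ ∈ Φ.1}.ncard +
              {φ : L →+* ℂ | φ.comp (algebraMap F L) = τ.comp (σ * σ').toRingEquiv.toRingHom ∧ φ ∈ Φ.1}.ncard =
            {φ : L →+* ℂ | φ.comp (algebraMap F L) = τ.comp σ.toRingEquiv.toRingHom ∧ φ ∈ Φ.1}.ncard +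
              {φ : L →+* ℂ | φ.comp (algebraMap F L) = τ.comp σ'.toRingEquiv.toRingHom ∧ φ ∈ Φ.1}.ncard}.ncard = 22 := by
  haveI : Fact (Nat.Prime 3) := ⟨Nat.prime_three⟩
  haveI : Fact (Nat.Prime 7) := ⟨by norm_num⟩
  have h := cmTypeRank_add_ncard_subfields_eq_of_isCyclotomicExtension (L := L) (N := 49) (by norm_num)
    (by decide : (3 : ℕ) ≠ 7) (by decide : (3 : ℕ) ≠ 2) (by decide : (7 : ℕ) ≠ 2) units_pow_fortyTwo_fortyNine Φ
  have hN : Nat.totient 49 = 42 := by decide +kernel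
  rw [hN] at h
  exact h

/-- **`ℚ(ζ_{49})`: THE HODGE CONJECTURE FOR ALL POWERS of every abelian variety with complex multiplication by `ℚ(ζ_{49})` (CM `21`-folds)
whose type is of Weil type over none of the imaginary quadratic subfields, level over none of the CM subfields of degree `6` or `14` and additively
separable over none of the CM subfields of degree `42`** — UNCONDITIONAL. [cite: Gordon1999HodgeAVSurvey, Thm. 6.4 and §9.3] [cite: Kubota1965, §4 Lemma 2] -/
theorem hodgeConjectureFor_pow_of_forall_fortyNine [IsCyclotomicExtension {49} ℚ L]
    (hW : ∀ F : IntermediateField ℚ L, Module.finrank ℚ F = 2 → ¬ IsTotallyReal F →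
        ¬ ∀ τ : F →+* ℂ, {φ : L →+* ℂ | φ.comp (algebraMap F L) = τ ∧ φ ∈ Φ.1}.ncard =
          {φ : L →+* ℂ | φ.comp (algebraMap F L) = τ ∧ φ ∉ Φ.1}.ncard)
    (hLp : ∀ F : IntermediateField ℚ L, Module.finrank ℚ F = 2 * 3 → ¬ IsTotallyReal F →
        ¬ ∀ σ : F ≃ₐ[ℚ] F, σ ^ (3 : ℕ) = AlgEquiv.refl → ∀ τ : F →+* ℂ,
          {φ : L →+* ℂ | φ.comp (algebraMap F L) = τ.comp σ.toRingEquiv.toRingHom ∧ φ ∈ Φ.1}.ncard =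
            {φ : L →+* ℂ | φ.comp (algebraMap F L) = τ ∧ φ ∈ Φ.1}.ncard)
    (hLq : ∀ F : IntermediateField ℚ L, Module.finrank ℚ F = 2 * 7 → ¬ IsTotallyReal F →
        ¬ ∀ σ : F ≃ₐ[ℚ] F, σ ^ (7 : ℕ) = AlgEquiv.refl → ∀ τ : F →+* ℂ,
          {φ : L →+* ℂ | φ.comp (algebraMap F L) = τ.comp σ.toRingEquiv.toRingHom ∧ φ ∈ Φ.1}.ncard =
            {φ : L →+* ℂ | φ.comp (algebraMap F L) = τ ∧ φ ∈ Φ.1}.ncard)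
    (hS : ∀ F : IntermediateField ℚ L, Module.finrank ℚ F = 2 * (3 * 7) → ¬ IsTotallyReal F →
        ¬ ∀ σ σ' : F ≃ₐ[ℚ] F, σ ^ (3 : ℕ) = AlgEquiv.refl → σ' ^ (7 : ℕ) = AlgEquiv.refl → ∀ τ : F →+* ℂ,
          {φ : L →+* ℂ | φ.comp (algebraMap F L) = τ ∧ φ ∈ Φ.1}.ncard +
              {φ : L →+* ℂ | φ.comp (algebraMap F L) = τ.comp (σ * σ').toRingEquiv.toRingHom ∧ φ ∈ Φ.1}.ncard =
            {φ : L →+* ℂ | φ.comp (algebraMap F L) = τ.comp σ.toRingEquiv.toRingHom ∧ φ ∈ Φ.1}.ncard +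
              {φ : L →+* ℂ | φ.comp (algebraMap F L) = τ.comp σ'.toRingEquiv.toRingHom ∧ φ ∈ Φ.1}.ncard)
    (hA : IsCMTypeRealisation Φ A ι θ) (n : ℕ) :
    HodgeConjectureFor (⨁ fun _ : Fin n => A).dim (⨁ fun _ : Fin n => A).X :=
  haveI : Fact (Nat.Prime 3) := ⟨Nat.prime_three⟩
  haveI : Fact (Nat.Prime 7) := ⟨by norm_num⟩
  hodgeConjectureFor_pow_of_forall_of_isCyclotomicExtension (N := 49) (by norm_num) (by decide) (by decide) (by decide)
    units_pow_fortyTwo_fortyNine hW hLp hLq hS hA n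

/-- `u⁴² = 1` for every unit of `ℤ/129`: `(ℤ/129)ˣ ≅ ℤ/2 × ℤ/42` (`129 = 3·43`; kernel decision on residues coprime to `129`).
[cite: Washington1997, Ch. 2 Thm. 2.5] -/
theorem units_pow_fortyTwo_oneHundredTwentyNine (u : (ZMod 129)ˣ) : u ^ (2 * (3 * 7)) = 1 := by
  have h : ∀ a : ZMod 129, Nat.Coprime a.val 129 → a ^ 42 = 1 := by decide +kernel
  exact Units.ext (by rw [Units.val_pow_eq_pow_val, h _ (ZMod.val_coe_unit_coprime u), Units.val_one])

/-- **`ℚ(ζ_{129})` (degree `84`, `Gal ≅ ℤ/2 × ℤ/42`, exponent `42`): the rank formula `Rank(Φ) + b(Φ) + 2·e₆(Φ) + 6·e₁₄(Φ) + 12·s₄₂(Φ) = 43`** for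
every CM type — `b` = number of imaginary quadratic subfields over which `Φ` is of Weil type, `e₆` (`e₁₄`) = number of cyclic CM subfields of degree `6`
(`14`) over which `Φ` is level of exponent `3` (`7`), `s₄₂` = number of CM subfields of degree `42` over which `Φ` is additively separable.
[cite: Kubota1965, §4 Lemma 2] [cite: Hazama2003CyclicCM, Prop. 4.3 and Thm. 4.8] [cite: Dodson1984, §3.1.1 Theorem] -/
theorem cmTypeRank_add_ncard_subfields_oneHundredTwentyNine [IsCyclotomicExtension {129} ℚ L] (Φ : CMType L) :
    cmTypeRank Φ + {F : IntermediateField ℚ L | Module.finrank ℚ F = 2 ∧ ¬ IsTotallyReal F ∧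
        ∀ τ : F →+* ℂ, {φ : L →+* ℂ | φ.comp (algebraMap F L) = τ ∧ φ ∈ Φ.1}.ncard =
          {φ : L →+* ℂ | φ.comp (algebraMap F L) = τ ∧ φ ∉ Φ.1}.ncard}.ncard +
      2 * {F : IntermediateField ℚ L | Module.finrank ℚ F = 6 ∧ ¬ IsTotallyReal F ∧
        ∀ σ : F ≃ₐ[ℚ] F, σ ^ (3 : ℕ) = AlgEquiv.refl → ∀ τ : F →+* ℂ,
          {φ : L →+* ℂ | φ.comp (algebraMap F L) = τ.comp σ.toRingEquiv.toRingHom ∧ φ ∈ Φ.1}.ncard =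
            {φ : L →+* ℂ | φ.comp (algebraMap F L) = τ ∧ φ ∈ Φ.1}.ncard}.ncard +
      6 * {F : IntermediateField ℚ L | Module.finrank ℚ F = 14 ∧ ¬ IsTotallyReal F ∧
        ∀ σ : F ≃ₐ[ℚ] F, σ ^ (7 : ℕ) = AlgEquiv.refl → ∀ τ : F →+* ℂ,
          {φ : L →+* ℂ | φ.comp (algebraMap F L) = τ.comp σ.toRingEquiv.toRingHom ∧ φ ∈ Φ.1}.ncard =
            {φ : L →+* ℂ | φ.comp (algebraMap F L) = τ ∧ φ ∈ Φ.1}.ncard}.ncard +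
      12 * {F : IntermediateField ℚ L | Module.finrank ℚ F = 42 ∧ ¬ IsTotallyReal F ∧
        ∀ σ σ' : F ≃ₐ[ℚ] F, σ ^ (3 : ℕ) = AlgEquiv.refl → σ' ^ (7 : ℕ) = AlgEquiv.refl → ∀ τ : F →+* ℂ,
          {φ : L →+* ℂ | φ.comp (algebraMap F L) = τ ∧ φ ∈ Φ.1}.ncard +
              {φ : L →+* ℂ | φ.comp (algebraMap F L) = τ.comp (σ * σ').toRingEquiv.toRingHom ∧ φ ∈ Φ.1}.ncard =
            {φ : L →+* ℂ | φ.comp (algebraMap F L) = τ.comp σ.toRingEquiv.toRingHom ∧ φ ∈ Φ.1}.ncard +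
              {φ : L →+* ℂ | φ.comp (algebraMap F L) = τ.comp σ'.toRingEquiv.toRingHom ∧ φ ∈ Φ.1}.ncard}.ncard = 43 := by
  haveI : Fact (Nat.Prime 3) := ⟨Nat.prime_three⟩
  haveI : Fact (Nat.Prime 7) := ⟨by norm_num⟩
  have h := cmTypeRank_add_ncard_subfields_eq_of_isCyclotomicExtension (L := L) (N := 129) (by norm_num)
    (by decide : (3 : ℕ) ≠ 7) (by decide : (3 : ℕ) ≠ 2) (by decide : (7 : ℕ) ≠ 2) units_pow_fortyTwo_oneHundredTwentyNine Φ
  have hN : Nat.totient 129 = 84 := by decide +kernel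
  rw [hN] at h
  exact h

/-- **`ℚ(ζ_{129})`: THE HODGE CONJECTURE FOR ALL POWERS of every abelian variety with complex multiplication by `ℚ(ζ_{129})` (CM `42`-folds)
whose type is of Weil type over none of the imaginary quadratic subfields, level over none of the CM subfields of degree `6` or `14` and additively
separable over none of the CM subfields of degree `42`** — UNCONDITIONAL. [cite: Gordon1999HodgeAVSurvey, Thm. 6.4 and §9.3] [cite: Kubota1965, §4 Lemma 2] -/
theorem hodgeConjectureFor_pow_of_forall_oneHundredTwentyNine [IsCyclotomicExtension {129} ℚ L]
    (hW : ∀ F : IntermediateField ℚ L, Module.finrank ℚ F = 2 → ¬ IsTotallyReal F →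
        ¬ ∀ τ : F →+* ℂ, {φ : L →+* ℂ | φ.comp (algebraMap F L) = τ ∧ φ ∈ Φ.1}.ncard =
          {φ : L →+* ℂ | φ.comp (algebraMap F L) = τ ∧ φ ∉ Φ.1}.ncard)
    (hLp : ∀ F : IntermediateField ℚ L, Module.finrank ℚ F = 2 * 3 → ¬ IsTotallyReal F →
        ¬ ∀ σ : F ≃ₐ[ℚ] F, σ ^ (3 : ℕ) = AlgEquiv.refl → ∀ τ : F →+* ℂ,
          {φ : L →+* ℂ | φ.comp (algebraMap F L) = τ.comp σ.toRingEquiv.toRingHom ∧ φ ∈ Φ.1}.ncard =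
            {φ : L →+* ℂ | φ.comp (algebraMap F L) = τ ∧ φ ∈ Φ.1}.ncard)
    (hLq : ∀ F : IntermediateField ℚ L, Module.finrank ℚ F = 2 * 7 → ¬ IsTotallyReal F →
        ¬ ∀ σ : F ≃ₐ[ℚ] F, σ ^ (7 : ℕ) = AlgEquiv.refl → ∀ τ : F →+* ℂ,
          {φ : L →+* ℂ | φ.comp (algebraMap F L) = τ.comp σ.toRingEquiv.toRingHom ∧ φ ∈ Φ.1}.ncard =
            {φ : L →+* ℂ | φ.comp (algebraMap F L) = τ ∧ φ ∈ Φ.1}.ncard)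
    (hS : ∀ F : IntermediateField ℚ L, Module.finrank ℚ F = 2 * (3 * 7) → ¬ IsTotallyReal F →
        ¬ ∀ σ σ' : F ≃ₐ[ℚ] F, σ ^ (3 : ℕ) = AlgEquiv.refl → σ' ^ (7 : ℕ) = AlgEquiv.refl → ∀ τ : F →+* ℂ,
          {φ : L →+* ℂ | φ.comp (algebraMap F L) = τ ∧ φ ∈ Φ.1}.ncard +
              {φ : L →+* ℂ | φ.comp (algebraMap F L) = τ.comp (σ * σ').toRingEquiv.toRingHom ∧ φ ∈ Φ.1}.ncard =
            {φ : L →+* ℂ | φ.comp (algebraMap F L) = τ.comp σ.toRingEquiv.toRingHom ∧ φ ∈ Φ.1}.ncard +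
              {φ : L →+* ℂ | φ.comp (algebraMap F L) = τ.comp σ'.toRingEquiv.toRingHom ∧ φ ∈ Φ.1}.ncard)
    (hA : IsCMTypeRealisation Φ A ι θ) (n : ℕ) :
    HodgeConjectureFor (⨁ fun _ : Fin n => A).dim (⨁ fun _ : Fin n => A).X :=
  haveI : Fact (Nat.Prime 3) := ⟨Nat.prime_three⟩
  haveI : Fact (Nat.Prime 7) := ⟨by norm_num⟩
  hodgeConjectureFor_pow_of_forall_of_isCyclotomicExtension (N := 129) (by norm_num) (by decide) (by decide) (by decide)
    units_pow_fortyTwo_oneHundredTwentyNine hW hLp hLq hS hA n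

/-- `u⁴² = 1` for every unit of `ℤ/147`: `(ℤ/147)ˣ ≅ ℤ/2 × ℤ/42` (`147 = 3·7²`; kernel decision on residues coprime to `147`).
[cite: Washington1997, Ch. 2 Thm. 2.5] -/
theorem units_pow_fortyTwo_oneHundredFortySeven (u : (ZMod 147)ˣ) : u ^ (2 * (3 * 7)) = 1 := by
  have h : ∀ a : ZMod 147, Nat.Coprime a.val 147 → a ^ 42 = 1 := by decide +kernel
  exact Units.ext (by rw [Units.val_pow_eq_pow_val, h _ (ZMod.val_coe_unit_coprime u), Units.val_one])

/-- **`ℚ(ζ_{147})` (degree `84`, `Gal ≅ ℤ/2 × ℤ/42`, exponent `42`): the rank formula `Rank(Φ) + b(Φ) + 2·e₆(Φ) + 6·e₁₄(Φ) + 12·s₄₂(Φ) = 43`** for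
every CM type — `b` = number of imaginary quadratic subfields over which `Φ` is of Weil type, `e₆` (`e₁₄`) = number of cyclic CM subfields of degree `6`
(`14`) over which `Φ` is level of exponent `3` (`7`), `s₄₂` = number of CM subfields of degree `42` over which `Φ` is additively separable.
[cite: Kubota1965, §4 Lemma 2] [cite: Hazama2003CyclicCM, Prop. 4.3 and Thm. 4.8] [cite: Dodson1984, §3.1.1 Theorem] -/
theorem cmTypeRank_add_ncard_subfields_oneHundredFortySeven [IsCyclotomicExtension {147} ℚ L] (Φ : CMType L) :
    cmTypeRank Φ + {F : IntermediateField ℚ L | Module.finrank ℚ F = 2 ∧ ¬ IsTotallyReal F ∧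
        ∀ τ : F →+* ℂ, {φ : L →+* ℂ | φ.comp (algebraMap F L) = τ ∧ φ ∈ Φ.1}.ncard =
          {φ : L →+* ℂ | φ.comp (algebraMap F L) = τ ∧ φ ∉ Φ.1}.ncard}.ncard +
      2 * {F : IntermediateField ℚ L | Module.finrank ℚ F = 6 ∧ ¬ IsTotallyReal F ∧
        ∀ σ : F ≃ₐ[ℚ] F, σ ^ (3 : ℕ) = AlgEquiv.refl → ∀ τ : F →+* ℂ,
          {φ : L →+* ℂ | φ.comp (algebraMap F L) = τ.comp σ.toRingEquiv.toRingHom ∧ φ ∈ Φ.1}.ncard =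
            {φ : L →+* ℂ | φ.comp (algebraMap F L) = τ ∧ φ ∈ Φ.1}.ncard}.ncard +
      6 * {F : IntermediateField ℚ L | Module.finrank ℚ F = 14 ∧ ¬ IsTotallyReal F ∧
        ∀ σ : F ≃ₐ[ℚ] F, σ ^ (7 : ℕ) = AlgEquiv.refl → ∀ τ : F →+* ℂ,
          {φ : L →+* ℂ | φ.comp (algebraMap F L) = τ.comp σ.toRingEquiv.toRingHom ∧ φ ∈ Φ.1}.ncard =
            {φ : L →+* ℂ | φ.comp (algebraMap F L) = τ ∧ φ ∈ Φ.1}.ncard}.ncard +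
      12 * {F : IntermediateField ℚ L | Module.finrank ℚ F = 42 ∧ ¬ IsTotallyReal F ∧
        ∀ σ σ' : F ≃ₐ[ℚ] F, σ ^ (3 : ℕ) = AlgEquiv.refl → σ' ^ (7 : ℕ) = AlgEquiv.refl → ∀ τ : F →+* ℂ,
          {φ : L →+* ℂ | φ.comp (algebraMap F L) = τ ∧ φ ∈ Φ.1}.ncard +
              {φ : L →+* ℂ | φ.comp (algebraMap F L) = τ.comp (σ * σ').toRingEquiv.toRingHom ∧ φ ∈ Φ.1}.ncard =
            {φ : L →+* ℂ | φ.comp (algebraMap F L) = τ.comp σ.toRingEquiv.toRingHom ∧ φ ∈ Φ.1}.ncard +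
              {φ : L →+* ℂ | φ.comp (algebraMap F L) = τ.comp σ'.toRingEquiv.toRingHom ∧ φ ∈ Φ.1}.ncard}.ncard = 43 := by
  haveI : Fact (Nat.Prime 3) := ⟨Nat.prime_three⟩
  haveI : Fact (Nat.Prime 7) := ⟨by norm_num⟩
  have h := cmTypeRank_add_ncard_subfields_eq_of_isCyclotomicExtension (L := L) (N := 147) (by norm_num)
    (by decide : (3 : ℕ) ≠ 7) (by decide : (3 : ℕ) ≠ 2) (by decide : (7 : ℕ) ≠ 2) units_pow_fortyTwo_oneHundredFortySeven Φ
  have hN : Nat.totient 147 = 84 := by decide +kernel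
  rw [hN] at h
  exact h

/-- **`ℚ(ζ_{147})`: THE HODGE CONJECTURE FOR ALL POWERS of every abelian variety with complex multiplication by `ℚ(ζ_{147})` (CM `42`-folds)
whose type is of Weil type over none of the imaginary quadratic subfields, level over none of the CM subfields of degree `6` or `14` and additively
separable over none of the CM subfields of degree `42`** — UNCONDITIONAL. [cite: Gordon1999HodgeAVSurvey, Thm. 6.4 and §9.3] [cite: Kubota1965, §4 Lemma 2] -/
theorem hodgeConjectureFor_pow_of_forall_oneHundredFortySeven [IsCyclotomicExtension {147} ℚ L]
    (hW : ∀ F : IntermediateField ℚ L, Module.finrank ℚ F = 2 → ¬ IsTotallyReal F →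
        ¬ ∀ τ : F →+* ℂ, {φ : L →+* ℂ | φ.comp (algebraMap F L) = τ ∧ φ ∈ Φ.1}.ncard =
          {φ : L →+* ℂ | φ.comp (algebraMap F L) = τ ∧ φ ∉ Φ.1}.ncard)
    (hLp : ∀ F : IntermediateField ℚ L, Module.finrank ℚ F = 2 * 3 → ¬ IsTotallyReal F →
        ¬ ∀ σ : F ≃ₐ[ℚ] F, σ ^ (3 : ℕ) = AlgEquiv.refl → ∀ τ : F →+* ℂ,
          {φ : L →+* ℂ | φ.comp (algebraMap F L) = τ.comp σ.toRingEquiv.toRingHom ∧ φ ∈ Φ.1}.ncard =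
            {φ : L →+* ℂ | φ.comp (algebraMap F L) = τ ∧ φ ∈ Φ.1}.ncard)
    (hLq : ∀ F : IntermediateField ℚ L, Module.finrank ℚ F = 2 * 7 → ¬ IsTotallyReal F →
        ¬ ∀ σ : F ≃ₐ[ℚ] F, σ ^ (7 : ℕ) = AlgEquiv.refl → ∀ τ : F →+* ℂ,
          {φ : L →+* ℂ | φ.comp (algebraMap F L) = τ.comp σ.toRingEquiv.toRingHom ∧ φ ∈ Φ.1}.ncard =
            {φ : L →+* ℂ | φ.comp (algebraMap F L) = τ ∧ φ ∈ Φ.1}.ncard)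
    (hS : ∀ F : IntermediateField ℚ L, Module.finrank ℚ F = 2 * (3 * 7) → ¬ IsTotallyReal F →
        ¬ ∀ σ σ' : F ≃ₐ[ℚ] F, σ ^ (3 : ℕ) = AlgEquiv.refl → σ' ^ (7 : ℕ) = AlgEquiv.refl → ∀ τ : F →+* ℂ,
          {φ : L →+* ℂ | φ.comp (algebraMap F L) = τ ∧ φ ∈ Φ.1}.ncard +
              {φ : L →+* ℂ | φ.comp (algebraMap F L) = τ.comp (σ * σ').toRingEquiv.toRingHom ∧ φ ∈ Φ.1}.ncard =
            {φ : L →+* ℂ | φ.comp (algebraMap F L) = τ.comp σ.toRingEquiv.toRingHom ∧ φ ∈ Φ.1}.ncard +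
              {φ : L →+* ℂ | φ.comp (algebraMap F L) = τ.comp σ'.toRingEquiv.toRingHom ∧ φ ∈ Φ.1}.ncard)
    (hA : IsCMTypeRealisation Φ A ι θ) (n : ℕ) :
    HodgeConjectureFor (⨁ fun _ : Fin n => A).dim (⨁ fun _ : Fin n => A).X :=
  haveI : Fact (Nat.Prime 3) := ⟨Nat.prime_three⟩
  haveI : Fact (Nat.Prime 7) := ⟨by norm_num⟩
  hodgeConjectureFor_pow_of_forall_of_isCyclotomicExtension (N := 147) (by norm_num) (by decide) (by decide) (by decide)
    units_pow_fortyTwo_oneHundredFortySeven hW hLp hLq hS hA n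

/-- `u⁴² = 1` for every unit of `ℤ/172`: `(ℤ/172)ˣ ≅ ℤ/2 × ℤ/42` (`172 = 4·43`; kernel decision on residues coprime to `172`).
[cite: Washington1997, Ch. 2 Thm. 2.5] -/
theorem units_pow_fortyTwo_oneHundredSeventyTwo (u : (ZMod 172)ˣ) : u ^ (2 * (3 * 7)) = 1 := by
  have h : ∀ a : ZMod 172, Nat.Coprime a.val 172 → a ^ 42 = 1 := by decide +kernel
  exact Units.ext (by rw [Units.val_pow_eq_pow_val, h _ (ZMod.val_coe_unit_coprime u), Units.val_one])

/-- **`ℚ(ζ_{172})` (degree `84`, `Gal ≅ ℤ/2 × ℤ/42`, exponent `42`): the rank formula `Rank(Φ) + b(Φ) + 2·e₆(Φ) + 6·e₁₄(Φ) + 12·s₄₂(Φ) = 43`** for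
every CM type — `b` = number of imaginary quadratic subfields over which `Φ` is of Weil type, `e₆` (`e₁₄`) = number of cyclic CM subfields of degree `6`
(`14`) over which `Φ` is level of exponent `3` (`7`), `s₄₂` = number of CM subfields of degree `42` over which `Φ` is additively separable.
[cite: Kubota1965, §4 Lemma 2] [cite: Hazama2003CyclicCM, Prop. 4.3 and Thm. 4.8] [cite: Dodson1984, §3.1.1 Theorem] -/
theorem cmTypeRank_add_ncard_subfields_oneHundredSeventyTwo [IsCyclotomicExtension {172} ℚ L] (Φ : CMType L) :
    cmTypeRank Φ + {F : IntermediateField ℚ L | Module.finrank ℚ F = 2 ∧ ¬ IsTotallyReal F ∧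
        ∀ τ : F →+* ℂ, {φ : L →+* ℂ | φ.comp (algebraMap F L) = τ ∧ φ ∈ Φ.1}.ncard =
          {φ : L →+* ℂ | φ.comp (algebraMap F L) = τ ∧ φ ∉ Φ.1}.ncard}.ncard +
      2 * {F : IntermediateField ℚ L | Module.finrank ℚ F = 6 ∧ ¬ IsTotallyReal F ∧
        ∀ σ : F ≃ₐ[ℚ] F, σ ^ (3 : ℕ) = AlgEquiv.refl → ∀ τ : F →+* ℂ,
          {φ : L →+* ℂ | φ.comp (algebraMap F L) = τ.comp σ.toRingEquiv.toRingHom ∧ φ ∈ Φ.1}.ncard =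
            {φ : L →+* ℂ | φ.comp (algebraMap F L) = τ ∧ φ ∈ Φ.1}.ncard}.ncard +
      6 * {F : IntermediateField ℚ L | Module.finrank ℚ F = 14 ∧ ¬ IsTotallyReal F ∧
        ∀ σ : F ≃ₐ[ℚ] F, σ ^ (7 : ℕ) = AlgEquiv.refl → ∀ τ : F →+* ℂ,
          {φ : L →+* ℂ | φ.comp (algebraMap F L) = τ.comp σ.toRingEquiv.toRingHom ∧ φ ∈ Φ.1}.ncard =
            {φ : L →+* ℂ | φ.comp (algebraMap F L) = τ ∧ φ ∈ Φ.1}.ncard}.ncard +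
      12 * {F : IntermediateField ℚ L | Module.finrank ℚ F = 42 ∧ ¬ IsTotallyReal F ∧
        ∀ σ σ' : F ≃ₐ[ℚ] F, σ ^ (3 : ℕ) = AlgEquiv.refl → σ' ^ (7 : ℕ) = AlgEquiv.refl → ∀ τ : F →+* ℂ,
          {φ : L →+* ℂ | φ.comp (algebraMap F L) = τ ∧ φ ∈ Φ.1}.ncard +
              {φ : L →+* ℂ | φ.comp (algebraMap F L) = τ.comp (σ * σ').toRingEquiv.toRingHom ∧ φ ∈ Φ.1}.ncard =
            {φ : L →+* ℂ | φ.comp (algebraMap F L) = τ.comp σ.toRingEquiv.toRingHom ∧ φ ∈ Φ.1}.ncard +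
              {φ : L →+* ℂ | φ.comp (algebraMap F L) = τ.comp σ'.toRingEquiv.toRingHom ∧ φ ∈ Φ.1}.ncard}.ncard = 43 := by
  haveI : Fact (Nat.Prime 3) := ⟨Nat.prime_three⟩
  haveI : Fact (Nat.Prime 7) := ⟨by norm_num⟩
  have h := cmTypeRank_add_ncard_subfields_eq_of_isCyclotomicExtension (L := L) (N := 172) (by norm_num)
    (by decide : (3 : ℕ) ≠ 7) (by decide : (3 : ℕ) ≠ 2) (by decide : (7 : ℕ) ≠ 2) units_pow_fortyTwo_oneHundredSeventyTwo Φ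
  have hN : Nat.totient 172 = 84 := by decide +kernel
  rw [hN] at h
  exact h

/-- **`ℚ(ζ_{172})`: THE HODGE CONJECTURE FOR ALL POWERS of every abelian variety with complex multiplication by `ℚ(ζ_{172})` (CM `42`-folds)
whose type is of Weil type over none of the imaginary quadratic subfields, level over none of the CM subfields of degree `6` or `14` and additively
separable over none of the CM subfields of degree `42`** — UNCONDITIONAL. [cite: Gordon1999HodgeAVSurvey, Thm. 6.4 and §9.3] [cite: Kubota1965, §4 Lemma 2] -/
theorem hodgeConjectureFor_pow_of_forall_oneHundredSeventyTwo [IsCyclotomicExtension {172} ℚ L]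
    (hW : ∀ F : IntermediateField ℚ L, Module.finrank ℚ F = 2 → ¬ IsTotallyReal F →
        ¬ ∀ τ : F →+* ℂ, {φ : L →+* ℂ | φ.comp (algebraMap F L) = τ ∧ φ ∈ Φ.1}.ncard =
          {φ : L →+* ℂ | φ.comp (algebraMap F L) = τ ∧ φ ∉ Φ.1}.ncard)
    (hLp : ∀ F : IntermediateField ℚ L, Module.finrank ℚ F = 2 * 3 → ¬ IsTotallyReal F →
        ¬ ∀ σ : F ≃ₐ[ℚ] F, σ ^ (3 : ℕ) = AlgEquiv.refl → ∀ τ : F →+* ℂ,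
          {φ : L →+* ℂ | φ.comp (algebraMap F L) = τ.comp σ.toRingEquiv.toRingHom ∧ φ ∈ Φ.1}.ncard =
            {φ : L →+* ℂ | φ.comp (algebraMap F L) = τ ∧ φ ∈ Φ.1}.ncard)
    (hLq : ∀ F : IntermediateField ℚ L, Module.finrank ℚ F = 2 * 7 → ¬ IsTotallyReal F →
        ¬ ∀ σ : F ≃ₐ[ℚ] F, σ ^ (7 : ℕ) = AlgEquiv.refl → ∀ τ : F →+* ℂ,
          {φ : L →+* ℂ | φ.comp (algebraMap F L) = τ.comp σ.toRingEquiv.toRingHom ∧ φ ∈ Φ.1}.ncard =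
            {φ : L →+* ℂ | φ.comp (algebraMap F L) = τ ∧ φ ∈ Φ.1}.ncard)
    (hS : ∀ F : IntermediateField ℚ L, Module.finrank ℚ F = 2 * (3 * 7) → ¬ IsTotallyReal F →
        ¬ ∀ σ σ' : F ≃ₐ[ℚ] F, σ ^ (3 : ℕ) = AlgEquiv.refl → σ' ^ (7 : ℕ) = AlgEquiv.refl → ∀ τ : F →+* ℂ,
          {φ : L →+* ℂ | φ.comp (algebraMap F L) = τ ∧ φ ∈ Φ.1}.ncard +
              {φ : L →+* ℂ | φ.comp (algebraMap F L) = τ.comp (σ * σ').toRingEquiv.toRingHom ∧ φ ∈ Φ.1}.ncard =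
            {φ : L →+* ℂ | φ.comp (algebraMap F L) = τ.comp σ.toRingEquiv.toRingHom ∧ φ ∈ Φ.1}.ncard +
              {φ : L →+* ℂ | φ.comp (algebraMap F L) = τ.comp σ'.toRingEquiv.toRingHom ∧ φ ∈ Φ.1}.ncard)
    (hA : IsCMTypeRealisation Φ A ι θ) (n : ℕ) :
    HodgeConjectureFor (⨁ fun _ : Fin n => A).dim (⨁ fun _ : Fin n => A).X :=
  haveI : Fact (Nat.Prime 3) := ⟨Nat.prime_three⟩
  haveI : Fact (Nat.Prime 7) := ⟨by norm_num⟩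
  hodgeConjectureFor_pow_of_forall_of_isCyclotomicExtension (N := 172) (by norm_num) (by decide) (by decide) (by decide)
    units_pow_fortyTwo_oneHundredSeventyTwo hW hLp hLq hS hA n

/-- `u⁴² = 1` for every unit of `ℤ/196`: `(ℤ/196)ˣ ≅ ℤ/2 × ℤ/42` (`196 = 4·7²`; kernel decision on residues coprime to `196`).
[cite: Washington1997, Ch. 2 Thm. 2.5] -/
theorem units_pow_fortyTwo_oneHundredNinetySix (u : (ZMod 196)ˣ) : u ^ (2 * (3 * 7)) = 1 := by
  have h : ∀ a : ZMod 196, Nat.Coprime a.val 196 → a ^ 42 = 1 := by decide +kernel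
  exact Units.ext (by rw [Units.val_pow_eq_pow_val, h _ (ZMod.val_coe_unit_coprime u), Units.val_one])

/-- **`ℚ(ζ_{196})` (degree `84`, `Gal ≅ ℤ/2 × ℤ/42`, exponent `42`): the rank formula `Rank(Φ) + b(Φ) + 2·e₆(Φ) + 6·e₁₄(Φ) + 12·s₄₂(Φ) = 43`** for
every CM type — `b` = number of imaginary quadratic subfields over which `Φ` is of Weil type, `e₆` (`e₁₄`) = number of cyclic CM subfields of degree `6`
(`14`) over which `Φ` is level of exponent `3` (`7`), `s₄₂` = number of CM subfields of degree `42` over which `Φ` is additively separable.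
[cite: Kubota1965, §4 Lemma 2] [cite: Hazama2003CyclicCM, Prop. 4.3 and Thm. 4.8] [cite: Dodson1984, §3.1.1 Theorem] -/
theorem cmTypeRank_add_ncard_subfields_oneHundredNinetySix [IsCyclotomicExtension {196} ℚ L] (Φ : CMType L) :
    cmTypeRank Φ + {F : IntermediateField ℚ L | Module.finrank ℚ F = 2 ∧ ¬ IsTotallyReal F ∧
        ∀ τ : F →+* ℂ, {φ : L →+* ℂ | φ.comp (algebraMap F L) = τ ∧ φ ∈ Φ.1}.ncard =
          {φ : L →+* ℂ | φ.comp (algebraMap F L) = τ ∧ φ ∉ Φ.1}.ncard}.ncard +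
      2 * {F : IntermediateField ℚ L | Module.finrank ℚ F = 6 ∧ ¬ IsTotallyReal F ∧
        ∀ σ : F ≃ₐ[ℚ] F, σ ^ (3 : ℕ) = AlgEquiv.refl → ∀ τ : F →+* ℂ,
          {φ : L →+* ℂ | φ.comp (algebraMap F L) = τ.comp σ.toRingEquiv.toRingHom ∧ φ ∈ Φ.1}.ncard =
            {φ : L →+* ℂ | φ.comp (algebraMap F L) = τ ∧ φ ∈ Φ.1}.ncard}.ncard +
      6 * {F : IntermediateField ℚ L | Module.finrank ℚ F = 14 ∧ ¬ IsTotallyReal F ∧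
        ∀ σ : F ≃ₐ[ℚ] F, σ ^ (7 : ℕ) = AlgEquiv.refl → ∀ τ : F →+* ℂ,
          {φ : L →+* ℂ | φ.comp (algebraMap F L) = τ.comp σ.toRingEquiv.toRingHom ∧ φ ∈ Φ.1}.ncard =
            {φ : L →+* ℂ | φ.comp (algebraMap F L) = τ ∧ φ ∈ Φ.1}.ncard}.ncard +
      12 * {F : IntermediateField ℚ L | Module.finrank ℚ F = 42 ∧ ¬ IsTotallyReal F ∧
        ∀ σ σ' : F ≃ₐ[ℚ] F, σ ^ (3 : ℕ) = AlgEquiv.refl → σ' ^ (7 : ℕ) = AlgEquiv.refl → ∀ τ : F →+* ℂ,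
          {φ : L →+* ℂ | φ.comp (algebraMap F L) = τ ∧ φ ∈ Φ.1}.ncard +
              {φ : L →+* ℂ | φ.comp (algebraMap F L) = τ.comp (σ * σ').toRingEquiv.toRingHom ∧ φ ∈ Φ.1}.ncard =
            {φ : L →+* ℂ | φ.comp (algebraMap F L) = τ.comp σ.toRingEquiv.toRingHom ∧ φ ∈ Φ.1}.ncard +
              {φ : L →+* ℂ | φ.comp (algebraMap F L) = τ.comp σ'.toRingEquiv.toRingHom ∧ φ ∈ Φ.1}.ncard}.ncard = 43 := by
  haveI : Fact (Nat.Prime 3) := ⟨Nat.prime_three⟩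
  haveI : Fact (Nat.Prime 7) := ⟨by norm_num⟩
  have h := cmTypeRank_add_ncard_subfields_eq_of_isCyclotomicExtension (L := L) (N := 196) (by norm_num)
    (by decide : (3 : ℕ) ≠ 7) (by decide : (3 : ℕ) ≠ 2) (by decide : (7 : ℕ) ≠ 2) units_pow_fortyTwo_oneHundredNinetySix Φ
  have hN : Nat.totient 196 = 84 := by decide +kernel
  rw [hN] at h
  exact h

/-- **`ℚ(ζ_{196})`: THE HODGE CONJECTURE FOR ALL POWERS of every abelian variety with complex multiplication by `ℚ(ζ_{196})` (CM `42`-folds)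
whose type is of Weil type over none of the imaginary quadratic subfields, level over none of the CM subfields of degree `6` or `14` and additively
separable over none of the CM subfields of degree `42`** — UNCONDITIONAL. [cite: Gordon1999HodgeAVSurvey, Thm. 6.4 and §9.3] [cite: Kubota1965, §4 Lemma 2] -/
theorem hodgeConjectureFor_pow_of_forall_oneHundredNinetySix [IsCyclotomicExtension {196} ℚ L]
    (hW : ∀ F : IntermediateField ℚ L, Module.finrank ℚ F = 2 → ¬ IsTotallyReal F →
        ¬ ∀ τ : F →+* ℂ, {φ : L →+* ℂ | φ.comp (algebraMap F L) = τ ∧ φ ∈ Φ.1}.ncard =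
          {φ : L →+* ℂ | φ.comp (algebraMap F L) = τ ∧ φ ∉ Φ.1}.ncard)
    (hLp : ∀ F : IntermediateField ℚ L, Module.finrank ℚ F = 2 * 3 → ¬ IsTotallyReal F →
        ¬ ∀ σ : F ≃ₐ[ℚ] F, σ ^ (3 : ℕ) = AlgEquiv.refl → ∀ τ : F →+* ℂ,
          {φ : L →+* ℂ | φ.comp (algebraMap F L) = τ.comp σ.toRingEquiv.toRingHom ∧ φ ∈ Φ.1}.ncard =
            {φ : L →+* ℂ | φ.comp (algebraMap F L) = τ ∧ φ ∈ Φ.1}.ncard)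
    (hLq : ∀ F : IntermediateField ℚ L, Module.finrank ℚ F = 2 * 7 → ¬ IsTotallyReal F →
        ¬ ∀ σ : F ≃ₐ[ℚ] F, σ ^ (7 : ℕ) = AlgEquiv.refl → ∀ τ : F →+* ℂ,
          {φ : L →+* ℂ | φ.comp (algebraMap F L) = τ.comp σ.toRingEquiv.toRingHom ∧ φ ∈ Φ.1}.ncard =
            {φ : L →+* ℂ | φ.comp (algebraMap F L) = τ ∧ φ ∈ Φ.1}.ncard)
    (hS : ∀ F : IntermediateField ℚ L, Module.finrank ℚ F = 2 * (3 * 7) → ¬ IsTotallyReal F →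
        ¬ ∀ σ σ' : F ≃ₐ[ℚ] F, σ ^ (3 : ℕ) = AlgEquiv.refl → σ' ^ (7 : ℕ) = AlgEquiv.refl → ∀ τ : F →+* ℂ,
          {φ : L →+* ℂ | φ.comp (algebraMap F L) = τ ∧ φ ∈ Φ.1}.ncard +
              {φ : L →+* ℂ | φ.comp (algebraMap F L) = τ.comp (σ * σ').toRingEquiv.toRingHom ∧ φ ∈ Φ.1}.ncard =
            {φ : L →+* ℂ | φ.comp (algebraMap F L) = τ.comp σ.toRingEquiv.toRingHom ∧ φ ∈ Φ.1}.ncard +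
              {φ : L →+* ℂ | φ.comp (algebraMap F L) = τ.comp σ'.toRingEquiv.toRingHom ∧ φ ∈ Φ.1}.ncard)
    (hA : IsCMTypeRealisation Φ A ι θ) (n : ℕ) :
    HodgeConjectureFor (⨁ fun _ : Fin n => A).dim (⨁ fun _ : Fin n => A).X :=
  haveI : Fact (Nat.Prime 3) := ⟨Nat.prime_three⟩
  haveI : Fact (Nat.Prime 7) := ⟨by norm_num⟩
  hodgeConjectureFor_pow_of_forall_of_isCyclotomicExtension (N := 196) (by norm_num) (by decide) (by decide) (by decide)
    units_pow_fortyTwo_oneHundredNinetySix hW hLp hLq hS hA n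

/-! ### APPENDED (gen 65): the remaining levels of exponent `30 = 2·3·5` with `N ≢ 2 (mod 4)` — the «φ(N) = 120» levels `231, 308, 396`
(`(ℤ/N)ˣ ≅ ℤ/2 × ℤ/6 × ℤ/10`) and `248, 372` (`(ℤ/2)² × ℤ/30`), and the «φ(N) = 180» levels `217, 279` (`ℤ/6 × ℤ/30`) -/

/-- `u³⁰ = 1` for every unit of `ℤ/231`: `(ℤ/231)ˣ ≅ ℤ/2 × ℤ/6 × ℤ/10` (`231 = 3·7·11`; kernel decision on residues coprime to `231`).
[cite: Washington1997, Ch. 2 Thm. 2.5] -/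
theorem units_pow_thirty_twoHundredThirtyOne (u : (ZMod 231)ˣ) : u ^ (2 * (3 * 5)) = 1 := by
  have h : ∀ a : ZMod 231, Nat.Coprime a.val 231 → a ^ 30 = 1 := by decide +kernel
  exact Units.ext (by rw [Units.val_pow_eq_pow_val, h _ (ZMod.val_coe_unit_coprime u), Units.val_one])

/-- **`ℚ(ζ_{231})` (degree `120`, `Gal ≅ ℤ/2 × ℤ/6 × ℤ/10`, exponent `30`): the rank formula `Rank(Φ) + b(Φ) + 2·e₆(Φ) + 4·e₁₀(Φ) + 8·s₃₀(Φ) = 61`** for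
every CM type — `b` = number of imaginary quadratic subfields over which `Φ` is of Weil type, `e₆` (`e₁₀`) = number of cyclic sextic (decic) CM
subfields over which `Φ` is level of exponent `3` (`5`), `s₃₀` = number of CM subfields of degree `30` over which `Φ` is additively separable.
[cite: Kubota1965, §4 Lemma 2] [cite: Hazama2003CyclicCM, Prop. 4.3 and Thm. 4.8] [cite: Dodson1984, §3.1.1 Theorem] -/
theorem cmTypeRank_add_ncard_subfields_twoHundredThirtyOne [IsCyclotomicExtension {231} ℚ L] (Φ : CMType L) :
    cmTypeRank Φ + {F : IntermediateField ℚ L | Module.finrank ℚ F = 2 ∧ ¬ IsTotallyReal F ∧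
        ∀ τ : F →+* ℂ, {φ : L →+* ℂ | φ.comp (algebraMap F L) = τ ∧ φ ∈ Φ.1}.ncard =
          {φ : L →+* ℂ | φ.comp (algebraMap F L) = τ ∧ φ ∉ Φ.1}.ncard}.ncard +
      2 * {F : IntermediateField ℚ L | Module.finrank ℚ F = 6 ∧ ¬ IsTotallyReal F ∧
        ∀ σ : F ≃ₐ[ℚ] F, σ ^ (3 : ℕ) = AlgEquiv.refl → ∀ τ : F →+* ℂ,
          {φ : L →+* ℂ | φ.comp (algebraMap F L) = τ.comp σ.toRingEquiv.toRingHom ∧ φ ∈ Φ.1}.ncard =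
            {φ : L →+* ℂ | φ.comp (algebraMap F L) = τ ∧ φ ∈ Φ.1}.ncard}.ncard +
      4 * {F : IntermediateField ℚ L | Module.finrank ℚ F = 10 ∧ ¬ IsTotallyReal F ∧
        ∀ σ : F ≃ₐ[ℚ] F, σ ^ (5 : ℕ) = AlgEquiv.refl → ∀ τ : F →+* ℂ,
          {φ : L →+* ℂ | φ.comp (algebraMap F L) = τ.comp σ.toRingEquiv.toRingHom ∧ φ ∈ Φ.1}.ncard =
            {φ : L →+* ℂ | φ.comp (algebraMap F L) = τ ∧ φ ∈ Φ.1}.ncard}.ncard +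
      8 * {F : IntermediateField ℚ L | Module.finrank ℚ F = 30 ∧ ¬ IsTotallyReal F ∧
        ∀ σ σ' : F ≃ₐ[ℚ] F, σ ^ (3 : ℕ) = AlgEquiv.refl → σ' ^ (5 : ℕ) = AlgEquiv.refl → ∀ τ : F →+* ℂ,
          {φ : L →+* ℂ | φ.comp (algebraMap F L) = τ ∧ φ ∈ Φ.1}.ncard +
              {φ : L →+* ℂ | φ.comp (algebraMap F L) = τ.comp (σ * σ').toRingEquiv.toRingHom ∧ φ ∈ Φ.1}.ncard =
            {φ : L →+* ℂ | φ.comp (algebraMap F L) = τ.comp σ.toRingEquiv.toRingHom ∧ φ ∈ Φ.1}.ncard +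
              {φ : L →+* ℂ | φ.comp (algebraMap F L) = τ.comp σ'.toRingEquiv.toRingHom ∧ φ ∈ Φ.1}.ncard}.ncard = 61 := by
  haveI : Fact (Nat.Prime 3) := ⟨Nat.prime_three⟩
  haveI : Fact (Nat.Prime 5) := ⟨Nat.prime_five⟩
  have h := cmTypeRank_add_ncard_subfields_eq_of_isCyclotomicExtension (L := L) (N := 231) (by norm_num)
    (by decide : (3 : ℕ) ≠ 5) (by decide : (3 : ℕ) ≠ 2) (by decide : (5 : ℕ) ≠ 2) units_pow_thirty_twoHundredThirtyOne Φ
  have hN : Nat.totient 231 = 120 := by decide +kernel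
  rw [hN] at h
  exact h

/-- **`ℚ(ζ_{231})`: THE HODGE CONJECTURE FOR ALL POWERS of every abelian variety with complex multiplication by `ℚ(ζ_{231})` (CM `60`-folds)
whose type is of Weil type over none of the imaginary quadratic subfields, level over none of the sextic and decic CM subfields and additively
separable over none of the CM subfields of degree `30`** — UNCONDITIONAL. [cite: Gordon1999HodgeAVSurvey, Thm. 6.4 and §9.3] [cite: Kubota1965, §4 Lemma 2] -/
theorem hodgeConjectureFor_pow_of_forall_twoHundredThirtyOne [IsCyclotomicExtension {231} ℚ L]
    (hW : ∀ F : IntermediateField ℚ L, Module.finrank ℚ F = 2 → ¬ IsTotallyReal F →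
        ¬ ∀ τ : F →+* ℂ, {φ : L →+* ℂ | φ.comp (algebraMap F L) = τ ∧ φ ∈ Φ.1}.ncard =
          {φ : L →+* ℂ | φ.comp (algebraMap F L) = τ ∧ φ ∉ Φ.1}.ncard)
    (hLp : ∀ F : IntermediateField ℚ L, Module.finrank ℚ F = 2 * 3 → ¬ IsTotallyReal F →
        ¬ ∀ σ : F ≃ₐ[ℚ] F, σ ^ (3 : ℕ) = AlgEquiv.refl → ∀ τ : F →+* ℂ,
          {φ : L →+* ℂ | φ.comp (algebraMap F L) = τ.comp σ.toRingEquiv.toRingHom ∧ φ ∈ Φ.1}.ncard =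
            {φ : L →+* ℂ | φ.comp (algebraMap F L) = τ ∧ φ ∈ Φ.1}.ncard)
    (hLq : ∀ F : IntermediateField ℚ L, Module.finrank ℚ F = 2 * 5 → ¬ IsTotallyReal F →
        ¬ ∀ σ : F ≃ₐ[ℚ] F, σ ^ (5 : ℕ) = AlgEquiv.refl → ∀ τ : F →+* ℂ,
          {φ : L →+* ℂ | φ.comp (algebraMap F L) = τ.comp σ.toRingEquiv.toRingHom ∧ φ ∈ Φ.1}.ncard =
            {φ : L →+* ℂ | φ.comp (algebraMap F L) = τ ∧ φ ∈ Φ.1}.ncard)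
    (hS : ∀ F : IntermediateField ℚ L, Module.finrank ℚ F = 2 * (3 * 5) → ¬ IsTotallyReal F →
        ¬ ∀ σ σ' : F ≃ₐ[ℚ] F, σ ^ (3 : ℕ) = AlgEquiv.refl → σ' ^ (5 : ℕ) = AlgEquiv.refl → ∀ τ : F →+* ℂ,
          {φ : L →+* ℂ | φ.comp (algebraMap F L) = τ ∧ φ ∈ Φ.1}.ncard +
              {φ : L →+* ℂ | φ.comp (algebraMap F L) = τ.comp (σ * σ').toRingEquiv.toRingHom ∧ φ ∈ Φ.1}.ncard =
            {φ : L →+* ℂ | φ.comp (algebraMap F L) = τ.comp σ.toRingEquiv.toRingHom ∧ φ ∈ Φ.1}.ncard +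
              {φ : L →+* ℂ | φ.comp (algebraMap F L) = τ.comp σ'.toRingEquiv.toRingHom ∧ φ ∈ Φ.1}.ncard)
    (hA : IsCMTypeRealisation Φ A ι θ) (n : ℕ) :
    HodgeConjectureFor (⨁ fun _ : Fin n => A).dim (⨁ fun _ : Fin n => A).X :=
  haveI : Fact (Nat.Prime 3) := ⟨Nat.prime_three⟩
  haveI : Fact (Nat.Prime 5) := ⟨Nat.prime_five⟩
  hodgeConjectureFor_pow_of_forall_of_isCyclotomicExtension (N := 231) (by norm_num) (by decide) (by decide) (by decide)
    units_pow_thirty_twoHundredThirtyOne hW hLp hLq hS hA n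

/-- `u³⁰ = 1` for every unit of `ℤ/248`: `(ℤ/248)ˣ ≅ (ℤ/2)² × ℤ/30` (`248 = 8·31`; kernel decision on residues coprime to `248`).
[cite: Washington1997, Ch. 2 Thm. 2.5] -/
theorem units_pow_thirty_twoHundredFortyEight (u : (ZMod 248)ˣ) : u ^ (2 * (3 * 5)) = 1 := by
  have h : ∀ a : ZMod 248, Nat.Coprime a.val 248 → a ^ 30 = 1 := by decide +kernel
  exact Units.ext (by rw [Units.val_pow_eq_pow_val, h _ (ZMod.val_coe_unit_coprime u), Units.val_one])

/-- **`ℚ(ζ_{248})` (degree `120`, `Gal ≅ (ℤ/2)² × ℤ/30`, exponent `30`): the rank formula `Rank(Φ) + b(Φ) + 2·e₆(Φ) + 4·e₁₀(Φ) + 8·s₃₀(Φ) = 61`** for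
every CM type — `b` = number of imaginary quadratic subfields over which `Φ` is of Weil type, `e₆` (`e₁₀`) = number of cyclic sextic (decic) CM
subfields over which `Φ` is level of exponent `3` (`5`), `s₃₀` = number of CM subfields of degree `30` over which `Φ` is additively separable.
[cite: Kubota1965, §4 Lemma 2] [cite: Hazama2003CyclicCM, Prop. 4.3 and Thm. 4.8] [cite: Dodson1984, §3.1.1 Theorem] -/
theorem cmTypeRank_add_ncard_subfields_twoHundredFortyEight [IsCyclotomicExtension {248} ℚ L] (Φ : CMType L) :
    cmTypeRank Φ + {F : IntermediateField ℚ L | Module.finrank ℚ F = 2 ∧ ¬ IsTotallyReal F ∧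
        ∀ τ : F →+* ℂ, {φ : L →+* ℂ | φ.comp (algebraMap F L) = τ ∧ φ ∈ Φ.1}.ncard =
          {φ : L →+* ℂ | φ.comp (algebraMap F L) = τ ∧ φ ∉ Φ.1}.ncard}.ncard +
      2 * {F : IntermediateField ℚ L | Module.finrank ℚ F = 6 ∧ ¬ IsTotallyReal F ∧
        ∀ σ : F ≃ₐ[ℚ] F, σ ^ (3 : ℕ) = AlgEquiv.refl → ∀ τ : F →+* ℂ,
          {φ : L →+* ℂ | φ.comp (algebraMap F L) = τ.comp σ.toRingEquiv.toRingHom ∧ φ ∈ Φ.1}.ncard =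
            {φ : L →+* ℂ | φ.comp (algebraMap F L) = τ ∧ φ ∈ Φ.1}.ncard}.ncard +
      4 * {F : IntermediateField ℚ L | Module.finrank ℚ F = 10 ∧ ¬ IsTotallyReal F ∧
        ∀ σ : F ≃ₐ[ℚ] F, σ ^ (5 : ℕ) = AlgEquiv.refl → ∀ τ : F →+* ℂ,
          {φ : L →+* ℂ | φ.comp (algebraMap F L) = τ.comp σ.toRingEquiv.toRingHom ∧ φ ∈ Φ.1}.ncard =
            {φ : L →+* ℂ | φ.comp (algebraMap F L) = τ ∧ φ ∈ Φ.1}.ncard}.ncard +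
      8 * {F : IntermediateField ℚ L | Module.finrank ℚ F = 30 ∧ ¬ IsTotallyReal F ∧
        ∀ σ σ' : F ≃ₐ[ℚ] F, σ ^ (3 : ℕ) = AlgEquiv.refl → σ' ^ (5 : ℕ) = AlgEquiv.refl → ∀ τ : F →+* ℂ,
          {φ : L →+* ℂ | φ.comp (algebraMap F L) = τ ∧ φ ∈ Φ.1}.ncard +
              {φ : L →+* ℂ | φ.comp (algebraMap F L) = τ.comp (σ * σ').toRingEquiv.toRingHom ∧ φ ∈ Φ.1}.ncard =
            {φ : L →+* ℂ | φ.comp (algebraMap F L) = τ.comp σ.toRingEquiv.toRingHom ∧ φ ∈ Φ.1}.ncard +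
              {φ : L →+* ℂ | φ.comp (algebraMap F L) = τ.comp σ'.toRingEquiv.toRingHom ∧ φ ∈ Φ.1}.ncard}.ncard = 61 := by
  haveI : Fact (Nat.Prime 3) := ⟨Nat.prime_three⟩
  haveI : Fact (Nat.Prime 5) := ⟨Nat.prime_five⟩
  have h := cmTypeRank_add_ncard_subfields_eq_of_isCyclotomicExtension (L := L) (N := 248) (by norm_num)
    (by decide : (3 : ℕ) ≠ 5) (by decide : (3 : ℕ) ≠ 2) (by decide : (5 : ℕ) ≠ 2) units_pow_thirty_twoHundredFortyEight Φ
  have hN : Nat.totient 248 = 120 := by decide +kernel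
  rw [hN] at h
  exact h

/-- **`ℚ(ζ_{248})`: THE HODGE CONJECTURE FOR ALL POWERS of every abelian variety with complex multiplication by `ℚ(ζ_{248})` (CM `60`-folds)
whose type is of Weil type over none of the imaginary quadratic subfields, level over none of the sextic and decic CM subfields and additively
separable over none of the CM subfields of degree `30`** — UNCONDITIONAL. [cite: Gordon1999HodgeAVSurvey, Thm. 6.4 and §9.3] [cite: Kubota1965, §4 Lemma 2] -/
theorem hodgeConjectureFor_pow_of_forall_twoHundredFortyEight [IsCyclotomicExtension {248} ℚ L]
    (hW : ∀ F : IntermediateField ℚ L, Module.finrank ℚ F = 2 → ¬ IsTotallyReal F →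
        ¬ ∀ τ : F →+* ℂ, {φ : L →+* ℂ | φ.comp (algebraMap F L) = τ ∧ φ ∈ Φ.1}.ncard =
          {φ : L →+* ℂ | φ.comp (algebraMap F L) = τ ∧ φ ∉ Φ.1}.ncard)
    (hLp : ∀ F : IntermediateField ℚ L, Module.finrank ℚ F = 2 * 3 → ¬ IsTotallyReal F →
        ¬ ∀ σ : F ≃ₐ[ℚ] F, σ ^ (3 : ℕ) = AlgEquiv.refl → ∀ τ : F →+* ℂ,
          {φ : L →+* ℂ | φ.comp (algebraMap F L) = τ.comp σ.toRingEquiv.toRingHom ∧ φ ∈ Φ.1}.ncard =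
            {φ : L →+* ℂ | φ.comp (algebraMap F L) = τ ∧ φ ∈ Φ.1}.ncard)
    (hLq : ∀ F : IntermediateField ℚ L, Module.finrank ℚ F = 2 * 5 → ¬ IsTotallyReal F →
        ¬ ∀ σ : F ≃ₐ[ℚ] F, σ ^ (5 : ℕ) = AlgEquiv.refl → ∀ τ : F →+* ℂ,
          {φ : L →+* ℂ | φ.comp (algebraMap F L) = τ.comp σ.toRingEquiv.toRingHom ∧ φ ∈ Φ.1}.ncard =
            {φ : L →+* ℂ | φ.comp (algebraMap F L) = τ ∧ φ ∈ Φ.1}.ncard)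
    (hS : ∀ F : IntermediateField ℚ L, Module.finrank ℚ F = 2 * (3 * 5) → ¬ IsTotallyReal F →
        ¬ ∀ σ σ' : F ≃ₐ[ℚ] F, σ ^ (3 : ℕ) = AlgEquiv.refl → σ' ^ (5 : ℕ) = AlgEquiv.refl → ∀ τ : F →+* ℂ,
          {φ : L →+* ℂ | φ.comp (algebraMap F L) = τ ∧ φ ∈ Φ.1}.ncard +
              {φ : L →+* ℂ | φ.comp (algebraMap F L) = τ.comp (σ * σ').toRingEquiv.toRingHom ∧ φ ∈ Φ.1}.ncard =
            {φ : L →+* ℂ | φ.comp (algebraMap F L) = τ.comp σ.toRingEquiv.toRingHom ∧ φ ∈ Φ.1}.ncard +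
              {φ : L →+* ℂ | φ.comp (algebraMap F L) = τ.comp σ'.toRingEquiv.toRingHom ∧ φ ∈ Φ.1}.ncard)
    (hA : IsCMTypeRealisation Φ A ι θ) (n : ℕ) :
    HodgeConjectureFor (⨁ fun _ : Fin n => A).dim (⨁ fun _ : Fin n => A).X :=
  haveI : Fact (Nat.Prime 3) := ⟨Nat.prime_three⟩
  haveI : Fact (Nat.Prime 5) := ⟨Nat.prime_five⟩
  hodgeConjectureFor_pow_of_forall_of_isCyclotomicExtension (N := 248) (by norm_num) (by decide) (by decide) (by decide)
    units_pow_thirty_twoHundredFortyEight hW hLp hLq hS hA n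

/-- `u³⁰ = 1` for every unit of `ℤ/308`: `(ℤ/308)ˣ ≅ ℤ/2 × ℤ/6 × ℤ/10` (`308 = 4·7·11`; kernel decision on residues coprime to `308`).
[cite: Washington1997, Ch. 2 Thm. 2.5] -/
theorem units_pow_thirty_threeHundredEight (u : (ZMod 308)ˣ) : u ^ (2 * (3 * 5)) = 1 := by
  have h : ∀ a : ZMod 308, Nat.Coprime a.val 308 → a ^ 30 = 1 := by decide +kernel
  exact Units.ext (by rw [Units.val_pow_eq_pow_val, h _ (ZMod.val_coe_unit_coprime u), Units.val_one])

/-- **`ℚ(ζ_{308})` (degree `120`, `Gal ≅ ℤ/2 × ℤ/6 × ℤ/10`, exponent `30`): the rank formula `Rank(Φ) + b(Φ) + 2·e₆(Φ) + 4·e₁₀(Φ) + 8·s₃₀(Φ) = 61`** for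
every CM type — `b` = number of imaginary quadratic subfields over which `Φ` is of Weil type, `e₆` (`e₁₀`) = number of cyclic sextic (decic) CM
subfields over which `Φ` is level of exponent `3` (`5`), `s₃₀` = number of CM subfields of degree `30` over which `Φ` is additively separable.
[cite: Kubota1965, §4 Lemma 2] [cite: Hazama2003CyclicCM, Prop. 4.3 and Thm. 4.8] [cite: Dodson1984, §3.1.1 Theorem] -/
theorem cmTypeRank_add_ncard_subfields_threeHundredEight [IsCyclotomicExtension {308} ℚ L] (Φ : CMType L) :
    cmTypeRank Φ + {F : IntermediateField ℚ L | Module.finrank ℚ F = 2 ∧ ¬ IsTotallyReal F ∧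
        ∀ τ : F →+* ℂ, {φ : L →+* ℂ | φ.comp (algebraMap F L) = τ ∧ φ ∈ Φ.1}.ncard =
          {φ : L →+* ℂ | φ.comp (algebraMap F L) = τ ∧ φ ∉ Φ.1}.ncard}.ncard +
      2 * {F : IntermediateField ℚ L | Module.finrank ℚ F = 6 ∧ ¬ IsTotallyReal F ∧
        ∀ σ : F ≃ₐ[ℚ] F, σ ^ (3 : ℕ) = AlgEquiv.refl → ∀ τ : F →+* ℂ,
          {φ : L →+* ℂ | φ.comp (algebraMap F L) = τ.comp σ.toRingEquiv.toRingHom ∧ φ ∈ Φ.1}.ncard =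
            {φ : L →+* ℂ | φ.comp (algebraMap F L) = τ ∧ φ ∈ Φ.1}.ncard}.ncard +
      4 * {F : IntermediateField ℚ L | Module.finrank ℚ F = 10 ∧ ¬ IsTotallyReal F ∧
        ∀ σ : F ≃ₐ[ℚ] F, σ ^ (5 : ℕ) = AlgEquiv.refl → ∀ τ : F →+* ℂ,
          {φ : L →+* ℂ | φ.comp (algebraMap F L) = τ.comp σ.toRingEquiv.toRingHom ∧ φ ∈ Φ.1}.ncard =
            {φ : L →+* ℂ | φ.comp (algebraMap F L) = τ ∧ φ ∈ Φ.1}.ncard}.ncard +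
      8 * {F : IntermediateField ℚ L | Module.finrank ℚ F = 30 ∧ ¬ IsTotallyReal F ∧
        ∀ σ σ' : F ≃ₐ[ℚ] F, σ ^ (3 : ℕ) = AlgEquiv.refl → σ' ^ (5 : ℕ) = AlgEquiv.refl → ∀ τ : F →+* ℂ,
          {φ : L →+* ℂ | φ.comp (algebraMap F L) = τ ∧ φ ∈ Φ.1}.ncard +
              {φ : L →+* ℂ | φ.comp (algebraMap F L) = τ.comp (σ * σ').toRingEquiv.toRingHom ∧ φ ∈ Φ.1}.ncard =
            {φ : L →+* ℂ | φ.comp (algebraMap F L) = τ.comp σ.toRingEquiv.toRingHom ∧ φ ∈ Φ.1}.ncard +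
              {φ : L →+* ℂ | φ.comp (algebraMap F L) = τ.comp σ'.toRingEquiv.toRingHom ∧ φ ∈ Φ.1}.ncard}.ncard = 61 := by
  haveI : Fact (Nat.Prime 3) := ⟨Nat.prime_three⟩
  haveI : Fact (Nat.Prime 5) := ⟨Nat.prime_five⟩
  have h := cmTypeRank_add_ncard_subfields_eq_of_isCyclotomicExtension (L := L) (N := 308) (by norm_num)
    (by decide : (3 : ℕ) ≠ 5) (by decide : (3 : ℕ) ≠ 2) (by decide : (5 : ℕ) ≠ 2) units_pow_thirty_threeHundredEight Φ
  have hN : Nat.totient 308 = 120 := by decide +kernel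
  rw [hN] at h
  exact h

/-- **`ℚ(ζ_{308})`: THE HODGE CONJECTURE FOR ALL POWERS of every abelian variety with complex multiplication by `ℚ(ζ_{308})` (CM `60`-folds)
whose type is of Weil type over none of the imaginary quadratic subfields, level over none of the sextic and decic CM subfields and additively
separable over none of the CM subfields of degree `30`** — UNCONDITIONAL. [cite: Gordon1999HodgeAVSurvey, Thm. 6.4 and §9.3] [cite: Kubota1965, §4 Lemma 2] -/
theorem hodgeConjectureFor_pow_of_forall_threeHundredEight [IsCyclotomicExtension {308} ℚ L]
    (hW : ∀ F : IntermediateField ℚ L, Module.finrank ℚ F = 2 → ¬ IsTotallyReal F →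
        ¬ ∀ τ : F →+* ℂ, {φ : L →+* ℂ | φ.comp (algebraMap F L) = τ ∧ φ ∈ Φ.1}.ncard =
          {φ : L →+* ℂ | φ.comp (algebraMap F L) = τ ∧ φ ∉ Φ.1}.ncard)
    (hLp : ∀ F : IntermediateField ℚ L, Module.finrank ℚ F = 2 * 3 → ¬ IsTotallyReal F →
        ¬ ∀ σ : F ≃ₐ[ℚ] F, σ ^ (3 : ℕ) = AlgEquiv.refl → ∀ τ : F →+* ℂ,
          {φ : L →+* ℂ | φ.comp (algebraMap F L) = τ.comp σ.toRingEquiv.toRingHom ∧ φ ∈ Φ.1}.ncard =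
            {φ : L →+* ℂ | φ.comp (algebraMap F L) = τ ∧ φ ∈ Φ.1}.ncard)
    (hLq : ∀ F : IntermediateField ℚ L, Module.finrank ℚ F = 2 * 5 → ¬ IsTotallyReal F →
        ¬ ∀ σ : F ≃ₐ[ℚ] F, σ ^ (5 : ℕ) = AlgEquiv.refl → ∀ τ : F →+* ℂ,
          {φ : L →+* ℂ | φ.comp (algebraMap F L) = τ.comp σ.toRingEquiv.toRingHom ∧ φ ∈ Φ.1}.ncard =
            {φ : L →+* ℂ | φ.comp (algebraMap F L) = τ ∧ φ ∈ Φ.1}.ncard)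
    (hS : ∀ F : IntermediateField ℚ L, Module.finrank ℚ F = 2 * (3 * 5) → ¬ IsTotallyReal F →
        ¬ ∀ σ σ' : F ≃ₐ[ℚ] F, σ ^ (3 : ℕ) = AlgEquiv.refl → σ' ^ (5 : ℕ) = AlgEquiv.refl → ∀ τ : F →+* ℂ,
          {φ : L →+* ℂ | φ.comp (algebraMap F L) = τ ∧ φ ∈ Φ.1}.ncard +
              {φ : L →+* ℂ | φ.comp (algebraMap F L) = τ.comp (σ * σ').toRingEquiv.toRingHom ∧ φ ∈ Φ.1}.ncard =
            {φ : L →+* ℂ | φ.comp (algebraMap F L) = τ.comp σ.toRingEquiv.toRingHom ∧ φ ∈ Φ.1}.ncard +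
              {φ : L →+* ℂ | φ.comp (algebraMap F L) = τ.comp σ'.toRingEquiv.toRingHom ∧ φ ∈ Φ.1}.ncard)
    (hA : IsCMTypeRealisation Φ A ι θ) (n : ℕ) :
    HodgeConjectureFor (⨁ fun _ : Fin n => A).dim (⨁ fun _ : Fin n => A).X :=
  haveI : Fact (Nat.Prime 3) := ⟨Nat.prime_three⟩
  haveI : Fact (Nat.Prime 5) := ⟨Nat.prime_five⟩
  hodgeConjectureFor_pow_of_forall_of_isCyclotomicExtension (N := 308) (by norm_num) (by decide) (by decide) (by decide)
    units_pow_thirty_threeHundredEight hW hLp hLq hS hA n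

/-- `u³⁰ = 1` for every unit of `ℤ/372`: `(ℤ/372)ˣ ≅ (ℤ/2)² × ℤ/30` (`372 = 4·3·31`; kernel decision on residues coprime to `372`).
[cite: Washington1997, Ch. 2 Thm. 2.5] -/
theorem units_pow_thirty_threeHundredSeventyTwo (u : (ZMod 372)ˣ) : u ^ (2 * (3 * 5)) = 1 := by
  have h : ∀ a : ZMod 372, Nat.Coprime a.val 372 → a ^ 30 = 1 := by decide +kernel
  exact Units.ext (by rw [Units.val_pow_eq_pow_val, h _ (ZMod.val_coe_unit_coprime u), Units.val_one])

/-- **`ℚ(ζ_{372})` (degree `120`, `Gal ≅ (ℤ/2)² × ℤ/30`, exponent `30`): the rank formula `Rank(Φ) + b(Φ) + 2·e₆(Φ) + 4·e₁₀(Φ) + 8·s₃₀(Φ) = 61`** for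
every CM type — `b` = number of imaginary quadratic subfields over which `Φ` is of Weil type, `e₆` (`e₁₀`) = number of cyclic sextic (decic) CM
subfields over which `Φ` is level of exponent `3` (`5`), `s₃₀` = number of CM subfields of degree `30` over which `Φ` is additively separable.
[cite: Kubota1965, §4 Lemma 2] [cite: Hazama2003CyclicCM, Prop. 4.3 and Thm. 4.8] [cite: Dodson1984, §3.1.1 Theorem] -/
theorem cmTypeRank_add_ncard_subfields_threeHundredSeventyTwo [IsCyclotomicExtension {372} ℚ L] (Φ : CMType L) :
    cmTypeRank Φ + {F : IntermediateField ℚ L | Module.finrank ℚ F = 2 ∧ ¬ IsTotallyReal F ∧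
        ∀ τ : F →+* ℂ, {φ : L →+* ℂ | φ.comp (algebraMap F L) = τ ∧ φ ∈ Φ.1}.ncard =
          {φ : L →+* ℂ | φ.comp (algebraMap F L) = τ ∧ φ ∉ Φ.1}.ncard}.ncard +
      2 * {F : IntermediateField ℚ L | Module.finrank ℚ F = 6 ∧ ¬ IsTotallyReal F ∧
        ∀ σ : F ≃ₐ[ℚ] F, σ ^ (3 : ℕ) = AlgEquiv.refl → ∀ τ : F →+* ℂ,
          {φ : L →+* ℂ | φ.comp (algebraMap F L) = τ.comp σ.toRingEquiv.toRingHom ∧ φ ∈ Φ.1}.ncard =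
            {φ : L →+* ℂ | φ.comp (algebraMap F L) = τ ∧ φ ∈ Φ.1}.ncard}.ncard +
      4 * {F : IntermediateField ℚ L | Module.finrank ℚ F = 10 ∧ ¬ IsTotallyReal F ∧
        ∀ σ : F ≃ₐ[ℚ] F, σ ^ (5 : ℕ) = AlgEquiv.refl → ∀ τ : F →+* ℂ,
          {φ : L →+* ℂ | φ.comp (algebraMap F L) = τ.comp σ.toRingEquiv.toRingHom ∧ φ ∈ Φ.1}.ncard =
            {φ : L →+* ℂ | φ.comp (algebraMap F L) = τ ∧ φ ∈ Φ.1}.ncard}.ncard +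
      8 * {F : IntermediateField ℚ L | Module.finrank ℚ F = 30 ∧ ¬ IsTotallyReal F ∧
        ∀ σ σ' : F ≃ₐ[ℚ] F, σ ^ (3 : ℕ) = AlgEquiv.refl → σ' ^ (5 : ℕ) = AlgEquiv.refl → ∀ τ : F →+* ℂ,
          {φ : L →+* ℂ | φ.comp (algebraMap F L) = τ ∧ φ ∈ Φ.1}.ncard +
              {φ : L →+* ℂ | φ.comp (algebraMap F L) = τ.comp (σ * σ').toRingEquiv.toRingHom ∧ φ ∈ Φ.1}.ncard =
            {φ : L →+* ℂ | φ.comp (algebraMap F L) = τ.comp σ.toRingEquiv.toRingHom ∧ φ ∈ Φ.1}.ncard +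
              {φ : L →+* ℂ | φ.comp (algebraMap F L) = τ.comp σ'.toRingEquiv.toRingHom ∧ φ ∈ Φ.1}.ncard}.ncard = 61 := by
  haveI : Fact (Nat.Prime 3) := ⟨Nat.prime_three⟩
  haveI : Fact (Nat.Prime 5) := ⟨Nat.prime_five⟩
  have h := cmTypeRank_add_ncard_subfields_eq_of_isCyclotomicExtension (L := L) (N := 372) (by norm_num)
    (by decide : (3 : ℕ) ≠ 5) (by decide : (3 : ℕ) ≠ 2) (by decide : (5 : ℕ) ≠ 2) units_pow_thirty_threeHundredSeventyTwo Φ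
  have hN : Nat.totient 372 = 120 := by decide +kernel
  rw [hN] at h
  exact h

/-- **`ℚ(ζ_{372})`: THE HODGE CONJECTURE FOR ALL POWERS of every abelian variety with complex multiplication by `ℚ(ζ_{372})` (CM `60`-folds)
whose type is of Weil type over none of the imaginary quadratic subfields, level over none of the sextic and decic CM subfields and additively
separable over none of the CM subfields of degree `30`** — UNCONDITIONAL. [cite: Gordon1999HodgeAVSurvey, Thm. 6.4 and §9.3] [cite: Kubota1965, §4 Lemma 2] -/
theorem hodgeConjectureFor_pow_of_forall_threeHundredSeventyTwo [IsCyclotomicExtension {372} ℚ L]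
    (hW : ∀ F : IntermediateField ℚ L, Module.finrank ℚ F = 2 → ¬ IsTotallyReal F →
        ¬ ∀ τ : F →+* ℂ, {φ : L →+* ℂ | φ.comp (algebraMap F L) = τ ∧ φ ∈ Φ.1}.ncard =
          {φ : L →+* ℂ | φ.comp (algebraMap F L) = τ ∧ φ ∉ Φ.1}.ncard)
    (hLp : ∀ F : IntermediateField ℚ L, Module.finrank ℚ F = 2 * 3 → ¬ IsTotallyReal F →
        ¬ ∀ σ : F ≃ₐ[ℚ] F, σ ^ (3 : ℕ) = AlgEquiv.refl → ∀ τ : F →+* ℂ,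
          {φ : L →+* ℂ | φ.comp (algebraMap F L) = τ.comp σ.toRingEquiv.toRingHom ∧ φ ∈ Φ.1}.ncard =
            {φ : L →+* ℂ | φ.comp (algebraMap F L) = τ ∧ φ ∈ Φ.1}.ncard)
    (hLq : ∀ F : IntermediateField ℚ L, Module.finrank ℚ F = 2 * 5 → ¬ IsTotallyReal F →
        ¬ ∀ σ : F ≃ₐ[ℚ] F, σ ^ (5 : ℕ) = AlgEquiv.refl → ∀ τ : F →+* ℂ,
          {φ : L →+* ℂ | φ.comp (algebraMap F L) = τ.comp σ.toRingEquiv.toRingHom ∧ φ ∈ Φ.1}.ncard =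
            {φ : L →+* ℂ | φ.comp (algebraMap F L) = τ ∧ φ ∈ Φ.1}.ncard)
    (hS : ∀ F : IntermediateField ℚ L, Module.finrank ℚ F = 2 * (3 * 5) → ¬ IsTotallyReal F →
        ¬ ∀ σ σ' : F ≃ₐ[ℚ] F, σ ^ (3 : ℕ) = AlgEquiv.refl → σ' ^ (5 : ℕ) = AlgEquiv.refl → ∀ τ : F →+* ℂ,
          {φ : L →+* ℂ | φ.comp (algebraMap F L) = τ ∧ φ ∈ Φ.1}.ncard +
              {φ : L →+* ℂ | φ.comp (algebraMap F L) = τ.comp (σ * σ').toRingEquiv.toRingHom ∧ φ ∈ Φ.1}.ncard =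
            {φ : L →+* ℂ | φ.comp (algebraMap F L) = τ.comp σ.toRingEquiv.toRingHom ∧ φ ∈ Φ.1}.ncard +
              {φ : L →+* ℂ | φ.comp (algebraMap F L) = τ.comp σ'.toRingEquiv.toRingHom ∧ φ ∈ Φ.1}.ncard)
    (hA : IsCMTypeRealisation Φ A ι θ) (n : ℕ) :
    HodgeConjectureFor (⨁ fun _ : Fin n => A).dim (⨁ fun _ : Fin n => A).X :=
  haveI : Fact (Nat.Prime 3) := ⟨Nat.prime_three⟩
  haveI : Fact (Nat.Prime 5) := ⟨Nat.prime_five⟩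
  hodgeConjectureFor_pow_of_forall_of_isCyclotomicExtension (N := 372) (by norm_num) (by decide) (by decide) (by decide)
    units_pow_thirty_threeHundredSeventyTwo hW hLp hLq hS hA n

/-- `u³⁰ = 1` for every unit of `ℤ/396`: `(ℤ/396)ˣ ≅ ℤ/2 × ℤ/6 × ℤ/10` (`396 = 4·9·11`; kernel decision on residues coprime to `396`).
[cite: Washington1997, Ch. 2 Thm. 2.5] -/
theorem units_pow_thirty_threeHundredNinetySix (u : (ZMod 396)ˣ) : u ^ (2 * (3 * 5)) = 1 := by
  have h : ∀ a : ZMod 396, Nat.Coprime a.val 396 → a ^ 30 = 1 := by decide +kernel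
  exact Units.ext (by rw [Units.val_pow_eq_pow_val, h _ (ZMod.val_coe_unit_coprime u), Units.val_one])

/-- **`ℚ(ζ_{396})` (degree `120`, `Gal ≅ ℤ/2 × ℤ/6 × ℤ/10`, exponent `30`): the rank formula `Rank(Φ) + b(Φ) + 2·e₆(Φ) + 4·e₁₀(Φ) + 8·s₃₀(Φ) = 61`** for
every CM type — `b` = number of imaginary quadratic subfields over which `Φ` is of Weil type, `e₆` (`e₁₀`) = number of cyclic sextic (decic) CM
subfields over which `Φ` is level of exponent `3` (`5`), `s₃₀` = number of CM subfields of degree `30` over which `Φ` is additively separable.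
[cite: Kubota1965, §4 Lemma 2] [cite: Hazama2003CyclicCM, Prop. 4.3 and Thm. 4.8] [cite: Dodson1984, §3.1.1 Theorem] -/
theorem cmTypeRank_add_ncard_subfields_threeHundredNinetySix [IsCyclotomicExtension {396} ℚ L] (Φ : CMType L) :
    cmTypeRank Φ + {F : IntermediateField ℚ L | Module.finrank ℚ F = 2 ∧ ¬ IsTotallyReal F ∧
        ∀ τ : F →+* ℂ, {φ : L →+* ℂ | φ.comp (algebraMap F L) = τ ∧ φ ∈ Φ.1}.ncard =
          {φ : L →+* ℂ | φ.comp (algebraMap F L) = τ ∧ φ ∉ Φ.1}.ncard}.ncard +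
      2 * {F : IntermediateField ℚ L | Module.finrank ℚ F = 6 ∧ ¬ IsTotallyReal F ∧
        ∀ σ : F ≃ₐ[ℚ] F, σ ^ (3 : ℕ) = AlgEquiv.refl → ∀ τ : F →+* ℂ,
          {φ : L →+* ℂ | φ.comp (algebraMap F L) = τ.comp σ.toRingEquiv.toRingHom ∧ φ ∈ Φ.1}.ncard =
            {φ : L →+* ℂ | φ.comp (algebraMap F L) = τ ∧ φ ∈ Φ.1}.ncard}.ncard +
      4 * {F : IntermediateField ℚ L | Module.finrank ℚ F = 10 ∧ ¬ IsTotallyReal F ∧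
        ∀ σ : F ≃ₐ[ℚ] F, σ ^ (5 : ℕ) = AlgEquiv.refl → ∀ τ : F →+* ℂ,
          {φ : L →+* ℂ | φ.comp (algebraMap F L) = τ.comp σ.toRingEquiv.toRingHom ∧ φ ∈ Φ.1}.ncard =
            {φ : L →+* ℂ | φ.comp (algebraMap F L) = τ ∧ φ ∈ Φ.1}.ncard}.ncard +
      8 * {F : IntermediateField ℚ L | Module.finrank ℚ F = 30 ∧ ¬ IsTotallyReal F ∧
        ∀ σ σ' : F ≃ₐ[ℚ] F, σ ^ (3 : ℕ) = AlgEquiv.refl → σ' ^ (5 : ℕ) = AlgEquiv.refl → ∀ τ : F →+* ℂ,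
          {φ : L →+* ℂ | φ.comp (algebraMap F L) = τ ∧ φ ∈ Φ.1}.ncard +
              {φ : L →+* ℂ | φ.comp (algebraMap F L) = τ.comp (σ * σ').toRingEquiv.toRingHom ∧ φ ∈ Φ.1}.ncard =
            {φ : L →+* ℂ | φ.comp (algebraMap F L) = τ.comp σ.toRingEquiv.toRingHom ∧ φ ∈ Φ.1}.ncard +
              {φ : L →+* ℂ | φ.comp (algebraMap F L) = τ.comp σ'.toRingEquiv.toRingHom ∧ φ ∈ Φ.1}.ncard}.ncard = 61 := by
  haveI : Fact (Nat.Prime 3) := ⟨Nat.prime_three⟩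
  haveI : Fact (Nat.Prime 5) := ⟨Nat.prime_five⟩
  have h := cmTypeRank_add_ncard_subfields_eq_of_isCyclotomicExtension (L := L) (N := 396) (by norm_num)
    (by decide : (3 : ℕ) ≠ 5) (by decide : (3 : ℕ) ≠ 2) (by decide : (5 : ℕ) ≠ 2) units_pow_thirty_threeHundredNinetySix Φ
  have hN : Nat.totient 396 = 120 := by decide +kernel
  rw [hN] at h
  exact h

/-- **`ℚ(ζ_{396})`: THE HODGE CONJECTURE FOR ALL POWERS of every abelian variety with complex multiplication by `ℚ(ζ_{396})` (CM `60`-folds)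
whose type is of Weil type over none of the imaginary quadratic subfields, level over none of the sextic and decic CM subfields and additively
separable over none of the CM subfields of degree `30`** — UNCONDITIONAL. [cite: Gordon1999HodgeAVSurvey, Thm. 6.4 and §9.3] [cite: Kubota1965, §4 Lemma 2] -/
theorem hodgeConjectureFor_pow_of_forall_threeHundredNinetySix [IsCyclotomicExtension {396} ℚ L]
    (hW : ∀ F : IntermediateField ℚ L, Module.finrank ℚ F = 2 → ¬ IsTotallyReal F →
        ¬ ∀ τ : F →+* ℂ, {φ : L →+* ℂ | φ.comp (algebraMap F L) = τ ∧ φ ∈ Φ.1}.ncard =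
          {φ : L →+* ℂ | φ.comp (algebraMap F L) = τ ∧ φ ∉ Φ.1}.ncard)
    (hLp : ∀ F : IntermediateField ℚ L, Module.finrank ℚ F = 2 * 3 → ¬ IsTotallyReal F →
        ¬ ∀ σ : F ≃ₐ[ℚ] F, σ ^ (3 : ℕ) = AlgEquiv.refl → ∀ τ : F →+* ℂ,
          {φ : L →+* ℂ | φ.comp (algebraMap F L) = τ.comp σ.toRingEquiv.toRingHom ∧ φ ∈ Φ.1}.ncard =
            {φ : L →+* ℂ | φ.comp (algebraMap F L) = τ ∧ φ ∈ Φ.1}.ncard)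
    (hLq : ∀ F : IntermediateField ℚ L, Module.finrank ℚ F = 2 * 5 → ¬ IsTotallyReal F →
        ¬ ∀ σ : F ≃ₐ[ℚ] F, σ ^ (5 : ℕ) = AlgEquiv.refl → ∀ τ : F →+* ℂ,
          {φ : L →+* ℂ | φ.comp (algebraMap F L) = τ.comp σ.toRingEquiv.toRingHom ∧ φ ∈ Φ.1}.ncard =
            {φ : L →+* ℂ | φ.comp (algebraMap F L) = τ ∧ φ ∈ Φ.1}.ncard)
    (hS : ∀ F : IntermediateField ℚ L, Module.finrank ℚ F = 2 * (3 * 5) → ¬ IsTotallyReal F →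
        ¬ ∀ σ σ' : F ≃ₐ[ℚ] F, σ ^ (3 : ℕ) = AlgEquiv.refl → σ' ^ (5 : ℕ) = AlgEquiv.refl → ∀ τ : F →+* ℂ,
          {φ : L →+* ℂ | φ.comp (algebraMap F L) = τ ∧ φ ∈ Φ.1}.ncard +
              {φ : L →+* ℂ | φ.comp (algebraMap F L) = τ.comp (σ * σ').toRingEquiv.toRingHom ∧ φ ∈ Φ.1}.ncard =
            {φ : L →+* ℂ | φ.comp (algebraMap F L) = τ.comp σ.toRingEquiv.toRingHom ∧ φ ∈ Φ.1}.ncard +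
              {φ : L →+* ℂ | φ.comp (algebraMap F L) = τ.comp σ'.toRingEquiv.toRingHom ∧ φ ∈ Φ.1}.ncard)
    (hA : IsCMTypeRealisation Φ A ι θ) (n : ℕ) :
    HodgeConjectureFor (⨁ fun _ : Fin n => A).dim (⨁ fun _ : Fin n => A).X :=
  haveI : Fact (Nat.Prime 3) := ⟨Nat.prime_three⟩
  haveI : Fact (Nat.Prime 5) := ⟨Nat.prime_five⟩
  hodgeConjectureFor_pow_of_forall_of_isCyclotomicExtension (N := 396) (by norm_num) (by decide) (by decide) (by decide)
    units_pow_thirty_threeHundredNinetySix hW hLp hLq hS hA n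

/-- `u³⁰ = 1` for every unit of `ℤ/217`: `(ℤ/217)ˣ ≅ ℤ/6 × ℤ/30` (`217 = 7·31`; kernel decision on residues coprime to `217`).
[cite: Washington1997, Ch. 2 Thm. 2.5] -/
theorem units_pow_thirty_twoHundredSeventeen (u : (ZMod 217)ˣ) : u ^ (2 * (3 * 5)) = 1 := by
  have h : ∀ a : ZMod 217, Nat.Coprime a.val 217 → a ^ 30 = 1 := by decide +kernel
  exact Units.ext (by rw [Units.val_pow_eq_pow_val, h _ (ZMod.val_coe_unit_coprime u), Units.val_one])

/-- **`ℚ(ζ_{217})` (degree `180`, `Gal ≅ ℤ/6 × ℤ/30`, exponent `30`): the rank formula `Rank(Φ) + b(Φ) + 2·e₆(Φ) + 4·e₁₀(Φ) + 8·s₃₀(Φ) = 91`** for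
every CM type — `b` = number of imaginary quadratic subfields over which `Φ` is of Weil type, `e₆` (`e₁₀`) = number of cyclic sextic (decic) CM
subfields over which `Φ` is level of exponent `3` (`5`), `s₃₀` = number of CM subfields of degree `30` over which `Φ` is additively separable.
[cite: Kubota1965, §4 Lemma 2] [cite: Hazama2003CyclicCM, Prop. 4.3 and Thm. 4.8] [cite: Dodson1984, §3.1.1 Theorem] -/
theorem cmTypeRank_add_ncard_subfields_twoHundredSeventeen [IsCyclotomicExtension {217} ℚ L] (Φ : CMType L) :
    cmTypeRank Φ + {F : IntermediateField ℚ L | Module.finrank ℚ F = 2 ∧ ¬ IsTotallyReal F ∧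
        ∀ τ : F →+* ℂ, {φ : L →+* ℂ | φ.comp (algebraMap F L) = τ ∧ φ ∈ Φ.1}.ncard =
          {φ : L →+* ℂ | φ.comp (algebraMap F L) = τ ∧ φ ∉ Φ.1}.ncard}.ncard +
      2 * {F : IntermediateField ℚ L | Module.finrank ℚ F = 6 ∧ ¬ IsTotallyReal F ∧
        ∀ σ : F ≃ₐ[ℚ] F, σ ^ (3 : ℕ) = AlgEquiv.refl → ∀ τ : F →+* ℂ,
          {φ : L →+* ℂ | φ.comp (algebraMap F L) = τ.comp σ.toRingEquiv.toRingHom ∧ φ ∈ Φ.1}.ncard =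
            {φ : L →+* ℂ | φ.comp (algebraMap F L) = τ ∧ φ ∈ Φ.1}.ncard}.ncard +
      4 * {F : IntermediateField ℚ L | Module.finrank ℚ F = 10 ∧ ¬ IsTotallyReal F ∧
        ∀ σ : F ≃ₐ[ℚ] F, σ ^ (5 : ℕ) = AlgEquiv.refl → ∀ τ : F →+* ℂ,
          {φ : L →+* ℂ | φ.comp (algebraMap F L) = τ.comp σ.toRingEquiv.toRingHom ∧ φ ∈ Φ.1}.ncard =
            {φ : L →+* ℂ | φ.comp (algebraMap F L) = τ ∧ φ ∈ Φ.1}.ncard}.ncard +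
      8 * {F : IntermediateField ℚ L | Module.finrank ℚ F = 30 ∧ ¬ IsTotallyReal F ∧
        ∀ σ σ' : F ≃ₐ[ℚ] F, σ ^ (3 : ℕ) = AlgEquiv.refl → σ' ^ (5 : ℕ) = AlgEquiv.refl → ∀ τ : F →+* ℂ,
          {φ : L →+* ℂ | φ.comp (algebraMap F L) = τ ∧ φ ∈ Φ.1}.ncard +
              {φ : L →+* ℂ | φ.comp (algebraMap F L) = τ.comp (σ * σ').toRingEquiv.toRingHom ∧ φ ∈ Φ.1}.ncard =
            {φ : L →+* ℂ | φ.comp (algebraMap F L) = τ.comp σ.toRingEquiv.toRingHom ∧ φ ∈ Φ.1}.ncard +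
              {φ : L →+* ℂ | φ.comp (algebraMap F L) = τ.comp σ'.toRingEquiv.toRingHom ∧ φ ∈ Φ.1}.ncard}.ncard = 91 := by
  haveI : Fact (Nat.Prime 3) := ⟨Nat.prime_three⟩
  haveI : Fact (Nat.Prime 5) := ⟨Nat.prime_five⟩
  have h := cmTypeRank_add_ncard_subfields_eq_of_isCyclotomicExtension (L := L) (N := 217) (by norm_num)
    (by decide : (3 : ℕ) ≠ 5) (by decide : (3 : ℕ) ≠ 2) (by decide : (5 : ℕ) ≠ 2) units_pow_thirty_twoHundredSeventeen Φ
  have hN : Nat.totient 217 = 180 := by decide +kernel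
  rw [hN] at h
  exact h

/-- **`ℚ(ζ_{217})`: THE HODGE CONJECTURE FOR ALL POWERS of every abelian variety with complex multiplication by `ℚ(ζ_{217})` (CM `90`-folds)
whose type is of Weil type over none of the imaginary quadratic subfields, level over none of the sextic and decic CM subfields and additively
separable over none of the CM subfields of degree `30`** — UNCONDITIONAL. [cite: Gordon1999HodgeAVSurvey, Thm. 6.4 and §9.3] [cite: Kubota1965, §4 Lemma 2] -/
theorem hodgeConjectureFor_pow_of_forall_twoHundredSeventeen [IsCyclotomicExtension {217} ℚ L]
    (hW : ∀ F : IntermediateField ℚ L, Module.finrank ℚ F = 2 → ¬ IsTotallyReal F →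
        ¬ ∀ τ : F →+* ℂ, {φ : L →+* ℂ | φ.comp (algebraMap F L) = τ ∧ φ ∈ Φ.1}.ncard =
          {φ : L →+* ℂ | φ.comp (algebraMap F L) = τ ∧ φ ∉ Φ.1}.ncard)
    (hLp : ∀ F : IntermediateField ℚ L, Module.finrank ℚ F = 2 * 3 → ¬ IsTotallyReal F →
        ¬ ∀ σ : F ≃ₐ[ℚ] F, σ ^ (3 : ℕ) = AlgEquiv.refl → ∀ τ : F →+* ℂ,
          {φ : L →+* ℂ | φ.comp (algebraMap F L) = τ.comp σ.toRingEquiv.toRingHom ∧ φ ∈ Φ.1}.ncard =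
            {φ : L →+* ℂ | φ.comp (algebraMap F L) = τ ∧ φ ∈ Φ.1}.ncard)
    (hLq : ∀ F : IntermediateField ℚ L, Module.finrank ℚ F = 2 * 5 → ¬ IsTotallyReal F →
        ¬ ∀ σ : F ≃ₐ[ℚ] F, σ ^ (5 : ℕ) = AlgEquiv.refl → ∀ τ : F →+* ℂ,
          {φ : L →+* ℂ | φ.comp (algebraMap F L) = τ.comp σ.toRingEquiv.toRingHom ∧ φ ∈ Φ.1}.ncard =
            {φ : L →+* ℂ | φ.comp (algebraMap F L) = τ ∧ φ ∈ Φ.1}.ncard)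
    (hS : ∀ F : IntermediateField ℚ L, Module.finrank ℚ F = 2 * (3 * 5) → ¬ IsTotallyReal F →
        ¬ ∀ σ σ' : F ≃ₐ[ℚ] F, σ ^ (3 : ℕ) = AlgEquiv.refl → σ' ^ (5 : ℕ) = AlgEquiv.refl → ∀ τ : F →+* ℂ,
          {φ : L →+* ℂ | φ.comp (algebraMap F L) = τ ∧ φ ∈ Φ.1}.ncard +
              {φ : L →+* ℂ | φ.comp (algebraMap F L) = τ.comp (σ * σ').toRingEquiv.toRingHom ∧ φ ∈ Φ.1}.ncard =
            {φ : L →+* ℂ | φ.comp (algebraMap F L) = τ.comp σ.toRingEquiv.toRingHom ∧ φ ∈ Φ.1}.ncard +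
              {φ : L →+* ℂ | φ.comp (algebraMap F L) = τ.comp σ'.toRingEquiv.toRingHom ∧ φ ∈ Φ.1}.ncard)
    (hA : IsCMTypeRealisation Φ A ι θ) (n : ℕ) :
    HodgeConjectureFor (⨁ fun _ : Fin n => A).dim (⨁ fun _ : Fin n => A).X :=
  haveI : Fact (Nat.Prime 3) := ⟨Nat.prime_three⟩
  haveI : Fact (Nat.Prime 5) := ⟨Nat.prime_five⟩
  hodgeConjectureFor_pow_of_forall_of_isCyclotomicExtension (N := 217) (by norm_num) (by decide) (by decide) (by decide)
    units_pow_thirty_twoHundredSeventeen hW hLp hLq hS hA n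

/-- `u³⁰ = 1` for every unit of `ℤ/279`: `(ℤ/279)ˣ ≅ ℤ/6 × ℤ/30` (`279 = 9·31`; kernel decision on residues coprime to `279`).
[cite: Washington1997, Ch. 2 Thm. 2.5] -/
theorem units_pow_thirty_twoHundredSeventyNine (u : (ZMod 279)ˣ) : u ^ (2 * (3 * 5)) = 1 := by
  have h : ∀ a : ZMod 279, Nat.Coprime a.val 279 → a ^ 30 = 1 := by decide +kernel
  exact Units.ext (by rw [Units.val_pow_eq_pow_val, h _ (ZMod.val_coe_unit_coprime u), Units.val_one])

/-- **`ℚ(ζ_{279})` (degree `180`, `Gal ≅ ℤ/6 × ℤ/30`, exponent `30`): the rank formula `Rank(Φ) + b(Φ) + 2·e₆(Φ) + 4·e₁₀(Φ) + 8·s₃₀(Φ) = 91`** for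
every CM type — `b` = number of imaginary quadratic subfields over which `Φ` is of Weil type, `e₆` (`e₁₀`) = number of cyclic sextic (decic) CM
subfields over which `Φ` is level of exponent `3` (`5`), `s₃₀` = number of CM subfields of degree `30` over which `Φ` is additively separable.
[cite: Kubota1965, §4 Lemma 2] [cite: Hazama2003CyclicCM, Prop. 4.3 and Thm. 4.8] [cite: Dodson1984, §3.1.1 Theorem] -/
theorem cmTypeRank_add_ncard_subfields_twoHundredSeventyNine [IsCyclotomicExtension {279} ℚ L] (Φ : CMType L) :
    cmTypeRank Φ + {F : IntermediateField ℚ L | Module.finrank ℚ F = 2 ∧ ¬ IsTotallyReal F ∧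
        ∀ τ : F →+* ℂ, {φ : L →+* ℂ | φ.comp (algebraMap F L) = τ ∧ φ ∈ Φ.1}.ncard =
          {φ : L →+* ℂ | φ.comp (algebraMap F L) = τ ∧ φ ∉ Φ.1}.ncard}.ncard +
      2 * {F : IntermediateField ℚ L | Module.finrank ℚ F = 6 ∧ ¬ IsTotallyReal F ∧
        ∀ σ : F ≃ₐ[ℚ] F, σ ^ (3 : ℕ) = AlgEquiv.refl → ∀ τ : F →+* ℂ,
          {φ : L →+* ℂ | φ.comp (algebraMap F L) = τ.comp σ.toRingEquiv.toRingHom ∧ φ ∈ Φ.1}.ncard =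
            {φ : L →+* ℂ | φ.comp (algebraMap F L) = τ ∧ φ ∈ Φ.1}.ncard}.ncard +
      4 * {F : IntermediateField ℚ L | Module.finrank ℚ F = 10 ∧ ¬ IsTotallyReal F ∧
        ∀ σ : F ≃ₐ[ℚ] F, σ ^ (5 : ℕ) = AlgEquiv.refl → ∀ τ : F →+* ℂ,
          {φ : L →+* ℂ | φ.comp (algebraMap F L) = τ.comp σ.toRingEquiv.toRingHom ∧ φ ∈ Φ.1}.ncard =
            {φ : L →+* ℂ | φ.comp (algebraMap F L) = τ ∧ φ ∈ Φ.1}.ncard}.ncard +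
      8 * {F : IntermediateField ℚ L | Module.finrank ℚ F = 30 ∧ ¬ IsTotallyReal F ∧
        ∀ σ σ' : F ≃ₐ[ℚ] F, σ ^ (3 : ℕ) = AlgEquiv.refl → σ' ^ (5 : ℕ) = AlgEquiv.refl → ∀ τ : F →+* ℂ,
          {φ : L →+* ℂ | φ.comp (algebraMap F L) = τ ∧ φ ∈ Φ.1}.ncard +
              {φ : L →+* ℂ | φ.comp (algebraMap F L) = τ.comp (σ * σ').toRingEquiv.toRingHom ∧ φ ∈ Φ.1}.ncard =
            {φ : L →+* ℂ | φ.comp (algebraMap F L) = τ.comp σ.toRingEquiv.toRingHom ∧ φ ∈ Φ.1}.ncard +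
              {φ : L →+* ℂ | φ.comp (algebraMap F L) = τ.comp σ'.toRingEquiv.toRingHom ∧ φ ∈ Φ.1}.ncard}.ncard = 91 := by
  haveI : Fact (Nat.Prime 3) := ⟨Nat.prime_three⟩
  haveI : Fact (Nat.Prime 5) := ⟨Nat.prime_five⟩
  have h := cmTypeRank_add_ncard_subfields_eq_of_isCyclotomicExtension (L := L) (N := 279) (by norm_num)
    (by decide : (3 : ℕ) ≠ 5) (by decide : (3 : ℕ) ≠ 2) (by decide : (5 : ℕ) ≠ 2) units_pow_thirty_twoHundredSeventyNine Φ
  have hN : Nat.totient 279 = 180 := by decide +kernel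
  rw [hN] at h
  exact h

/-- **`ℚ(ζ_{279})`: THE HODGE CONJECTURE FOR ALL POWERS of every abelian variety with complex multiplication by `ℚ(ζ_{279})` (CM `90`-folds)
whose type is of Weil type over none of the imaginary quadratic subfields, level over none of the sextic and decic CM subfields and additively
separable over none of the CM subfields of degree `30`** — UNCONDITIONAL. [cite: Gordon1999HodgeAVSurvey, Thm. 6.4 and §9.3] [cite: Kubota1965, §4 Lemma 2] -/
theorem hodgeConjectureFor_pow_of_forall_twoHundredSeventyNine [IsCyclotomicExtension {279} ℚ L]
    (hW : ∀ F : IntermediateField ℚ L, Module.finrank ℚ F = 2 → ¬ IsTotallyReal F →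
        ¬ ∀ τ : F →+* ℂ, {φ : L →+* ℂ | φ.comp (algebraMap F L) = τ ∧ φ ∈ Φ.1}.ncard =
          {φ : L →+* ℂ | φ.comp (algebraMap F L) = τ ∧ φ ∉ Φ.1}.ncard)
    (hLp : ∀ F : IntermediateField ℚ L, Module.finrank ℚ F = 2 * 3 → ¬ IsTotallyReal F →
        ¬ ∀ σ : F ≃ₐ[ℚ] F, σ ^ (3 : ℕ) = AlgEquiv.refl → ∀ τ : F →+* ℂ,
          {φ : L →+* ℂ | φ.comp (algebraMap F L) = τ.comp σ.toRingEquiv.toRingHom ∧ φ ∈ Φ.1}.ncard =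
            {φ : L →+* ℂ | φ.comp (algebraMap F L) = τ ∧ φ ∈ Φ.1}.ncard)
    (hLq : ∀ F : IntermediateField ℚ L, Module.finrank ℚ F = 2 * 5 → ¬ IsTotallyReal F →
        ¬ ∀ σ : F ≃ₐ[ℚ] F, σ ^ (5 : ℕ) = AlgEquiv.refl → ∀ τ : F →+* ℂ,
          {φ : L →+* ℂ | φ.comp (algebraMap F L) = τ.comp σ.toRingEquiv.toRingHom ∧ φ ∈ Φ.1}.ncard =
            {φ : L →+* ℂ | φ.comp (algebraMap F L) = τ ∧ φ ∈ Φ.1}.ncard)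
    (hS : ∀ F : IntermediateField ℚ L, Module.finrank ℚ F = 2 * (3 * 5) → ¬ IsTotallyReal F →
        ¬ ∀ σ σ' : F ≃ₐ[ℚ] F, σ ^ (3 : ℕ) = AlgEquiv.refl → σ' ^ (5 : ℕ) = AlgEquiv.refl → ∀ τ : F →+* ℂ,
          {φ : L →+* ℂ | φ.comp (algebraMap F L) = τ ∧ φ ∈ Φ.1}.ncard +
              {φ : L →+* ℂ | φ.comp (algebraMap F L) = τ.comp (σ * σ').toRingEquiv.toRingHom ∧ φ ∈ Φ.1}.ncard =
            {φ : L →+* ℂ | φ.comp (algebraMap F L) = τ.comp σ.toRingEquiv.toRingHom ∧ φ ∈ Φ.1}.ncard +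
              {φ : L →+* ℂ | φ.comp (algebraMap F L) = τ.comp σ'.toRingEquiv.toRingHom ∧ φ ∈ Φ.1}.ncard)
    (hA : IsCMTypeRealisation Φ A ι θ) (n : ℕ) :
    HodgeConjectureFor (⨁ fun _ : Fin n => A).dim (⨁ fun _ : Fin n => A).X :=
  haveI : Fact (Nat.Prime 3) := ⟨Nat.prime_three⟩
  haveI : Fact (Nat.Prime 5) := ⟨Nat.prime_five⟩
  hodgeConjectureFor_pow_of_forall_of_isCyclotomicExtension (N := 279) (by norm_num) (by decide) (by decide) (by decide)
    units_pow_thirty_twoHundredSeventyNine hW hLp hLq hS hA n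

end Cyclotomic

end ExponentTwoOddPrimes

end Literature.AlgebraicGeometry.Pohlmann1968

end
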